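import Mathlib
import Literature.Analysis.FunctionSpaces.BesselJAnalyticProofs
import Literature.NumberTheory.Sieve.BombieriFriedlanderIwaniecKuznetsovBoundFromSpectral
import HarnessLib

/-!
# The Kuznetsov–Bessel transforms and the transform bounds of Deshouillers–Iwaniec (hypothesis (W))

Companion of `Literature.NumberTheory.Sieve.BombieriFriedlanderIwaniecKuznetsovBoundFromSpectral`: that
file reduces the Bombieri–Friedlander–Iwaniec cone (`…Theorem5_of_kuznetsov`, `H91At_of_kuznetsov`)
to an abstract Kuznetsov package `(D, W)` with eleven hypotheses, one of which — (W)
`TransformBound W`, the bounds of [DeshouillersIwaniec1982, Lemma 7.1] for the three integral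
transforms `φ̃, φ̌, φ̇` of Kuznetsov's formula — concerns the transforms alone.  Here we DEFINE the
genuine transforms (`BFI.L1.kuzTransforms`) and PROVE (W) for them
(`BFI.L1.transformBound_kuzTransforms`), sorry-free.  Nothing is vendored; no fact is introduced.

## The transforms

For a test function `φ` put `P(w) = ∫ cos(wx) φ(x) dx/x` (`Kuz.IsTest.Pk φ 0`, see
`Kuz.IsTest.Pk_zero_eq_integral_cos`).  Following [Drappeau2017, (4.11)–(4.13), `κ = 0`] (the
normalisation fixed in `KuzPlus`/`KuzMinus`):

* `φ̃(t) = (2πi/sinh πt) ∫₀^∞ (J_{2it}(x) − J_{−2it}(x)) φ(x) dx/x = 4 ∫_ℝ cos(2tξ) P(cosh ξ) dξ`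
  (`Tpl`), by the Mehler–Sonine representation
  `(J_{2it} − J_{−2it})(x) = −(4i/π) sinh(πt) ∫₀^∞ cos(x cosh ξ) cos(2tξ) dξ`
  [Watson1944, §6.21; DeshouillersIwaniec1982, p. 264 ("we appeal to the Mehler–Sonine formula")];
* `φ̌(t) = 8 cosh(πt) ∫₀^∞ K_{2it}(x) φ(x) dx/x = 4 ∫_ℝ cos(2tξ) P(sinh ξ) dξ` (`Tmi`), by
  `cosh(πt) K_{2it}(x) = ∫₀^∞ cos(x sinh ξ) cos(2tξ) dξ` [Watson1944, §6.22; DeshouillersIwaniec1982, p. 264];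
* `φ̃(iy), φ̌(iy)` (`TplX`, `TmiX`): the same with `cosh(2yξ)` in place of `cos(2tξ)` (`0 < y < 1/2`);
* `φ̇(k) = 4 i^k ∫₀^∞ J_{k−1}(x) φ(x) dx/x` (`Thol`, with the tree's `besselJ`).

The `ξ`-integrals of the Bessel kernels are only conditionally convergent; integrating against `φ`
first makes everything absolutely convergent, and we take the resulting double integrals as the
definitions.  The identification with the Bessel-function form (an exchange of integrations,
legitimate by the uniform boundedness of the truncated kernel integrals) is classical and is not used
here; it is the business of whoever instantiates `KuzPlus`/`KuzMinus` with Fourier coefficients.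

## The bounds (proof of `TransformBoundAt kuzTransforms 6144000`)

For `φ` smooth, supported in `[X, 2X]`, with `|φ^{(j)}| ≤ X^{-j}` (`j ≤ 4`) — the bundle
`Kuz.IsTest X φ`:

1. `ψ_n(x) = (−ix)^n φ(x)/x` has `|ψ_n^{(m)}| ≤ 1536 X^{n−1−m}` on `[X, 2X]` (Leibniz), hence the
   Fourier bounds `|w|^m |𝓐ψ_n(w)| ≤ 1536 X^{n−m}` (`𝓐 g (w) = 𝓕 g (w/2π)`, Mathlib's
   `Real.fourier_iteratedDeriv`), i.e. `|P^{(k)}(w)| ≤ 1536 X^k / max(1, X|w|)^m` (`k ≤ 3`, `m ≤ 4`).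
2. `H₊ = P ∘ cosh`, `H₋ = P ∘ sinh` are smooth with `|H₊'''| ≤ 7680/max(1, X cosh ξ)`,
   `|H₋'''| ≤ 6144 sinhProf`, and the real-variable estimates `∫ dξ/max(1, X cosh ξ) ≪ Λ(X)`,
   `∫ cosh(2yξ) dξ/max(1, X cosh ξ) ≪ Λ(X)(1 + X^{−2y})`, `∫ sinhProf ≪ (1+|log X|)(1+X)²`
   (three regions `|ξ| ≤ 1`, `1 ≤ |ξ| ≤ L`, `|ξ| > L` with `L ≍ log(1/X)`), `Λ(X) = (1+|log X|)/(1+X)`.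
3. `4 ∫ cos(2tξ) H = 2(𝓐H(2t) + 𝓐H(−2t))`, so its norm is `≤ ∫|H'''|/(2|t|³)`: the cubic decay in
   `t`; together with the trivial bound this gives `≤ A Λ(X) min(1, ((1+X)/(1+|t|))³)`.
4. `φ̇(k)`: Bessel's integral in the exponential form `J_n(x) = (2π)⁻¹ ∫_{−π}^{π} e^{i(nθ − x sin θ)} dθ`
   (from the tree's `besselJ_eq_integral_cos_holds`), Fubini, and three integrations by parts against
   `e^{inθ}` over a period (`Q = 𝓐ψ₀ ∘ sin` and its first two derivatives are `2π`-periodic):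
   `|∫ J_n ψ₀| ≤ (2π)⁻¹ ∫_{−π}^{π} |Q'''| / n³ ≪ Λ(X)(1+X)³/n³`, and `≪ Λ(X)` uniformly (Jordan's
   inequality on four quarter periods for `∫ dθ/max(1, X|sin θ|)`).

The absolute constant `6144000` is of no importance.

## References

* [DeshouillersIwaniec1982] J.-M. Deshouillers, H. Iwaniec, *Kloosterman sums and Fourier
  coefficients of cusp forms*, Invent. Math. 70 (1982), 219–288: Lemma 7.1 (7.1)–(7.4) and its proof,
  pp. 264–267; (1.21)–(1.23).
* [Drappeau2017] S. Drappeau, *Sums of Kloosterman sums in arithmetic progressions, and the error term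
  in the dispersion method*, Proc. LMS 114 (2017): §4.1.3 (4.11)–(4.14), Lemma 4.4.
* [Watson1944] G. N. Watson, *A treatise on the theory of Bessel functions*, 2nd ed., CUP 1944:
  §2.2 (1) (Bessel's integral), §6.21–6.22 (Mehler–Sonine and Schläfli-type representations).

Mathlib: `Real.fourier_iteratedDeriv`, `Real.hasDerivAt_fourier`, `Real.contDiff_fourier`,
`VectorFourier.norm_fourierIntegral_le_integral_norm`, `iteratedDeriv_mul` (Leibniz),
`iter_deriv_zpow`, `MeasureTheory.intervalIntegral_integral_swap`,
`intervalIntegral.integral_mul_deriv_eq_deriv_mul`, `Real.mul_le_sin`, `integral_exp_mul_Ioi/Iic`,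
`integral_inv`.  Literature: `besselJ`, `besselJ_eq_integral_cos_holds`
(`Literature.Analysis.FunctionSpaces.BesselJ(AnalyticProofs)`); `KuzTransforms`, `TransformBoundAt`,
`TransformBound`, `LamT`, `omegaT` (`…KuznetsovBoundFromSpectral`).
-/

noncomputable section

open MeasureTheory Set Filter Real Complex
open scoped Topology FourierTransform ContDiff

namespace Literature.NumberTheory.Sieve.BFI.L1.Kuz

/-- `𝓐 g w = ∫ e^{-iwx} g(x) dx = 𝓕 g (w / 2π)`: the Fourier transform in the frequency
normalisation of the Kuznetsov kernels. [folklore] -/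
def four (g : ℝ → ℂ) (w : ℝ) : ℂ := 𝓕 g (w / (2 * π))

/-- `𝓐 g w = ∫ e^{-iwx} g(x) dx`. [folklore] -/
theorem four_eq_integral (g : ℝ → ℂ) (w : ℝ) :
    four g w = ∫ x : ℝ, Complex.exp (-(I * w * x)) * g x := by
  rw [four, Real.fourier_real_eq_integral_exp_smul]
  congr 1; funext x
  rw [smul_eq_mul]
  congr 1
  have h1 : -2 * π * x * (w / (2 * π)) = -(w * x) := by
    field_simp
  rw [h1]; push_cast; ring_nf

/-- `‖𝓐 g w‖ ≤ ∫ ‖g‖`. [folklore] -/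
theorem norm_four_le (g : ℝ → ℂ) (w : ℝ) : ‖four g w‖ ≤ ∫ x, ‖g x‖ := by
  rw [four]
  exact VectorFourier.norm_fourierIntegral_le_integral_norm _ _ _ _ _

/-- `tsupport (iteratedDeriv k g) ⊆ tsupport g`. [folklore] -/
theorem tsupport_iteratedDeriv_subset' (g : ℝ → ℂ) : ∀ k : ℕ, tsupport (iteratedDeriv k g) ⊆ tsupport g
  | 0 => by simp
  | k + 1 => by
      rw [iteratedDeriv_succ]
      exact tsupport_deriv_subset.trans (tsupport_iteratedDeriv_subset' g k)

/-- Iterated derivatives of a compactly supported function have compact support. [folklore] -/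
private theorem hasCompactSupport_iteratedDeriv {g : ℝ → ℂ} (hg : HasCompactSupport g) (k : ℕ) :
    HasCompactSupport (iteratedDeriv k g) :=
  hg.mono' ((subset_tsupport _).trans (tsupport_iteratedDeriv_subset' g k))

/-- Iterated derivatives of a smooth compactly supported function are integrable. [folklore] -/
private theorem integrable_iteratedDeriv {g : ℝ → ℂ} (hg : ContDiff ℝ ∞ g) (hgc : HasCompactSupport g) (k : ℕ) :
    Integrable (iteratedDeriv k g) :=
  ((hg.continuous_iteratedDeriv k (by exact_mod_cast le_top))).integrable_of_hasCompactSupport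
    (hasCompactSupport_iteratedDeriv hgc k)

/-- `x ↦ x^n g(x)` is integrable for smooth compactly supported `g`. [folklore] -/
theorem integrable_pow_mul_norm {g : ℝ → ℂ} (hg : Continuous g) (hgc : HasCompactSupport g) (n : ℕ) :
    Integrable (fun v : ℝ => ‖v‖ ^ n * ‖g v‖) := by
  have h1 : Continuous fun v : ℝ => ‖v‖ ^ n * ‖g v‖ := by fun_prop
  apply h1.integrable_of_hasCompactSupport
  apply hgc.norm.mono'
  · intro v hv
    rw [Function.mem_support] at hv
    apply subset_tsupport
    rw [Function.mem_support]
    intro h0; apply hv; rw [h0, mul_zero]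

/-- `𝓐 g` is smooth. [folklore] -/
theorem contDiff_four {g : ℝ → ℂ} (hg : Continuous g) (hgc : HasCompactSupport g) : ContDiff ℝ ∞ (four g) := by
  have h : ContDiff ℝ ∞ (𝓕 g) := Real.contDiff_fourier (N := (⊤ : ℕ∞)) fun n _ => integrable_pow_mul_norm hg hgc n
  unfold four
  exact h.comp (contDiff_id.div_const _)

/-- `𝓐 g` is continuous. [folklore] -/
theorem continuous_four {g : ℝ → ℂ} (hg : Continuous g) (hgc : HasCompactSupport g) : Continuous (four g) :=
  (contDiff_four hg hgc).continuous

/-- The derivative of `𝓐 g`: `(𝓐 g)' = 𝓐 (x ↦ -i x g(x))`. [folklore] -/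
theorem hasDerivAt_four {g : ℝ → ℂ} (hg : Continuous g) (hgc : HasCompactSupport g) (w : ℝ) :
    HasDerivAt (four g) (four (fun x : ℝ => -(I * x) * g x) w) w := by
  have hi : Integrable g := hg.integrable_of_hasCompactSupport hgc
  have hi' : Integrable (fun x : ℝ => x • g x) := by
    have hc : Continuous fun x : ℝ => x • g x := by fun_prop
    apply hc.integrable_of_hasCompactSupport
    exact hgc.mono' (by
      intro v hv
      apply subset_tsupport
      rw [Function.mem_support] at hv ⊢
      intro h0; apply hv; rw [h0, smul_zero])
  have hF := Real.hasDerivAt_fourier hi hi' (w / (2 * π))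
  -- chain rule with `w ↦ w / (2π)`
  have hlin : HasDerivAt (fun w : ℝ => w / (2 * π)) (1 / (2 * π)) w := by
    simpa using (hasDerivAt_id w).div_const (2 * π)
  have hcomp := hF.scomp w hlin
  have hfun : four g = (𝓕 g) ∘ fun w : ℝ => w / (2 * π) := rfl
  rw [hfun]
  refine hcomp.congr_deriv ?_
  -- identify the derivative value
  rw [four_eq_integral, Real.fourier_real_eq_integral_exp_smul, ← integral_smul]
  refine integral_congr_ae (Filter.Eventually.of_forall fun v => ?_)
  simp only [smul_eq_mul, Complex.real_smul]
  have hπ : (π : ℂ) ≠ 0 := by exact_mod_cast Real.pi_ne_zero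
  have h1 : (↑(-2 * π * v * (w / (2 * π))) : ℂ) * I = -(I * w * v) := by
    have : -2 * π * v * (w / (2 * π)) = -(w * v) := by field_simp
    rw [this]; push_cast; ring
  rw [h1]
  push_cast
  field_simp

/-- **Decay of `𝓐 g` from smoothness**: `|w|^m ‖𝓐 g w‖ ≤ ∫ ‖g^{(m)}‖` for smooth compactly
supported `g` (the Fourier transform of `g^{(m)}` is `(iw)^m 𝓐 g`). [folklore] -/
theorem pow_mul_norm_four_le {g : ℝ → ℂ} (hg : ContDiff ℝ ∞ g) (hgc : HasCompactSupport g) (m : ℕ) (w : ℝ) :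
    |w| ^ m * ‖four g w‖ ≤ ∫ x, ‖iteratedDeriv m g x‖ := by
  have hint : ∀ n : ℕ, (n : ℕ∞) ≤ (⊤ : ℕ∞) → Integrable (iteratedDeriv n g) := fun n _ =>
    integrable_iteratedDeriv hg hgc n
  have key := Real.fourier_iteratedDeriv (N := (⊤ : ℕ∞)) (n := m) hg hint le_top
  have hval := congrFun key (w / (2 * π))
  -- `𝓕 (g^{(m)}) (w/2π) = (i w)^m • 𝓕 g (w/2π)`
  have hnorm : ‖𝓕 (iteratedDeriv m g) (w / (2 * π))‖ = |w| ^ m * ‖four g w‖ := by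
    rw [hval, norm_smul, four]
    congr 1
    rw [norm_pow]
    congr 1
    have hπ : (π : ℂ) ≠ 0 := by exact_mod_cast Real.pi_ne_zero
    have : (2 * π * I * ↑(w / (2 * π)) : ℂ) = I * w := by push_cast; field_simp
    rw [this, norm_mul, Complex.norm_I, one_mul, Complex.norm_real, Real.norm_eq_abs]
  rw [← hnorm]
  exact VectorFourier.norm_fourierIntegral_le_integral_norm _ _ _ _ _

/-- The product `x ↦ -(ix) g(x)` is smooth and compactly supported. [folklore] -/
theorem contDiff_negIx_mul {g : ℝ → ℂ} (hg : ContDiff ℝ ∞ g) : ContDiff ℝ ∞ fun x : ℝ => -(I * x) * g x := by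
  have : ContDiff ℝ ∞ fun x : ℝ => -(I * (x : ℂ)) := by
    have h1 : ContDiff ℝ ∞ fun x : ℝ => (x : ℂ) := Complex.ofRealCLM.contDiff
    exact (contDiff_const.mul h1).neg
  exact this.mul hg

/-- Products with a compactly supported factor are compactly supported. [folklore] -/
theorem hasCompactSupport_mul_left' {g : ℝ → ℂ} (hgc : HasCompactSupport g) (h : ℝ → ℂ) :
    HasCompactSupport fun x => h x * g x :=
  hgc.mul_left


/-- The hypotheses on the test function in `TransformBoundAt`: `X > 0`, `φ` smooth, supported in
`[X, 2X]`, with `‖φ^{(j)}‖ ≤ X^{-j}` for `j ≤ 4`. [cite: DeshouillersIwaniec1982, (1.43)–(1.44)] -/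
structure IsTest (X : ℝ) (φ : ℝ → ℂ) : Prop where
  pos : 0 < X
  smooth : ContDiff ℝ ∞ φ
  supp : ∀ x, φ x ≠ 0 → x ∈ Set.Icc X (2 * X)
  bound : ∀ j ≤ 4, ∀ x, ‖iteratedDeriv j φ x‖ ≤ X ^ (-(j : ℝ))

namespace IsTest

variable {X : ℝ} {φ : ℝ → ℂ} (h : IsTest X φ)
include h

/-- `tsupport φ ⊆ [X, 2X]`. [folklore] -/
theorem tsupport_subset : tsupport φ ⊆ Set.Icc X (2 * X) :=
  closure_minimal (fun x hx => h.supp x hx) isClosed_Icc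

/-- `φ` has compact support. [folklore] -/
private theorem hasCompactSupport : HasCompactSupport φ :=
  HasCompactSupport.of_support_subset_isCompact isCompact_Icc fun x hx => h.supp x hx

/-- `φ` vanishes off `[X, 2X]`. [folklore] -/
theorem eq_zero {x : ℝ} (hx : x ∉ Set.Icc X (2 * X)) : φ x = 0 := by
  by_contra hne; exact hx (h.supp x hne)

/-- `φ` is continuous. [folklore] -/
private theorem continuous : Continuous φ := h.smooth.continuous

/-- All derivatives vanish off `[X, 2X]`. [folklore] -/
theorem iteratedDeriv_eq_zero (j : ℕ) {x : ℝ} (hx : x ∉ Set.Icc X (2 * X)) : iteratedDeriv j φ x = 0 := by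
  have hx' : x ∉ tsupport φ := fun h' => hx (h.tsupport_subset h')
  have h0 : iteratedFDeriv ℝ j φ x = 0 := by
    by_contra hne
    exact hx' (support_iteratedFDeriv_subset j (Function.mem_support.mpr hne))
  rw [iteratedDeriv, h0]; rfl

/-- `‖φ^{(j)}(x)‖ ≤ X^{-j}` as an integer power. [folklore] -/
theorem norm_iteratedDeriv_le {j : ℕ} (hj : j ≤ 4) (x : ℝ) : ‖iteratedDeriv j φ x‖ ≤ X ^ (-(j : ℤ)) := by
  have := h.bound j hj x
  rwa [show (X : ℝ) ^ (-(j : ℝ)) = X ^ (-(j : ℤ)) by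
    rw [← Real.rpow_intCast]; push_cast; ring_nf] at this

/-- In particular `‖φ‖ ≤ 1`. [folklore] -/
theorem norm_le_one (x : ℝ) : ‖φ x‖ ≤ 1 := by
  have := h.bound 0 (by norm_num) x
  simpa using this

/-! ### The weighted functions `ψ_n` -/

omit h in
/-- `ψ_n(x) = (-ix)^n φ(x)/x`. [folklore] -/
def psi (φ : ℝ → ℂ) (n : ℕ) (x : ℝ) : ℂ := (-(I * x)) ^ n * (φ x / x)

/-- `ψ_n` vanishes off `[X, 2X]`. [folklore] -/
theorem psi_eq_zero {n : ℕ} {x : ℝ} (hx : x ∉ Set.Icc X (2 * X)) : psi φ n x = 0 := by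
  rw [psi, h.eq_zero hx, zero_div, mul_zero]

/-- `ψ_n` has compact support. [folklore] -/
theorem hasCompactSupport_psi (n : ℕ) : HasCompactSupport (psi φ n) :=
  HasCompactSupport.of_support_subset_isCompact isCompact_Icc fun x hx => by
    by_contra hx'; exact hx (h.psi_eq_zero hx')

/-- `x ↦ φ(x)/x` is smooth (`φ` vanishes near `0`). [folklore] -/
theorem contDiff_div : ContDiff ℝ ∞ fun x : ℝ => φ x / (x : ℂ) := by
  rw [contDiff_iff_contDiffAt]
  intro x
  by_cases hx : x < X
  · -- `φ / id` vanishes near `x`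
    have hev : (fun y : ℝ => φ y / (y : ℂ)) =ᶠ[𝓝 x] fun _ => 0 := by
      filter_upwards [Iio_mem_nhds hx] with y hy
      rw [h.eq_zero (fun hm => absurd hm.1 (not_le.2 hy)), zero_div]
    exact (contDiffAt_const.congr_of_eventuallyEq hev)
  · have hx0 : (x : ℂ) ≠ 0 := by
      have : 0 < x := h.pos.trans_le (not_lt.1 hx)
      exact_mod_cast this.ne'
    have hinv : ContDiffAt ℝ ∞ (fun y : ℝ => (y : ℂ)⁻¹) x :=
      (contDiffAt_inv ℝ hx0).comp x Complex.ofRealCLM.contDiff.contDiffAt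
    have := h.smooth.contDiffAt.mul hinv
    simpa only [div_eq_mul_inv] using this

/-- `ψ_n` is smooth. [folklore] -/
theorem contDiff_psi (n : ℕ) : ContDiff ℝ ∞ (psi φ n) := by
  have h1 : ContDiff ℝ ∞ fun x : ℝ => (-(I * (x : ℂ))) ^ n :=
    (contDiff_const.mul Complex.ofRealCLM.contDiff).neg.pow n
  exact h1.mul h.contDiff_div

/-- `ψ_n` is continuous. [folklore] -/
theorem continuous_psi (n : ℕ) : Continuous (psi φ n) := (h.contDiff_psi n).continuous

/-- `ψ_n` is integrable. [folklore] -/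
theorem integrable_psi (n : ℕ) : Integrable (psi φ n) :=
  (h.continuous_psi n).integrable_of_hasCompactSupport (h.hasCompactSupport_psi n)

omit h in
/-- `-(ix) ψ_n(x) = ψ_{n+1}(x)`. [folklore] -/
theorem negIx_mul_psi (n : ℕ) : (fun x : ℝ => -(I * x) * psi φ n x) = psi φ (n + 1) := by
  funext x; simp only [psi, pow_succ]; ring

/-! ### Iterated derivatives of `y ↦ y^p` restricted to the reals -/

omit h in
/-- The iterated derivatives of a function holomorphic on an open set are holomorphic there. [folklore] -/
private theorem differentiableOn_iteratedDeriv_of_isOpen' {e : ℂ → ℂ} {V : Set ℂ} (hV : IsOpen V)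
    (he : DifferentiableOn ℂ e V) (m : ℕ) : DifferentiableOn ℂ (iteratedDeriv m e) V := by
  induction m with
  | zero => simpa using he
  | succ m ih => rw [iteratedDeriv_succ]; exact ih.deriv hV

omit h in
/-- Restriction to the real axis commutes with iterated derivatives (holomorphic `e` on an open
`V`, real `x ∈ V`). [folklore] -/
theorem iteratedDeriv_comp_ofReal_eq' {e : ℂ → ℂ} {V : Set ℂ} (hV : IsOpen V)
    (he : DifferentiableOn ℂ e V) (m : ℕ) {x : ℝ} (hx : (x : ℂ) ∈ V) :
    iteratedDeriv m (fun y : ℝ => e y) x = iteratedDeriv m e x := by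
  induction m generalizing x with
  | zero => simp
  | succ m ih =>
    have hdiff := differentiableOn_iteratedDeriv_of_isOpen' hV he m
    rw [iteratedDeriv_succ, iteratedDeriv_succ]
    have hev : (iteratedDeriv m fun y : ℝ => e y) =ᶠ[𝓝 x] fun y : ℝ => iteratedDeriv m e y := by
      have : ∀ᶠ y : ℝ in 𝓝 x, (y : ℂ) ∈ V :=
        Complex.continuous_ofReal.continuousAt.preimage_mem_nhds (hV.mem_nhds hx)
      filter_upwards [this] with y hy using ih hy
    rw [hev.deriv_eq]
    have h2 : HasDerivAt (iteratedDeriv m e) (deriv (iteratedDeriv m e) x) x :=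
      ((hdiff _ hx).differentiableAt (hV.mem_nhds hx)).hasDerivAt
    exact h2.comp_ofReal.deriv

omit h in
/-- `‖(y ↦ y^p)^{(i)}(x)‖ = |∏_{l<i} (p - l)| x^{p-i}` for real `x > 0`. [folklore] -/
theorem norm_iteratedDeriv_ofReal_zpow (p : ℤ) (i : ℕ) {x : ℝ} (hx : 0 < x) :
    ‖iteratedDeriv i (fun y : ℝ => (y : ℂ) ^ p) x‖ = |((∏ l ∈ Finset.range i, ((p : ℤ) - l) : ℤ) : ℝ)| * x ^ (p - i) := by
  have hV : IsOpen {z : ℂ | z ≠ 0} := isOpen_ne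
  have he : DifferentiableOn ℂ (fun z : ℂ => z ^ p) {z : ℂ | z ≠ 0} :=
    fun z hz => (differentiableAt_zpow.2 (Or.inl hz)).differentiableWithinAt
  have hxV : (x : ℂ) ∈ {z : ℂ | z ≠ 0} := by
    show (x : ℂ) ≠ 0; exact_mod_cast hx.ne'
  rw [iteratedDeriv_comp_ofReal_eq' hV he i hxV, iteratedDeriv_eq_iterate, iter_deriv_zpow]
  rw [norm_mul]
  congr 1
  · rw [show (∏ l ∈ Finset.range i, ((p : ℂ) - (l : ℂ))) = ((∏ l ∈ Finset.range i, ((p : ℤ) - (l : ℤ)) : ℤ) : ℂ) by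
      push_cast; rfl]
    exact Complex.norm_intCast _
  · have : ((x : ℂ) ^ (p - i) : ℂ) = ((x ^ (p - i) : ℝ) : ℂ) := by push_cast; rfl
    rw [this, Complex.norm_real, Real.norm_eq_abs, abs_of_pos (zpow_pos hx _)]

omit h in
/-- The combinatorial factor `|∏_{l<i} (n-1-l)| ≤ 24` for `n ≤ 3`, `i ≤ 4`. [folklore] -/
theorem abs_prod_le {n i : ℕ} (hn : n ≤ 3) (hi : i ≤ 4) :
    |((∏ l ∈ Finset.range i, (((n : ℤ) - 1 : ℤ) - l) : ℤ) : ℝ)| ≤ 24 := by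
  rw [← Int.cast_abs]
  have : |(∏ l ∈ Finset.range i, (((n : ℤ) - 1 : ℤ) - l) : ℤ)| ≤ 24 := by
    interval_cases n <;> interval_cases i <;> simp [Finset.prod_range_succ]
  exact_mod_cast this

omit h in
/-- `x^e ≤ 4 X^e` for `x ∈ [X, 2X]` and `-5 ≤ e ≤ 2`. [folklore] -/
theorem zpow_le_four_mul {X x : ℝ} (hX : 0 < X) (hx : x ∈ Set.Icc X (2 * X)) {e : ℤ} (he : e ≤ 2) :
    x ^ e ≤ 4 * X ^ e := by
  have hx0 : 0 < x := hX.trans_le hx.1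
  rcases le_or_gt 0 e with he0 | he0
  · -- `0 ≤ e ≤ 2`
    have h1 : x ^ e ≤ (2 * X) ^ e := by
      lift e to ℕ using he0
      simp only [zpow_natCast]
      exact pow_le_pow_left₀ hx0.le hx.2 _
    have h2 : (2 * X) ^ e = 2 ^ e * X ^ e := mul_zpow _ _ _
    have h3 : (2 : ℝ) ^ e ≤ 4 := by
      calc (2 : ℝ) ^ e ≤ 2 ^ (2 : ℤ) := zpow_le_zpow_right₀ (by norm_num) he
        _ = 4 := by norm_num
    have h4 : 0 ≤ X ^ e := (zpow_pos hX _).le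
    calc x ^ e ≤ 2 ^ e * X ^ e := by rw [← h2]; exact h1
      _ ≤ 4 * X ^ e := mul_le_mul_of_nonneg_right h3 h4
  · -- `e < 0`: antitone in the base
    obtain ⟨k, rfl⟩ : ∃ k : ℕ, e = -(k : ℤ) := ⟨(-e).toNat, by omega⟩
    have h1 : x ^ (-(k : ℤ)) ≤ X ^ (-(k : ℤ)) := by
      simp only [zpow_neg, zpow_natCast]
      exact inv_anti₀ (pow_pos hX k) (pow_le_pow_left₀ hX.le hx.1 k)
    have h4 : 0 ≤ X ^ (-(k : ℤ)) := (zpow_pos hX _).le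
    linarith

/-- **Derivative bounds for `ψ_n`**: `‖ψ_n^{(m)}(x)‖ ≤ 1536 X^{n-1-m}` for `n ≤ 3`, `m ≤ 4` and
`x ∈ [X, 2X]` (Leibniz). [folklore] -/
theorem norm_iteratedDeriv_psi_le {n m : ℕ} (hn : n ≤ 3) (hm : m ≤ 4) {x : ℝ} (hx : x ∈ Set.Icc X (2 * X)) :
    ‖iteratedDeriv m (psi φ n) x‖ ≤ 1536 * X ^ ((n : ℤ) - 1 - m) := by
  have hX := h.pos
  have hx0 : 0 < x := hX.trans_le hx.1
  -- the factor `f(y) = (-i)^n y^{n-1}` near `x`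
  set f : ℝ → ℂ := fun y => (-I) ^ n * (y : ℂ) ^ ((n : ℤ) - 1) with hf
  have hev : psi φ n =ᶠ[𝓝 x] fun y => f y * φ y := by
    filter_upwards [Ioi_mem_nhds hx0] with y hy
    have hy0 : (y : ℂ) ≠ 0 := by exact_mod_cast (ne_of_gt hy)
    simp only [psi, hf]
    rw [zpow_sub_one₀ hy0, zpow_natCast, neg_eq_neg_one_mul, mul_pow, div_eq_mul_inv]
    have : (-I : ℂ) = -1 * I := by ring
    rw [this, mul_pow]
    ring
  rw [hev.iteratedDeriv_eq]
  -- smoothness of the two factors at `x`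
  have hzC : ∀ k : ℕ, ContDiffAt ℝ k (fun y : ℝ => (y : ℂ) ^ ((n : ℤ) - 1)) x := by
    intro k
    have hV : IsOpen {z : ℂ | z ≠ 0} := isOpen_ne
    have he : DifferentiableOn ℂ (fun z : ℂ => z ^ ((n : ℤ) - 1)) {z : ℂ | z ≠ 0} :=
      fun z hz => (differentiableAt_zpow.2 (Or.inl hz)).differentiableWithinAt
    have hxV : {z : ℂ | z ≠ 0} ∈ 𝓝 (x : ℂ) := hV.mem_nhds (by show (x : ℂ) ≠ 0; exact_mod_cast hx0.ne')
    have hz : ContDiffAt ℂ k (fun z : ℂ => z ^ ((n : ℤ) - 1)) (x : ℂ) := (he.analyticAt hxV).contDiffAt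
    exact (hz.restrict_scalars ℝ).comp x Complex.ofRealCLM.contDiff.contDiffAt
  have hfC : ContDiffAt ℝ m f x := contDiffAt_const.mul (hzC m)
  have hφC : ContDiffAt ℝ m φ x := h.smooth.contDiffAt.of_le (by exact_mod_cast le_top)
  rw [iteratedDeriv_fun_mul hfC hφC]
  -- termwise bounds
  have hterm : ∀ i ∈ Finset.range (m + 1),
      ‖(m.choose i : ℂ) * iteratedDeriv i f x * iteratedDeriv (m - i) φ x‖ ≤
        (m.choose i : ℝ) * (96 * X ^ ((n : ℤ) - 1 - m)) := by
    intro i hi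
    have him : i ≤ m := Nat.lt_succ_iff.1 (Finset.mem_range.1 hi)
    have hi4 : i ≤ 4 := him.trans hm
    rw [norm_mul, norm_mul, Complex.norm_natCast]
    -- the factor `f`
    have hfi : ‖iteratedDeriv i f x‖ ≤ 96 * X ^ ((n : ℤ) - 1 - i) := by
      have e1 : iteratedDeriv i f x = (-I) ^ n * iteratedDeriv i (fun y : ℝ => (y : ℂ) ^ ((n : ℤ) - 1)) x := by
        rw [hf]
        exact iteratedDeriv_const_mul _ (hzC i)
      rw [e1, norm_mul, norm_pow, norm_neg, Complex.norm_I, one_pow, one_mul,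
        norm_iteratedDeriv_ofReal_zpow _ _ hx0]
      have h1 := abs_prod_le hn hi4
      have h2 : x ^ (((n : ℤ) - 1) - i) ≤ 4 * X ^ ((n : ℤ) - 1 - i) :=
        zpow_le_four_mul hX hx (by omega)
      have h3 : 0 ≤ x ^ (((n : ℤ) - 1) - i) := (zpow_pos hx0 _).le
      calc |((∏ l ∈ Finset.range i, (((n : ℤ) - 1 : ℤ) - l) : ℤ) : ℝ)| * x ^ (((n : ℤ) - 1) - i)
          ≤ 24 * (4 * X ^ ((n : ℤ) - 1 - i)) := mul_le_mul h1 h2 h3 (by norm_num)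
        _ = 96 * X ^ ((n : ℤ) - 1 - i) := by ring
    -- the factor `φ`
    have hφi : ‖iteratedDeriv (m - i) φ x‖ ≤ X ^ (-((m - i : ℕ) : ℤ)) :=
      h.norm_iteratedDeriv_le (by omega) x
    have hprod : ‖iteratedDeriv i f x‖ * ‖iteratedDeriv (m - i) φ x‖ ≤ 96 * X ^ ((n : ℤ) - 1 - m) := by
      calc ‖iteratedDeriv i f x‖ * ‖iteratedDeriv (m - i) φ x‖
          ≤ (96 * X ^ ((n : ℤ) - 1 - i)) * X ^ (-((m - i : ℕ) : ℤ)) :=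
            mul_le_mul hfi hφi (norm_nonneg _) (by positivity)
        _ = 96 * X ^ ((n : ℤ) - 1 - m) := by
            rw [mul_assoc, ← zpow_add₀ hX.ne']
            congr 2
            omega
    calc (m.choose i : ℝ) * ‖iteratedDeriv i f x‖ * ‖iteratedDeriv (m - i) φ x‖
        = (m.choose i : ℝ) * (‖iteratedDeriv i f x‖ * ‖iteratedDeriv (m - i) φ x‖) := by ring
      _ ≤ (m.choose i : ℝ) * (96 * X ^ ((n : ℤ) - 1 - m)) :=
          mul_le_mul_of_nonneg_left hprod (Nat.cast_nonneg _)
  calc ‖∑ i ∈ Finset.range (m + 1), (m.choose i : ℂ) * iteratedDeriv i f x * iteratedDeriv (m - i) φ x‖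
      ≤ ∑ i ∈ Finset.range (m + 1), ‖(m.choose i : ℂ) * iteratedDeriv i f x * iteratedDeriv (m - i) φ x‖ :=
        norm_sum_le _ _
    _ ≤ ∑ i ∈ Finset.range (m + 1), (m.choose i : ℝ) * (96 * X ^ ((n : ℤ) - 1 - m)) := Finset.sum_le_sum hterm
    _ = (∑ i ∈ Finset.range (m + 1), (m.choose i : ℝ)) * (96 * X ^ ((n : ℤ) - 1 - m)) := by
        rw [Finset.sum_mul]
    _ = 2 ^ m * (96 * X ^ ((n : ℤ) - 1 - m)) := by
        congr 1
        have := Nat.sum_range_choose m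
        exact_mod_cast this
    _ ≤ 16 * (96 * X ^ ((n : ℤ) - 1 - m)) := by
        apply mul_le_mul_of_nonneg_right _ (by positivity)
        calc (2 : ℝ) ^ m ≤ 2 ^ 4 := pow_le_pow_right₀ (by norm_num) hm
          _ = 16 := by norm_num
    _ = 1536 * X ^ ((n : ℤ) - 1 - m) := by ring

/-- The derivatives of `ψ_n` vanish off `[X, 2X]`. [folklore] -/
theorem iteratedDeriv_psi_eq_zero (n j : ℕ) {x : ℝ} (hx : x ∉ Set.Icc X (2 * X)) :
    iteratedDeriv j (psi φ n) x = 0 := by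
  have hts : tsupport (psi φ n) ⊆ Set.Icc X (2 * X) :=
    closure_minimal (fun y hy => by by_contra hy'; exact hy (h.psi_eq_zero hy')) isClosed_Icc
  have hx' : x ∉ tsupport (psi φ n) := fun h' => hx (hts h')
  have h0 : iteratedFDeriv ℝ j (psi φ n) x = 0 := by
    by_contra hne
    exact hx' (support_iteratedFDeriv_subset j (Function.mem_support.mpr hne))
  rw [iteratedDeriv, h0]; rfl

/-- **`L¹` bounds for the derivatives of `ψ_n`**: `∫ ‖ψ_n^{(m)}‖ ≤ 1536 X^{n-m}` (`n ≤ 3`, `m ≤ 4`).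
[folklore] -/
theorem integral_norm_iteratedDeriv_psi_le {n m : ℕ} (hn : n ≤ 3) (hm : m ≤ 4) :
    ∫ x, ‖iteratedDeriv m (psi φ n) x‖ ≤ 1536 * X ^ ((n : ℤ) - m) := by
  have hX := h.pos
  have hvan : ∀ x, x ∉ Set.Icc X (2 * X) → ‖iteratedDeriv m (psi φ n) x‖ = 0 := fun x hx => by
    rw [h.iteratedDeriv_psi_eq_zero n m hx, norm_zero]
  rw [← setIntegral_eq_integral_of_forall_compl_eq_zero (s := Set.Icc X (2 * X)) (fun x hx => hvan x hx)]
  have hbd : ∀ x ∈ Set.Icc X (2 * X), ‖iteratedDeriv m (psi φ n) x‖ ≤ 1536 * X ^ ((n : ℤ) - 1 - m) :=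
    fun x hx => h.norm_iteratedDeriv_psi_le hn hm hx
  calc ∫ x in Set.Icc X (2 * X), ‖iteratedDeriv m (psi φ n) x‖
      ≤ ∫ x in Set.Icc X (2 * X), (1536 * X ^ ((n : ℤ) - 1 - m) : ℝ) := by
        apply setIntegral_mono_on _ _ measurableSet_Icc hbd
        · exact (((h.contDiff_psi n).continuous_iteratedDeriv m (by exact_mod_cast le_top)).norm
            ).integrableOn_Icc
        · exact integrableOn_const (by rw [Real.volume_Icc]; exact ENNReal.ofReal_ne_top)
    _ = 1536 * X ^ ((n : ℤ) - 1 - m) * X := by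
        rw [setIntegral_const, Measure.real, Real.volume_Icc, ENNReal.toReal_ofReal (by linarith),
          smul_eq_mul]
        ring
    _ = 1536 * X ^ ((n : ℤ) - m) := by
        rw [mul_assoc, ← zpow_add_one₀ hX.ne']
        congr 2; ring

end IsTest




/-! ### The cosine/exponential transforms `P_k` and their uniform bounds -/

namespace IsTest

variable {X : ℝ} {φ : ℝ → ℂ} (h : IsTest X φ)
include h

/-- **Fourier bounds for `ψ_n`**: `|w|^m ‖𝓐 ψ_n (w)‖ ≤ 1536 X^{n-m}` (`n ≤ 3`, `m ≤ 4`). [folklore] -/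
theorem pow_mul_norm_four_psi_le {n m : ℕ} (hn : n ≤ 3) (hm : m ≤ 4) (w : ℝ) :
    |w| ^ m * ‖four (psi φ n) w‖ ≤ 1536 * X ^ ((n : ℤ) - m) :=
  (pow_mul_norm_four_le (h.contDiff_psi n) (h.hasCompactSupport_psi n) m w).trans
    (h.integral_norm_iteratedDeriv_psi_le hn hm)

/-- The same in the junk-free form `‖𝓐 ψ_n (w)‖ ≤ 1536 X^n / max(1, X|w|)^m`. [folklore] -/
theorem norm_four_psi_le {n m : ℕ} (hn : n ≤ 3) (hm : m ≤ 4) (w : ℝ) :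
    ‖four (psi φ n) w‖ ≤ 1536 * X ^ n / (max 1 (X * |w|)) ^ m := by
  have hX := h.pos
  have hM1 : 1 ≤ max 1 (X * |w|) := le_max_left _ _
  have hM0 : 0 < max 1 (X * |w|) := by linarith
  rw [le_div_iff₀ (pow_pos hM0 _)]
  rcases le_or_gt (X * |w|) 1 with hle | hgt
  · -- `max = 1`: use `m = 0`
    rw [max_eq_left hle, one_pow, mul_one]
    have := h.pow_mul_norm_four_psi_le hn (Nat.zero_le 4) w
    simp only [pow_zero, one_mul, CharP.cast_eq_zero, sub_zero, zpow_natCast] at this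
    exact this
  · rw [max_eq_right hgt.le]
    have := h.pow_mul_norm_four_psi_le hn hm w
    have hw : 0 < |w| := by
      by_contra h0
      have : |w| = 0 := le_antisymm (not_lt.1 h0) (abs_nonneg w)
      rw [this, mul_zero] at hgt; linarith
    calc ‖four (psi φ n) w‖ * (X * |w|) ^ m = X ^ m * (|w| ^ m * ‖four (psi φ n) w‖) := by ring
      _ ≤ X ^ m * (1536 * X ^ ((n : ℤ) - m)) := mul_le_mul_of_nonneg_left this (by positivity)
      _ = 1536 * X ^ n := by
          rw [show (X ^ m : ℝ) = X ^ (m : ℤ) by simp, mul_left_comm, ← zpow_add₀ hX.ne']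
          simp

omit h in
/-- `P_k(w) = (𝓐 ψ_k (w) + (-1)^k 𝓐 ψ_k (-w)) / 2`: for `k = 0` this is the cosine transform
`∫ cos(wx) φ(x) dx/x`, and `P_{k+1} = P_k'`. [folklore] -/
def Pk (φ : ℝ → ℂ) (k : ℕ) (w : ℝ) : ℂ := (four (psi φ k) w + (-1) ^ k * four (psi φ k) (-w)) / 2

/-- `P_0(w) = ∫ cos(wx) φ(x)/x dx`. [folklore] -/
theorem Pk_zero_eq_integral_cos (w : ℝ) : Pk φ 0 w = ∫ x : ℝ, (Real.cos (w * x) : ℂ) * (φ x / x) := by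
  have hint : ∀ v : ℝ, Integrable fun x : ℝ => Complex.exp (-(I * v * x)) * psi φ 0 x := by
    intro v
    apply (h.integrable_psi 0).bdd_mul (c := 1)
    · exact (Complex.continuous_exp.comp (by fun_prop)).aestronglyMeasurable
    · refine Filter.Eventually.of_forall fun x => ?_
      rw [Complex.norm_exp]
      simp
  rw [Pk, four_eq_integral, four_eq_integral, pow_zero, one_mul, ← integral_add (hint w) (hint (-w)),
    ← integral_div]
  refine integral_congr_ae (Filter.Eventually.of_forall fun x => ?_)
  simp only [psi, pow_zero, one_mul]
  have : (Real.cos (w * x) : ℂ) = (Complex.exp (-(I * w * x)) + Complex.exp (-(I * ↑(-w) * x))) / 2 := by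
    rw [Complex.ofReal_cos, Complex.cos]
    push_cast
    ring_nf
  rw [this]; ring

/-- `P_k' = P_{k+1}`. [folklore] -/
theorem hasDerivAt_Pk (k : ℕ) (w : ℝ) : HasDerivAt (Pk φ k) (Pk φ (k + 1) w) w := by
  have h1 := hasDerivAt_four (h.continuous_psi k) (h.hasCompactSupport_psi k) w
  have h2 := hasDerivAt_four (h.continuous_psi k) (h.hasCompactSupport_psi k) (-w)
  rw [negIx_mul_psi] at h1 h2
  have h2' : HasDerivAt (fun w => four (psi φ k) (-w)) (-four (psi φ (k + 1)) (-w)) w := by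
    have := h2.scomp w (hasDerivAt_neg w)
    have e : ((-1 : ℝ) • four (psi φ (k + 1)) (-w)) = -four (psi φ (k + 1)) (-w) := by simp
    rw [e] at this
    exact this
  have h3 : HasDerivAt (fun x => (four (psi φ k) x + (-1) ^ k * four (psi φ k) (-x)) / 2)
      ((four (psi φ (k + 1)) w + (-1) ^ k * -four (psi φ (k + 1)) (-w)) / 2) w :=
    (h1.add (h2'.const_mul ((-1 : ℂ) ^ k))).div_const 2
  have e : Pk φ k = fun x => (four (psi φ k) x + (-1) ^ k * four (psi φ k) (-x)) / 2 := rfl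
  rw [e]
  refine h3.congr_deriv ?_
  simp only [Pk, pow_succ]
  ring

/-- `P_k` is continuous. [folklore] -/
theorem continuous_Pk (k : ℕ) : Continuous (Pk φ k) := by
  have hc := continuous_four (h.continuous_psi k) (h.hasCompactSupport_psi k)
  unfold Pk
  exact ((hc.add (continuous_const.mul (hc.comp continuous_neg))).div_const _)

/-- **Uniform bounds for `P_k`**: `‖P_k(w)‖ ≤ 1536 X^k / max(1, X|w|)^m` (`k ≤ 3`, `m ≤ 4`). [folklore] -/
theorem norm_Pk_le {k m : ℕ} (hk : k ≤ 3) (hm : m ≤ 4) (w : ℝ) :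
    ‖Pk φ k w‖ ≤ 1536 * X ^ k / (max 1 (X * |w|)) ^ m := by
  have h1 := h.norm_four_psi_le hk hm w
  have h2 := h.norm_four_psi_le hk hm (-w)
  rw [abs_neg] at h2
  unfold Pk
  rw [norm_div, Complex.norm_two]
  calc ‖four (psi φ k) w + (-1) ^ k * four (psi φ k) (-w)‖ / 2
      ≤ (‖four (psi φ k) w‖ + ‖(-1 : ℂ) ^ k * four (psi φ k) (-w)‖) / 2 := by
        gcongr; exact norm_add_le _ _
    _ = (‖four (psi φ k) w‖ + ‖four (psi φ k) (-w)‖) / 2 := by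
        rw [norm_mul, norm_pow, norm_neg, norm_one, one_pow, one_mul]
    _ ≤ _ := by linarith

end IsTest

/-! ### Master integral estimates on `ℝ` -/

/-- `∫_{|ξ| > L} B e^{-b|ξ|}`-type tails: `∫_{Ioi L} e^{-bξ} = e^{-bL}/b`. [folklore] -/
theorem integral_exp_neg_mul_Ioi {b : ℝ} (hb : 0 < b) (L : ℝ) :
    ∫ ξ in Set.Ioi L, Real.exp (-b * ξ) = Real.exp (-b * L) / b := by
  rw [integral_exp_mul_Ioi (by linarith) L]
  field_simp

/-- `∫_{Iic (-L)} e^{bξ} dξ = e^{-bL}/b`. [folklore] -/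
theorem integral_exp_mul_Iic' {b : ℝ} (hb : 0 < b) (L : ℝ) :
    ∫ ξ in Set.Iic (-L), Real.exp (b * ξ) = Real.exp (-b * L) / b := by
  rw [integral_exp_mul_Iic hb]; ring_nf

/-- **Three-region bound**: if `f ≥ 0` is integrable, `f ≤ A` on `1 ≤ |ξ| ≤ L` and
`f ≤ B e^{-b|ξ|}` on `|ξ| > L` (`L ≥ 1`, `b > 0`, `A, B ≥ 0`), then
`∫ f ≤ ∫_{-1}^{1} f + 2(L-1)A + 2Be^{-bL}/b`. [folklore] -/
theorem integral_le_three_regions {f : ℝ → ℝ} (hf : Integrable f)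
    {L A B b : ℝ} (hL : 1 ≤ L) (hb : 0 < b)
    (hmid : ∀ ξ, 1 ≤ |ξ| → |ξ| ≤ L → f ξ ≤ A)
    (hout : ∀ ξ, L < |ξ| → f ξ ≤ B * Real.exp (-b * |ξ|)) :
    ∫ ξ, f ξ ≤ (∫ ξ in (-1 : ℝ)..1, f ξ) + 2 * (L - 1) * A + 2 * B * Real.exp (-b * L) / b := by
  -- split `ℝ = Iic (-L) ∪ Ioc (-L) (-1) ∪ Ioc (-1) 1 ∪ Ioc 1 L ∪ Ioi L` via interval integrals
  have hfi : ∀ s, IntegrableOn f s := fun s => hf.integrableOn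
  -- `∫ = ∫_{Iio (-L)} + ∫_{Ioi (-L)}`
  have e1 : ∫ ξ, f ξ = (∫ ξ in Set.Iio (-L), f ξ) + ∫ ξ in Set.Ioi (-L), f ξ := by
    rw [← setIntegral_univ, ← Set.Iic_union_Ioi (a := -L),
      setIntegral_union (Set.Iic_disjoint_Ioi le_rfl) measurableSet_Ioi (hfi _) (hfi _),
      integral_Iic_eq_integral_Iio]
  -- `∫_{Ioi (-L)} = ∫_{(-L)..L} + ∫_{Ioi L}`
  have e2 : ∫ ξ in Set.Ioi (-L), f ξ = (∫ ξ in (-L : ℝ)..L, f ξ) + ∫ ξ in Set.Ioi L, f ξ := by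
    rw [intervalIntegral.integral_of_le (by linarith), ← setIntegral_union (Set.Ioc_disjoint_Ioi le_rfl)
      measurableSet_Ioi (hfi _) (hfi _), Set.Ioc_union_Ioi_eq_Ioi (by linarith)]
  -- `∫_{(-L)..L} = ∫_{(-L)..(-1)} + ∫_{(-1)..1} + ∫_{1..L}`
  have hii : ∀ a c : ℝ, IntervalIntegrable f volume a c := fun a c => (hf.intervalIntegrable)
  have e3 : ∫ ξ in (-L : ℝ)..L, f ξ =
      (∫ ξ in (-L : ℝ)..(-1), f ξ) + (∫ ξ in (-1 : ℝ)..1, f ξ) + ∫ ξ in (1 : ℝ)..L, f ξ := by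
    rw [intervalIntegral.integral_add_adjacent_intervals (hii _ _) (hii _ _),
      intervalIntegral.integral_add_adjacent_intervals (hii _ _) (hii _ _)]
  -- the middle pieces
  have m1 : ∫ ξ in (1 : ℝ)..L, f ξ ≤ (L - 1) * A := by
    have := intervalIntegral.integral_mono_on hL (hii _ _) (intervalIntegrable_const (c := A))
      (fun ξ hξ => hmid ξ (by rw [abs_of_pos (by linarith [hξ.1])]; exact hξ.1)
        (by rw [abs_of_pos (by linarith [hξ.1])]; exact hξ.2))
    simpa [intervalIntegral.integral_const, smul_eq_mul] using this
  have m2 : ∫ ξ in (-L : ℝ)..(-1), f ξ ≤ (L - 1) * A := by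
    have := intervalIntegral.integral_mono_on (by linarith : -L ≤ -1) (hii _ _) (intervalIntegrable_const (c := A))
      (fun ξ hξ => hmid ξ (by rw [abs_of_neg (by linarith [hξ.2])]; linarith [hξ.2])
        (by rw [abs_of_neg (by linarith [hξ.2])]; linarith [hξ.1]))
    have e : (-1 : ℝ) - -L = L - 1 := by ring
    simpa [intervalIntegral.integral_const, smul_eq_mul, e] using this
  -- the tails
  have hexp1 : IntegrableOn (fun ξ => B * Real.exp (-b * ξ)) (Set.Ioi L) :=
    ((integrableOn_exp_mul_Ioi (by linarith : -b < 0) L).const_mul B)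
  have hexp2 : IntegrableOn (fun ξ => B * Real.exp (b * ξ)) (Set.Iic (-L)) :=
    ((integrableOn_exp_mul_Iic hb (-L)).const_mul B)
  have t1 : ∫ ξ in Set.Ioi L, f ξ ≤ B * Real.exp (-b * L) / b := by
    calc ∫ ξ in Set.Ioi L, f ξ ≤ ∫ ξ in Set.Ioi L, B * Real.exp (-b * ξ) := by
          apply setIntegral_mono_on (hfi _) hexp1 measurableSet_Ioi
          intro ξ hξ
          have hξ' : L < |ξ| := by rw [abs_of_pos (by linarith [hξ.out])]; exact hξ
          have := hout ξ hξ'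
          rwa [abs_of_pos (by linarith [hξ.out] : (0:ℝ) < ξ)] at this
      _ = B * Real.exp (-b * L) / b := by
          rw [integral_const_mul, integral_exp_neg_mul_Ioi hb]; ring
  have t2 : ∫ ξ in Set.Iio (-L), f ξ ≤ B * Real.exp (-b * L) / b := by
    calc ∫ ξ in Set.Iio (-L), f ξ ≤ ∫ ξ in Set.Iio (-L), B * Real.exp (b * ξ) := by
          apply setIntegral_mono_on (hfi _) (hexp2.mono_set Set.Iio_subset_Iic_self) measurableSet_Iio
          intro ξ hξ
          have hlt : ξ < -L := hξ
          have hξ0 : ξ < 0 := by linarith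
          have hξ' : L < |ξ| := by rw [abs_of_neg hξ0]; linarith
          have := hout ξ hξ'
          rwa [abs_of_neg hξ0, show -b * -ξ = b * ξ by ring] at this
      _ = B * Real.exp (-b * L) / b := by
          rw [← integral_Iic_eq_integral_Iio, integral_const_mul, integral_exp_mul_Iic' hb]; ring
  rw [e1, e2, e3]
  have hsum := add_le_add (add_le_add t2 (add_le_add (add_le_add m2 (le_refl (∫ ξ in (-1 : ℝ)..1, f ξ))) m1)) t1
  calc (∫ ξ in Set.Iio (-L), f ξ) +
        ((∫ ξ in (-L : ℝ)..(-1), f ξ) + (∫ ξ in (-1 : ℝ)..1, f ξ) + (∫ ξ in (1 : ℝ)..L, f ξ) + ∫ ξ in Set.Ioi L, f ξ)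
      = (∫ ξ in Set.Iio (-L), f ξ) +
        ((∫ ξ in (-L : ℝ)..(-1), f ξ) + (∫ ξ in (-1 : ℝ)..1, f ξ) + (∫ ξ in (1 : ℝ)..L, f ξ)) + ∫ ξ in Set.Ioi L, f ξ := by
        ring
    _ ≤ B * Real.exp (-b * L) / b + ((L - 1) * A + (∫ ξ in (-1 : ℝ)..1, f ξ) + (L - 1) * A) +
        B * Real.exp (-b * L) / b := hsum
    _ = (∫ ξ in (-1 : ℝ)..1, f ξ) + 2 * (L - 1) * A + 2 * B * Real.exp (-b * L) / b := by ring


/-! ### Elementary inequalities for `cosh`, `sinh`, `exp` -/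

/-- `e^{|ξ|} ≤ 2 cosh ξ`. [folklore] -/
theorem exp_abs_le_two_mul_cosh (ξ : ℝ) : Real.exp |ξ| ≤ 2 * Real.cosh ξ := by
  rw [Real.cosh_eq]
  rcases le_or_gt 0 ξ with h | h
  · rw [abs_of_nonneg h]; linarith [Real.exp_pos (-ξ)]
  · rw [abs_of_neg h]; linarith [Real.exp_pos ξ]

/-- `1/cosh ξ ≤ 2 e^{-|ξ|}`. [folklore] -/
theorem inv_cosh_le (ξ : ℝ) : (Real.cosh ξ)⁻¹ ≤ 2 * Real.exp (-|ξ|) := by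
  have hc := Real.cosh_pos ξ
  rw [inv_le_comm₀ hc (by positivity), Real.exp_neg]
  have := exp_abs_le_two_mul_cosh ξ
  rw [show (2 * (Real.exp |ξ|)⁻¹)⁻¹ = Real.exp |ξ| / 2 by
    field_simp]
  linarith

/-- `cosh ξ ≤ e^{|ξ|}`. [folklore] -/
theorem cosh_le_exp_abs' (ξ : ℝ) : Real.cosh ξ ≤ Real.exp |ξ| := by
  rw [Real.cosh_eq]
  rcases le_or_gt 0 ξ with h | h
  · rw [abs_of_nonneg h]
    have : Real.exp (-ξ) ≤ Real.exp ξ := Real.exp_le_exp.2 (by linarith)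
    linarith
  · rw [abs_of_neg h]
    have : Real.exp ξ ≤ Real.exp (-ξ) := Real.exp_le_exp.2 (by linarith)
    linarith

/-- `cosh(2yξ) ≤ e^{2y|ξ|}` for `y ≥ 0`. [folklore] -/
theorem cosh_two_mul_mul_le {y : ℝ} (hy : 0 ≤ y) (ξ : ℝ) : Real.cosh (2 * y * ξ) ≤ Real.exp (2 * y * |ξ|) := by
  have := cosh_le_exp_abs' (2 * y * ξ)
  rwa [abs_mul, abs_of_nonneg (by positivity : 0 ≤ 2 * y)] at this

/-- `e^{-bx}` restricted to `|x|` is integrable: `∫ e^{-b|x|} dx < ∞` for `b > 0`. [folklore] -/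
theorem integrable_exp_neg_mul_abs {b : ℝ} (hb : 0 < b) : Integrable fun ξ : ℝ => Real.exp (-b * |ξ|) := by
  have h1 : IntegrableOn (fun ξ : ℝ => Real.exp (-b * |ξ|)) (Set.Ioi 0) := by
    refine (integrableOn_exp_mul_Ioi (by linarith : -b < 0) 0).congr_fun (fun ξ hξ => ?_) measurableSet_Ioi
    rw [abs_of_pos hξ]
  have h2 : IntegrableOn (fun ξ : ℝ => Real.exp (-b * |ξ|)) (Set.Iic 0) := by
    refine (integrableOn_exp_mul_Iic hb 0).congr_fun (fun ξ hξ => ?_) measurableSet_Iic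
    rw [abs_of_nonpos hξ]; ring_nf
  have := h2.union h1
  rwa [Set.Iic_union_Ioi, integrableOn_univ] at this

/-- The size factor `Λ(X) = (1 + |log X|)/(1 + X)` (same expression as `BFI.L1.LamT`). [folklore] -/
def Lam (X : ℝ) : ℝ := (1 + |Real.log X|) / (1 + X)

/-- `Λ(X) ≥ 0`. [folklore] -/
theorem Lam_nonneg {X : ℝ} (hX : 0 ≤ X) : 0 ≤ Lam X := by unfold Lam; positivity

/-- For `X ≤ 1`: `1 + |log X| ≤ 2 Λ(X)`. [folklore] -/
theorem one_add_abs_log_le_two_mul_Lam {X : ℝ} (hX : 0 ≤ X) (hX1 : X ≤ 1) : 1 + |Real.log X| ≤ 2 * Lam X := by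
  unfold Lam
  rw [mul_div_assoc', le_div_iff₀ (by linarith)]
  nlinarith [abs_nonneg (Real.log X)]

/-- For `X ≥ 1`: `1/X ≤ 2 Λ(X)`. [folklore] -/
theorem inv_le_two_mul_Lam {X : ℝ} (hX1 : 1 ≤ X) : X⁻¹ ≤ 2 * Lam X := by
  unfold Lam
  rw [mul_div_assoc', inv_eq_one_div, div_le_div_iff₀ (by linarith) (by linarith)]
  nlinarith [abs_nonneg (Real.log X)]

/-- For `X ≥ 1`: `(1 + log X)/X ≤ 2 Λ(X)`. [folklore] -/
theorem one_add_log_div_le_two_mul_Lam {X : ℝ} (hX1 : 1 ≤ X) : (1 + Real.log X) / X ≤ 2 * Lam X := by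
  unfold Lam
  rw [abs_of_nonneg (Real.log_nonneg hX1), mul_div_assoc', div_le_div_iff₀ (by linarith) (by linarith)]
  have := Real.log_nonneg hX1
  nlinarith

/-- Numerical constants: `e^{1/2} ≤ 1.65`, `log 2 ≤ 0.7`. [folklore] -/
private theorem exp_half_le : Real.exp (1 / 2) ≤ 1.65 := by
  have h := Real.exp_one_lt_d9
  have hsq : Real.exp (1 / 2) * Real.exp (1 / 2) = Real.exp 1 := by rw [← Real.exp_add]; norm_num
  nlinarith [Real.exp_pos (1 / 2)]

/-- `log 2 ≤ 0.7`. [folklore] -/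
private theorem log_two_le : Real.log 2 ≤ 0.7 := by linarith [Real.log_two_lt_d9]

/-! ### The `cosh`-profile integrals -/

/-- Global majorant and integrability of `cosh(2yξ)/max(1, X cosh ξ)` (`0 ≤ y ≤ 1/4`). [folklore] -/
theorem cosh_div_max_le_glob {X y : ℝ} (hX : 0 < X) (hy0 : 0 ≤ y) (ξ : ℝ) :
    Real.cosh (2 * y * ξ) * (max 1 (X * Real.cosh ξ))⁻¹ ≤ 2 / X * Real.exp (-(1 - 2 * y) * |ξ|) := by
  have hM0 : 0 < max 1 (X * Real.cosh ξ) := by positivity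
  have h1 : (max 1 (X * Real.cosh ξ))⁻¹ ≤ (X * Real.cosh ξ)⁻¹ :=
    inv_anti₀ (by positivity) (le_max_right _ _)
  have h2 : (X * Real.cosh ξ)⁻¹ ≤ 2 / X * Real.exp (-|ξ|) := by
    rw [mul_inv]
    have := inv_cosh_le ξ
    calc X⁻¹ * (Real.cosh ξ)⁻¹ ≤ X⁻¹ * (2 * Real.exp (-|ξ|)) :=
          mul_le_mul_of_nonneg_left this (inv_nonneg.2 hX.le)
      _ = 2 / X * Real.exp (-|ξ|) := by ring
  have h3 := cosh_two_mul_mul_le hy0 ξ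
  calc Real.cosh (2 * y * ξ) * (max 1 (X * Real.cosh ξ))⁻¹ ≤ Real.exp (2 * y * |ξ|) * (2 / X * Real.exp (-|ξ|)) :=
        mul_le_mul h3 (h1.trans h2) (inv_nonneg.2 hM0.le) (Real.exp_pos _).le
    _ = 2 / X * Real.exp (-(1 - 2 * y) * |ξ|) := by
        rw [show -(1 - 2 * y) * |ξ| = 2 * y * |ξ| + -|ξ| by ring, Real.exp_add]; ring

/-- Continuity of `cosh(2yξ)/max(1, X cosh ξ)`. [folklore] -/
theorem continuous_cosh_div_max (X y : ℝ) :
    Continuous fun ξ : ℝ => Real.cosh (2 * y * ξ) * (max 1 (X * Real.cosh ξ))⁻¹ := by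
  have : Continuous fun ξ => max 1 (X * Real.cosh ξ) := by fun_prop
  exact (Real.continuous_cosh.comp (continuous_const.mul continuous_id)).mul
    (this.inv₀ fun ξ => by positivity)

/-- Integrability of `cosh(2yξ)/max(1, X cosh ξ)` (`0 ≤ y ≤ 1/4`). [folklore] -/
theorem integrable_cosh_div_max {X y : ℝ} (hX : 0 < X) (hy0 : 0 ≤ y) (hy : y ≤ 1 / 4) :
    Integrable fun ξ : ℝ => Real.cosh (2 * y * ξ) * (max 1 (X * Real.cosh ξ))⁻¹ := by
  have hb : 0 < 1 - 2 * y := by linarith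
  refine ((integrable_exp_neg_mul_abs hb).const_mul (2 / X)).mono' (continuous_cosh_div_max X y).aestronglyMeasurable ?_
  refine Filter.Eventually.of_forall fun ξ => ?_
  rw [Real.norm_eq_abs, abs_of_nonneg (mul_nonneg (Real.cosh_pos _).le (inv_nonneg.2 (by positivity)))]
  exact cosh_div_max_le_glob hX hy0 ξ

/-- **`∫ cosh(2yξ)/max(1, X cosh ξ) dξ ≤ 32 Λ(X) (1 + X^{-2y})`** for `0 ≤ y ≤ 1/4`, `X > 0`.
[folklore] -/
theorem integral_cosh_div_max_le {X y : ℝ} (hX : 0 < X) (hy0 : 0 ≤ y) (hy : y ≤ 1 / 4) :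
    ∫ ξ, Real.cosh (2 * y * ξ) * (max 1 (X * Real.cosh ξ))⁻¹ ≤ 32 * Lam X * (1 + X ^ (-2 * y)) := by
  set L : ℝ := max 1 (Real.log (2 / X)) with hL
  have hL1 : 1 ≤ L := le_max_left _ _
  have hL2 : Real.log (2 / X) ≤ L := le_max_right _ _
  have hb : 0 < 1 - 2 * y := by linarith
  set f : ℝ → ℝ := fun ξ => Real.cosh (2 * y * ξ) * (max 1 (X * Real.cosh ξ))⁻¹ with hf
  have hM1 : ∀ ξ, 1 ≤ max 1 (X * Real.cosh ξ) := fun ξ => le_max_left _ _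
  have hM0 : ∀ ξ, 0 < max 1 (X * Real.cosh ξ) := fun ξ => by linarith [hM1 ξ]
  have hf0 : ∀ ξ, 0 ≤ f ξ := fun ξ => mul_nonneg (Real.cosh_pos _).le (inv_nonneg.2 (hM0 ξ).le)
  -- global majorant `(2/X) e^{-(1-2y)|ξ|}` and integrability
  have hglob : ∀ ξ, f ξ ≤ 2 / X * Real.exp (-(1 - 2 * y) * |ξ|) := fun ξ => cosh_div_max_le_glob hX hy0 ξ
  have hint : Integrable f := integrable_cosh_div_max hX hy0 hy
  -- the inner bound `f ≤ e^{2yL} / max(1, X)` on `|ξ| ≤ L`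
  set A : ℝ := Real.exp (2 * y * L) * (max 1 X)⁻¹ with hA
  have hin : ∀ ξ, |ξ| ≤ L → f ξ ≤ A := by
    intro ξ hξ
    have h1 : Real.cosh (2 * y * ξ) ≤ Real.exp (2 * y * L) :=
      (cosh_two_mul_mul_le hy0 ξ).trans (Real.exp_le_exp.2 (by nlinarith))
    have h2 : (max 1 (X * Real.cosh ξ))⁻¹ ≤ (max 1 X)⁻¹ := by
      apply inv_anti₀ (by positivity)
      apply max_le_max le_rfl
      have := Real.one_le_cosh ξ
      nlinarith
    exact mul_le_mul h1 h2 (inv_nonneg.2 (hM0 ξ).le) (Real.exp_pos _).le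
  have hA0 : 0 ≤ A := by positivity
  -- the core `∫_{-1}^{1} f ≤ 2A`
  have hcore : ∫ ξ in (-1 : ℝ)..1, f ξ ≤ 2 * A := by
    have := intervalIntegral.integral_mono_on (by norm_num : (-1 : ℝ) ≤ 1) (hint.intervalIntegrable)
      (intervalIntegrable_const (c := A)) (fun ξ hξ => hin ξ ((abs_le.2 ⟨by linarith [hξ.1], hξ.2⟩).trans hL1))
    calc ∫ ξ in (-1 : ℝ)..1, f ξ ≤ ∫ _ in (-1 : ℝ)..1, A := this
      _ = 2 * A := by rw [intervalIntegral.integral_const, smul_eq_mul]; norm_num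
  -- apply the three-region lemma
  have h3 := integral_le_three_regions hint hL1 hb (A := A) (B := 2 / X)
    (fun ξ _ hξ => hin ξ hξ) (fun ξ hξ => hglob ξ)
  -- `e^{-L} ≤ X/2` and `e^{2yL} ≤ 1.65 (1 + X^{-2y})`
  have heL : Real.exp (-L) ≤ X / 2 := by
    have : Real.log (2 / X) ≤ L := hL2
    have h1 : 2 / X ≤ Real.exp L := by
      rw [← Real.log_le_iff_le_exp (by positivity)]; exact this
    rw [Real.exp_neg, inv_le_comm₀ (Real.exp_pos _) (by positivity)]
    rwa [show (X / 2)⁻¹ = 2 / X by rw [inv_div]]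
  have hXpow0 : 0 ≤ X ^ (-2 * y) := by positivity
  have he2 : Real.exp (2 * y * L) ≤ 1.65 * (1 + X ^ (-2 * y)) := by
    rcases le_or_gt (Real.log (2 / X)) 1 with hc | hc
    · -- `L = 1`
      have hL' : L = 1 := max_eq_left hc
      rw [hL', mul_one]
      have h1 : Real.exp (2 * y) ≤ Real.exp (1 / 2) := Real.exp_le_exp.2 (by linarith)
      nlinarith [exp_half_le]
    · -- `L = log(2/X)`: `e^{2yL} = (2/X)^{2y} = 2^{2y} X^{-2y}`
      have hL' : L = Real.log (2 / X) := max_eq_right hc.le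
      rw [hL', show 2 * y * Real.log (2 / X) = Real.log (2 / X) * (2 * y) by ring,
        ← Real.rpow_def_of_pos (by positivity), Real.div_rpow (by norm_num) hX.le,
        div_eq_mul_inv, ← Real.rpow_neg hX.le, show -(2 * y) = -2 * y by ring]
      have h2 : (2 : ℝ) ^ (2 * y) ≤ 1.65 := by
        calc (2 : ℝ) ^ (2 * y) ≤ 2 ^ ((1 : ℝ) / 2) := Real.rpow_le_rpow_of_exponent_le (by norm_num) (by linarith)
          _ = Real.sqrt 2 := (Real.sqrt_eq_rpow 2).symm
          _ ≤ Real.sqrt (1.65 ^ 2) := Real.sqrt_le_sqrt (by norm_num)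
          _ = 1.65 := Real.sqrt_sq (by norm_num)
      nlinarith
  -- bound `L ≤ 1.7 + |log X|`
  have hLle : L ≤ 1.7 + |Real.log X| := by
    apply max_le
    · linarith [abs_nonneg (Real.log X)]
    · rw [Real.log_div (by norm_num) hX.ne']
      linarith [log_two_le, neg_le_abs (Real.log X)]
  have hΛ0 : 0 ≤ Lam X := Lam_nonneg hX.le
  rcases le_or_gt 1 X with hX1 | hX1
  · -- `X ≥ 1`: then `L = 1`, `A = e^{2y}/X`
    have hlog : Real.log (2 / X) ≤ 1 := by
      rw [Real.log_div (by norm_num) hX.ne']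
      linarith [log_two_le, Real.log_nonneg hX1]
    have hL' : L = 1 := max_eq_left hlog
    have hA' : A = Real.exp (2 * y) * X⁻¹ := by rw [hA, hL', mul_one, max_eq_right hX1]
    have hey : Real.exp (2 * y) ≤ 1.65 := (Real.exp_le_exp.2 (by linarith)).trans exp_half_le
    have het : Real.exp (-(1 - 2 * y) * L) ≤ 1 := by
      rw [Real.exp_le_one_iff]; nlinarith
    have hinv := inv_le_two_mul_Lam hX1
    have hXi : 0 ≤ X⁻¹ := inv_nonneg.2 hX.le
    -- `∫ f ≤ 2A + (4/X) e^{-(1-2y)L}/(1-2y) ≤ 3.3/X + 8/X`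
    have h4 : 2 * (2 / X) * Real.exp (-(1 - 2 * y) * L) / (1 - 2 * y) ≤ 8 * X⁻¹ := by
      rw [div_le_iff₀ hb]
      have : 2 * (2 / X) * Real.exp (-(1 - 2 * y) * L) ≤ 4 * X⁻¹ := by
        rw [div_eq_mul_inv]; nlinarith [Real.exp_pos (-(1 - 2 * y) * L)]
      nlinarith
    calc ∫ ξ, f ξ ≤ (∫ ξ in (-1 : ℝ)..1, f ξ) + 2 * (L - 1) * A + 2 * (2 / X) * Real.exp (-(1 - 2 * y) * L) / (1 - 2 * y) := h3
      _ ≤ 2 * A + 0 + 8 * X⁻¹ := by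
          have hz : 2 * (L - 1) * A = 0 := by rw [hL']; ring
          linarith
      _ ≤ 2 * (1.65 * X⁻¹) + 0 + 8 * X⁻¹ := by rw [hA']; nlinarith
      _ ≤ 11.3 * (2 * Lam X) := by nlinarith
      _ ≤ 32 * Lam X * (1 + X ^ (-2 * y)) := by nlinarith
  · -- `X < 1`: `A = e^{2yL}`
    have hA' : A = Real.exp (2 * y * L) := by rw [hA, max_eq_left hX1.le, inv_one, mul_one]
    have hlogΛ := one_add_abs_log_le_two_mul_Lam hX.le hX1.le
    -- the tail: `(4/X) e^{-(1-2y)L}/(1-2y) ≤ (8/X) e^{-L} e^{2yL} ≤ 4 e^{2yL}`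
    have htail : 2 * (2 / X) * Real.exp (-(1 - 2 * y) * L) / (1 - 2 * y) ≤ 4 * Real.exp (2 * y * L) := by
      rw [div_le_iff₀ hb, show -(1 - 2 * y) * L = -L + 2 * y * L by ring, Real.exp_add]
      have h1 : 2 * (2 / X) * (Real.exp (-L) * Real.exp (2 * y * L)) ≤ 2 * Real.exp (2 * y * L) := by
        have : 2 / X * Real.exp (-L) ≤ 1 := by
          rw [div_mul_eq_mul_div, div_le_one hX]; linarith
        nlinarith [Real.exp_pos (2 * y * L)]
      nlinarith [Real.exp_pos (2 * y * L)]
    calc ∫ ξ, f ξ ≤ (∫ ξ in (-1 : ℝ)..1, f ξ) + 2 * (L - 1) * A + 2 * (2 / X) * Real.exp (-(1 - 2 * y) * L) / (1 - 2 * y) := h3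
      _ ≤ 2 * A + 2 * (L - 1) * A + 4 * Real.exp (2 * y * L) := by linarith
      _ = (2 * L + 4) * Real.exp (2 * y * L) := by rw [hA']; ring
      _ ≤ (7.4 * (1 + |Real.log X|)) * (1.65 * (1 + X ^ (-2 * y))) := by
          apply mul_le_mul _ he2 (Real.exp_pos _).le (by positivity)
          linarith [abs_nonneg (Real.log X)]
      _ ≤ (7.4 * (2 * Lam X)) * (1.65 * (1 + X ^ (-2 * y))) := by gcongr
      _ ≤ 32 * Lam X * (1 + X ^ (-2 * y)) := by nlinarith


/-! ### The core integral `∫_{-1}^{1} dξ / max(1, X|ξ|)` -/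

/-- `∫_{-1}^{1} dξ/max(1, X|ξ|) ≤ 2 (1 + log(max(1, X)))/max(1, X)`. [folklore] -/
theorem core_integral_le {X : ℝ} (hX : 0 < X) :
    ∫ ξ in (-1 : ℝ)..1, (max 1 (X * |ξ|))⁻¹ ≤ 2 * (1 + Real.log (max 1 X)) / max 1 X := by
  set g : ℝ → ℝ := fun ξ => (max 1 (X * |ξ|))⁻¹ with hg
  have hg1 : ∀ ξ, g ξ ≤ 1 := fun ξ => inv_le_one_of_one_le₀ (le_max_left _ _)
  have hg0 : ∀ ξ, 0 ≤ g ξ := fun ξ => inv_nonneg.2 (by positivity)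
  have hgc : Continuous g := by
    have : Continuous fun ξ => max 1 (X * |ξ|) := by fun_prop
    exact this.inv₀ fun ξ => by positivity
  have hgi : ∀ a c : ℝ, IntervalIntegrable g volume a c := fun a c => hgc.intervalIntegrable _ _
  rcases le_or_gt X 1 with hX1 | hX1
  · -- `X ≤ 1`: the integrand is `≤ 1`
    rw [max_eq_left hX1, Real.log_one, add_zero, mul_one, div_one]
    have := intervalIntegral.integral_mono_on (by norm_num : (-1 : ℝ) ≤ 1) (hgi _ _)
      (intervalIntegrable_const (c := (1 : ℝ))) (fun ξ _ => hg1 ξ)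
    calc ∫ ξ in (-1 : ℝ)..1, g ξ ≤ ∫ _ in (-1 : ℝ)..1, (1 : ℝ) := this
      _ = 2 := by rw [intervalIntegral.integral_const, smul_eq_mul]; norm_num
  · -- `X > 1`: evenness and the split at `1/X`
    rw [max_eq_right hX1.le]
    have hXi : 0 < X⁻¹ := inv_pos.2 hX
    have hXi1 : X⁻¹ < 1 := inv_lt_one_of_one_lt₀ hX1
    -- evenness
    have heven : ∫ ξ in (-1 : ℝ)..0, g ξ = ∫ ξ in (0 : ℝ)..1, g ξ := by
      have h1 : ∫ ξ in (0 : ℝ)..1, g (-ξ) = ∫ ξ in (-1 : ℝ)..0, g ξ := by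
        rw [intervalIntegral.integral_comp_neg]; simp
      rw [← h1]
      refine intervalIntegral.integral_congr fun ξ _ => ?_
      simp only [hg, abs_neg]
    have hsplit1 : ∫ ξ in (-1 : ℝ)..1, g ξ = (∫ ξ in (-1 : ℝ)..0, g ξ) + ∫ ξ in (0 : ℝ)..1, g ξ :=
      (intervalIntegral.integral_add_adjacent_intervals (hgi _ _) (hgi _ _)).symm
    have hsplit2 : ∫ ξ in (0 : ℝ)..1, g ξ = (∫ ξ in (0 : ℝ)..X⁻¹, g ξ) + ∫ ξ in X⁻¹..1, g ξ :=
      (intervalIntegral.integral_add_adjacent_intervals (hgi _ _) (hgi _ _)).symm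
    -- `∫_0^{1/X} g ≤ 1/X`
    have hp1 : ∫ ξ in (0 : ℝ)..X⁻¹, g ξ ≤ X⁻¹ := by
      have := intervalIntegral.integral_mono_on hXi.le (hgi _ _) (intervalIntegrable_const (c := (1 : ℝ)))
        (fun ξ _ => hg1 ξ)
      calc ∫ ξ in (0 : ℝ)..X⁻¹, g ξ ≤ ∫ _ in (0 : ℝ)..X⁻¹, (1 : ℝ) := this
        _ = X⁻¹ := by rw [intervalIntegral.integral_const, smul_eq_mul]; ring
    -- `∫_{1/X}^{1} g = (log X)/X`
    have hp2 : ∫ ξ in X⁻¹..1, g ξ = Real.log X / X := by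
      have heq : Set.EqOn g (fun ξ => X⁻¹ * ξ⁻¹) (Set.uIcc X⁻¹ 1) := by
        intro ξ hξ
        rw [Set.uIcc_of_le hXi1.le] at hξ
        have hξ0 : 0 < ξ := hXi.trans_le hξ.1
        have hXξ : 1 ≤ X * |ξ| := by
          rw [abs_of_pos hξ0]
          have := mul_le_mul_of_nonneg_left hξ.1 hX.le
          rwa [mul_inv_cancel₀ hX.ne'] at this
        simp only [hg]
        rw [max_eq_right hXξ, abs_of_pos hξ0, mul_inv]
      rw [intervalIntegral.integral_congr heq, intervalIntegral.integral_const_mul,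
        integral_inv (by
          rw [Set.uIcc_of_le hXi1.le]
          exact fun hm => absurd hm.1 (not_le.2 hXi)),
        one_div, Real.log_inv]
      field_simp
      rw [one_div, Real.log_inv, neg_neg]
    have hlog : 0 ≤ Real.log X := Real.log_nonneg hX1.le
    calc ∫ ξ in (-1 : ℝ)..1, g ξ = 2 * ((∫ ξ in (0 : ℝ)..X⁻¹, g ξ) + ∫ ξ in X⁻¹..1, g ξ) := by
          rw [hsplit1, heven, hsplit2]; ring
      _ ≤ 2 * (X⁻¹ + Real.log X / X) := by rw [hp2]; linarith
      _ = 2 * (1 + Real.log X) / X := by field_simp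

/-- Powers of `1/max(1, u)` are bounded by `1/max(1, u)`. [folklore] -/
theorem inv_max_pow_le {u : ℝ} (m : ℕ) (hm : 1 ≤ m) : ((max 1 u)⁻¹) ^ m ≤ (max 1 u)⁻¹ := by
  have h1 : (max 1 u)⁻¹ ≤ 1 := inv_le_one_of_one_le₀ (le_max_left _ _)
  have h0 : 0 ≤ (max 1 u)⁻¹ := inv_nonneg.2 (le_trans zero_le_one (le_max_left _ _))
  calc ((max 1 u)⁻¹) ^ m ≤ ((max 1 u)⁻¹) ^ 1 := pow_le_pow_of_le_one h0 h1 hm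
    _ = _ := pow_one _

/-! ### Elementary facts for the `sinh` profile -/

/-- `|sinh ξ| = sinh |ξ|`. [folklore] -/
theorem abs_sinh (ξ : ℝ) : |Real.sinh ξ| = Real.sinh |ξ| := by
  rcases le_or_gt 0 ξ with h | h
  · rw [abs_of_nonneg h, abs_of_nonneg (Real.sinh_nonneg_iff.2 h)]
  · rw [abs_of_neg h, abs_of_neg (Real.sinh_neg_iff.2 h), Real.sinh_neg]

/-- `|ξ| ≤ |sinh ξ|`. [folklore] -/
theorem abs_le_abs_sinh (ξ : ℝ) : |ξ| ≤ |Real.sinh ξ| := by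
  rw [abs_sinh]; exact Real.self_le_sinh_iff.2 (abs_nonneg ξ)

/-- For `|ξ| ≥ 1`: `|sinh ξ| ≥ e^{|ξ|}/4`. [folklore] -/
theorem exp_abs_div_four_le_abs_sinh {ξ : ℝ} (hξ : 1 ≤ |ξ|) : Real.exp |ξ| / 4 ≤ |Real.sinh ξ| := by
  rw [abs_sinh, Real.sinh_eq]
  have h1 : Real.exp (-|ξ|) * 2 ≤ Real.exp |ξ| := by
    -- `2 e^{-|ξ|} ≤ e^{|ξ|}` iff `2 ≤ e^{2|ξ|}`, and `e^{2|ξ|} ≥ 1 + 2|ξ| ≥ 3`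
    have h2 : (2 : ℝ) ≤ Real.exp (2 * |ξ|) := by
      have := Real.add_one_le_exp (2 * |ξ|); linarith
    have h3 : Real.exp (2 * |ξ|) = Real.exp |ξ| * Real.exp |ξ| := by rw [← Real.exp_add]; ring_nf
    have h4 : Real.exp (-|ξ|) * Real.exp |ξ| = 1 := by rw [← Real.exp_add]; simp
    nlinarith [Real.exp_pos (-|ξ|), Real.exp_pos |ξ|]
  linarith

/-- `cosh 1 ≤ 1.55`. [folklore] -/
theorem cosh_one_le : Real.cosh 1 ≤ 1.55 := by
  rw [Real.cosh_eq]
  have h1 := Real.exp_one_lt_d9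
  have h2 : Real.exp (-1) ≤ 0.37 := by
    rw [Real.exp_neg, inv_le_comm₀ (Real.exp_pos _) (by norm_num)]
    linarith [Real.exp_one_gt_d9]
  linarith

/-- `cosh ξ ≤ 1.55` for `|ξ| ≤ 1`. [folklore] -/
theorem cosh_le_of_abs_le_one {ξ : ℝ} (hξ : |ξ| ≤ 1) : Real.cosh ξ ≤ 1.55 := by
  calc Real.cosh ξ = Real.cosh |ξ| := (Real.cosh_abs ξ).symm
    _ ≤ Real.cosh 1 := Real.cosh_le_cosh.2 (by rwa [abs_abs, abs_one])
    _ ≤ 1.55 := cosh_one_le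


/-! ### The `sinh`-profile integrals -/

/-- Outside `|ξ| ≥ 1`: `1/max(1, X|sinh ξ|) ≤ (4/X) e^{-|ξ|}`. [folklore] -/
theorem inv_max_sinh_le_out {X : ℝ} (hX : 0 < X) {ξ : ℝ} (hξ : 1 ≤ |ξ|) :
    (max 1 (X * |Real.sinh ξ|))⁻¹ ≤ 4 / X * Real.exp (-|ξ|) := by
  have hD : 0 < X * (Real.exp |ξ| / 4) := by positivity
  have h1 : X * (Real.exp |ξ| / 4) ≤ max 1 (X * |Real.sinh ξ|) :=
    le_max_of_le_right (mul_le_mul_of_nonneg_left (exp_abs_div_four_le_abs_sinh hξ) hX.le)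
  calc (max 1 (X * |Real.sinh ξ|))⁻¹ ≤ (X * (Real.exp |ξ| / 4))⁻¹ := inv_anti₀ hD h1
    _ = 4 / X * Real.exp (-|ξ|) := by rw [Real.exp_neg]; field_simp

/-- In the core `|ξ| ≤ 1`: `1/max(1, X|sinh ξ|) ≤ 1/max(1, X|ξ|)`. [folklore] -/
theorem inv_max_sinh_le_core {X : ℝ} (hX : 0 < X) (ξ : ℝ) :
    (max 1 (X * |Real.sinh ξ|))⁻¹ ≤ (max 1 (X * |ξ|))⁻¹ :=
  inv_anti₀ (by positivity) (max_le_max le_rfl (mul_le_mul_of_nonneg_left (abs_le_abs_sinh ξ) hX.le))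

/-- `log 4 ≤ 1.39`. [folklore] -/
theorem log_four_le : Real.log 4 ≤ 1.39 := by
  rw [show (4 : ℝ) = 2 ^ 2 by norm_num, Real.log_pow]; push_cast; linarith [Real.log_two_lt_d9]

/-- `1 < log 4`. [folklore] -/
private theorem one_lt_log_four : 1 < Real.log 4 := by
  rw [show (4 : ℝ) = 2 ^ 2 by norm_num, Real.log_pow]; push_cast; linarith [Real.log_two_gt_d9]

/-- Outer and global majorants of `cosh(2yξ)/max(1, X|sinh ξ|)` (`0 ≤ y`). [folklore] -/
theorem cosh_div_max_sinh_le_out {X y : ℝ} (hX : 0 < X) (hy0 : 0 ≤ y) {ξ : ℝ} (hξ : 1 ≤ |ξ|) :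
    Real.cosh (2 * y * ξ) * (max 1 (X * |Real.sinh ξ|))⁻¹ ≤ 4 / X * Real.exp (-(1 - 2 * y) * |ξ|) := by
  calc Real.cosh (2 * y * ξ) * (max 1 (X * |Real.sinh ξ|))⁻¹ ≤ Real.exp (2 * y * |ξ|) * (4 / X * Real.exp (-|ξ|)) :=
        mul_le_mul (cosh_two_mul_mul_le hy0 ξ) (inv_max_sinh_le_out hX hξ) (inv_nonneg.2 (by positivity))
          (Real.exp_pos _).le
    _ = 4 / X * Real.exp (-(1 - 2 * y) * |ξ|) := by
        rw [show -(1 - 2 * y) * |ξ| = 2 * y * |ξ| + -|ξ| by ring, Real.exp_add]; ring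

/-- Global majorant `(e + 4/X) e^{-(1-2y)|ξ|}` of `cosh(2yξ)/max(1, X|sinh ξ|)`. [folklore] -/
theorem cosh_div_max_sinh_le_glob {X y : ℝ} (hX : 0 < X) (hy0 : 0 ≤ y) (ξ : ℝ) :
    Real.cosh (2 * y * ξ) * (max 1 (X * |Real.sinh ξ|))⁻¹ ≤ (Real.exp 1 + 4 / X) * Real.exp (-(1 - 2 * y) * |ξ|) := by
  have hM0 : 0 < max 1 (X * |Real.sinh ξ|) := by positivity
  rcases le_or_gt 1 |ξ| with hξ | hξ
  · have := cosh_div_max_sinh_le_out hX hy0 hξ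
    have h0 : 0 ≤ Real.exp 1 * Real.exp (-(1 - 2 * y) * |ξ|) := by positivity
    nlinarith
  · have h1 : Real.cosh (2 * y * ξ) * (max 1 (X * |Real.sinh ξ|))⁻¹ ≤ Real.exp (2 * y * |ξ|) := by
      calc Real.cosh (2 * y * ξ) * (max 1 (X * |Real.sinh ξ|))⁻¹ ≤ Real.exp (2 * y * |ξ|) * 1 :=
            mul_le_mul (cosh_two_mul_mul_le hy0 ξ) (inv_le_one_of_one_le₀ (le_max_left _ _))
              (inv_nonneg.2 hM0.le) (Real.exp_pos _).le
        _ = _ := mul_one _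
    have h2 : Real.exp (2 * y * |ξ|) ≤ Real.exp 1 * Real.exp (-(1 - 2 * y) * |ξ|) := by
      rw [← Real.exp_add]; exact Real.exp_le_exp.2 (by nlinarith [abs_nonneg ξ])
    have h3 : 0 ≤ 4 / X * Real.exp (-(1 - 2 * y) * |ξ|) := by positivity
    nlinarith

/-- Continuity of `cosh(2yξ)/max(1, X|sinh ξ|)`. [folklore] -/
theorem continuous_cosh_div_max_sinh (X y : ℝ) :
    Continuous fun ξ : ℝ => Real.cosh (2 * y * ξ) * (max 1 (X * |Real.sinh ξ|))⁻¹ := by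
  have : Continuous fun ξ => max 1 (X * |Real.sinh ξ|) := by fun_prop
  exact (Real.continuous_cosh.comp (continuous_const.mul continuous_id)).mul (this.inv₀ fun ξ => by positivity)

/-- Integrability of `cosh(2yξ)/max(1, X|sinh ξ|)` (`0 ≤ y ≤ 1/4`). [folklore] -/
theorem integrable_cosh_div_max_sinh {X y : ℝ} (hX : 0 < X) (hy0 : 0 ≤ y) (hy : y ≤ 1 / 4) :
    Integrable fun ξ : ℝ => Real.cosh (2 * y * ξ) * (max 1 (X * |Real.sinh ξ|))⁻¹ := by
  have hb : 0 < 1 - 2 * y := by linarith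
  refine ((integrable_exp_neg_mul_abs hb).const_mul (Real.exp 1 + 4 / X)).mono'
    (continuous_cosh_div_max_sinh X y).aestronglyMeasurable ?_
  refine Filter.Eventually.of_forall fun ξ => ?_
  rw [Real.norm_eq_abs, abs_of_nonneg (mul_nonneg (Real.cosh_pos _).le (inv_nonneg.2 (by positivity)))]
  exact cosh_div_max_sinh_le_glob hX hy0 ξ

/-- **`∫ cosh(2yξ)/max(1, X|sinh ξ|) dξ ≤ 40 Λ(X) (1 + X^{-2y})`** for `0 ≤ y ≤ 1/4`, `X > 0`. [folklore] -/
theorem integral_cosh_div_max_sinh_le {X y : ℝ} (hX : 0 < X) (hy0 : 0 ≤ y) (hy : y ≤ 1 / 4) :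
    ∫ ξ, Real.cosh (2 * y * ξ) * (max 1 (X * |Real.sinh ξ|))⁻¹ ≤ 40 * Lam X * (1 + X ^ (-2 * y)) := by
  have hb : 0 < 1 - 2 * y := by linarith
  set f : ℝ → ℝ := fun ξ => Real.cosh (2 * y * ξ) * (max 1 (X * |Real.sinh ξ|))⁻¹ with hf
  have hM0 : ∀ ξ, 0 < max 1 (X * |Real.sinh ξ|) := fun ξ => by positivity
  have hf0 : ∀ ξ, 0 ≤ f ξ := fun ξ => mul_nonneg (Real.cosh_pos _).le (inv_nonneg.2 (hM0 ξ).le)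
  -- outer bound, valid for all `|ξ| ≥ 1`, and integrability
  have hout : ∀ ξ, 1 ≤ |ξ| → f ξ ≤ 4 / X * Real.exp (-(1 - 2 * y) * |ξ|) := fun ξ hξ =>
    cosh_div_max_sinh_le_out hX hy0 hξ
  have hint : Integrable f := integrable_cosh_div_max_sinh hX hy0 hy
  -- the core
  have hey : Real.exp (2 * y) ≤ 1.65 := (Real.exp_le_exp.2 (by linarith)).trans exp_half_le
  have hcore : ∫ ξ in (-1 : ℝ)..1, f ξ ≤ 1.65 * (2 * (1 + Real.log (max 1 X)) / max 1 X) := by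
    have hpt : ∀ ξ ∈ Set.Icc (-1 : ℝ) 1, f ξ ≤ 1.65 * (max 1 (X * |ξ|))⁻¹ := by
      intro ξ hξ
      have habs : |ξ| ≤ 1 := abs_le.2 ⟨by linarith [hξ.1], hξ.2⟩
      have h1 : Real.cosh (2 * y * ξ) ≤ 1.65 :=
        (cosh_two_mul_mul_le hy0 ξ).trans ((Real.exp_le_exp.2 (by nlinarith)).trans hey)
      exact mul_le_mul h1 (inv_max_sinh_le_core hX ξ) (inv_nonneg.2 (hM0 ξ).le) (by norm_num)
    have hgc : Continuous fun ξ : ℝ => 1.65 * (max 1 (X * |ξ|))⁻¹ := by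
      have : Continuous fun ξ => max 1 (X * |ξ|) := by fun_prop
      exact continuous_const.mul (this.inv₀ fun ξ => by positivity)
    have := intervalIntegral.integral_mono_on (by norm_num : (-1 : ℝ) ≤ 1) hint.intervalIntegrable
      (hgc.intervalIntegrable _ _) hpt
    refine this.trans ?_
    rw [intervalIntegral.integral_const_mul]
    exact mul_le_mul_of_nonneg_left (core_integral_le hX) (by norm_num)
  have hXpow0 : 0 ≤ X ^ (-2 * y) := by positivity
  have hΛ0 : 0 ≤ Lam X := Lam_nonneg hX.le
  rcases le_or_gt 1 X with hX1 | hX1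
  · -- `X ≥ 1`: `L = 1`
    have h3 := integral_le_three_regions hint le_rfl hb (A := 4 / X) (B := 4 / X)
      (fun ξ hξ _ => (hout ξ hξ).trans (by
        have : Real.exp (-(1 - 2 * y) * |ξ|) ≤ 1 := by
          rw [Real.exp_le_one_iff]; nlinarith [abs_nonneg ξ]
        have h0 : 0 ≤ 4 / X := by positivity
        nlinarith))
      (fun ξ hξ => hout ξ hξ.le)
    rw [max_eq_right hX1] at hcore
    have het : Real.exp (-(1 - 2 * y) * 1) ≤ 1 := by rw [Real.exp_le_one_iff]; linarith
    have htail : 2 * (4 / X) * Real.exp (-(1 - 2 * y) * 1) / (1 - 2 * y) ≤ 16 / X := by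
      rw [div_le_iff₀ hb]
      have h0 : 0 ≤ 4 / X := by positivity
      have step1 : 2 * (4 / X) * Real.exp (-(1 - 2 * y) * 1) ≤ 2 * (4 / X) := by
        have := mul_le_mul_of_nonneg_left het (by positivity : (0:ℝ) ≤ 2 * (4 / X))
        simpa using this
      have e16 : (16 : ℝ) / X = 4 * (4 / X) := by ring
      have hb' : (1 : ℝ) / 2 ≤ 1 - 2 * y := by linarith
      rw [e16]
      nlinarith
    have hlog := one_add_log_div_le_two_mul_Lam hX1
    have hlog0 : 0 ≤ Real.log X := Real.log_nonneg hX1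
    calc ∫ ξ, f ξ ≤ (∫ ξ in (-1 : ℝ)..1, f ξ) + 2 * (1 - 1) * (4 / X) + 2 * (4 / X) * Real.exp (-(1 - 2 * y) * 1) / (1 - 2 * y) := h3
      _ ≤ 1.65 * (2 * (1 + Real.log X) / X) + 0 + 16 / X := by linarith
      _ = (3.3 + 3.3 * Real.log X + 16) / X := by ring
      _ ≤ 19.3 * ((1 + Real.log X) / X) := by
          rw [mul_div_assoc']
          apply div_le_div_of_nonneg_right _ hX.le
          nlinarith
      _ ≤ 19.3 * (2 * Lam X) := by nlinarith
      _ ≤ 40 * Lam X * (1 + X ^ (-2 * y)) := by nlinarith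
  · -- `X < 1`: `L = log(4/X) > 1`
    set L := Real.log (4 / X) with hL
    have hL1 : 1 ≤ L := by
      rw [hL, Real.log_div (by norm_num) hX.ne']
      have : Real.log X < 0 := Real.log_neg hX hX1
      linarith [one_lt_log_four]
    have heL : Real.exp (-L) = X / 4 := by
      rw [hL, Real.exp_neg, Real.exp_log (by positivity)]; rw [inv_div]
    have heL' : Real.exp L = 4 / X := by rw [hL, Real.exp_log (by positivity)]
    -- middle bound `A = e^{2yL}`
    have hmid : ∀ ξ, 1 ≤ |ξ| → |ξ| ≤ L → f ξ ≤ Real.exp (2 * y * L) := by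
      intro ξ _ hξL
      calc f ξ ≤ Real.exp (2 * y * |ξ|) * 1 :=
            mul_le_mul (cosh_two_mul_mul_le hy0 ξ) (inv_le_one_of_one_le₀ (le_max_left _ _))
              (inv_nonneg.2 (hM0 ξ).le) (Real.exp_pos _).le
        _ ≤ Real.exp (2 * y * L) := by rw [mul_one]; exact Real.exp_le_exp.2 (by nlinarith)
    have h3 := integral_le_three_regions hint hL1 hb (A := Real.exp (2 * y * L)) (B := 4 / X) hmid
      (fun ξ hξ => hout ξ (hL1.trans hξ.le))
    -- `e^{2yL} ≤ 2 X^{-2y}`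
    have he2 : Real.exp (2 * y * L) ≤ 2 * X ^ (-2 * y) := by
      rw [show 2 * y * L = L * (2 * y) by ring, hL, ← Real.rpow_def_of_pos (by positivity),
        Real.div_rpow (by norm_num) hX.le, div_eq_mul_inv, ← Real.rpow_neg hX.le, show -(2 * y) = -2 * y by ring]
      have h2 : (4 : ℝ) ^ (2 * y) ≤ 2 := by
        calc (4 : ℝ) ^ (2 * y) ≤ 4 ^ ((1 : ℝ) / 2) := Real.rpow_le_rpow_of_exponent_le (by norm_num) (by linarith)
          _ = Real.sqrt 4 := (Real.sqrt_eq_rpow 4).symm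
          _ = 2 := by rw [show (4:ℝ) = 2 ^ 2 by norm_num, Real.sqrt_sq (by norm_num)]
      nlinarith
    -- tail `= (8/X) e^{-(1-2y)L}/(1-2y) ≤ (16/X) e^{-L} e^{2yL} = 4 e^{2yL}`
    have htail : 2 * (4 / X) * Real.exp (-(1 - 2 * y) * L) / (1 - 2 * y) ≤ 4 * Real.exp (2 * y * L) := by
      rw [div_le_iff₀ hb, show -(1 - 2 * y) * L = -L + 2 * y * L by ring, Real.exp_add, heL]
      have : (1:ℝ) / 2 ≤ 1 - 2 * y := by linarith
      have h0 : 0 ≤ Real.exp (2 * y * L) := (Real.exp_pos _).le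
      have e1 : 2 * (4 / X) * (X / 4 * Real.exp (2 * y * L)) = 2 * Real.exp (2 * y * L) := by
        field_simp
      rw [e1]; nlinarith
    have hcore' : ∫ ξ in (-1 : ℝ)..1, f ξ ≤ 3.3 := by
      rw [max_eq_left hX1.le, Real.log_one] at hcore; norm_num at hcore; linarith
    have hLle : L ≤ 1.39 + |Real.log X| := by
      rw [hL, Real.log_div (by norm_num) hX.ne']; linarith [log_four_le, neg_le_abs (Real.log X)]
    have hlogΛ := one_add_abs_log_le_two_mul_Lam hX.le hX1.le
    calc ∫ ξ, f ξ ≤ (∫ ξ in (-1 : ℝ)..1, f ξ) + 2 * (L - 1) * Real.exp (2 * y * L) +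
          2 * (4 / X) * Real.exp (-(1 - 2 * y) * L) / (1 - 2 * y) := h3
      _ ≤ 3.3 + (2 * L + 2) * Real.exp (2 * y * L) := by nlinarith [Real.exp_pos (2 * y * L)]
      _ ≤ 3.3 + (4.78 + 2 * |Real.log X|) * (2 * X ^ (-2 * y)) := by
          have hA : 2 * L + 2 ≤ 4.78 + 2 * |Real.log X| := by linarith
          have := mul_le_mul hA he2 (Real.exp_pos _).le (by positivity)
          linarith
      _ ≤ 12.9 * (1 + |Real.log X|) * (1 + X ^ (-2 * y)) := by nlinarith [abs_nonneg (Real.log X)]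
      _ ≤ 12.9 * (2 * Lam X) * (1 + X ^ (-2 * y)) := by gcongr
      _ ≤ 40 * Lam X * (1 + X ^ (-2 * y)) := by nlinarith

/-- `e^{-1} ≤ 0.37`. [folklore] -/
private theorem exp_neg_one_le : Real.exp (-1) ≤ 0.37 := by
  rw [Real.exp_neg, inv_le_comm₀ (Real.exp_pos _) (by norm_num)]
  linarith [Real.exp_one_gt_d9]

/-- The `sinh`-profile majorant `cosh ξ · X/N² + cosh³ ξ · X³/N⁴`, `N = max(1, X|sinh ξ|)`. [folklore] -/
def sinhProf (X ξ : ℝ) : ℝ :=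
  Real.cosh ξ * X * ((max 1 (X * |Real.sinh ξ|))⁻¹) ^ 2 + (Real.cosh ξ) ^ 3 * X ^ 3 * ((max 1 (X * |Real.sinh ξ|))⁻¹) ^ 4

/-- `sinhProf X ξ ≥ 0`. [folklore] -/
theorem sinhProf_nonneg {X : ℝ} (hX : 0 < X) (ξ : ℝ) : 0 ≤ sinhProf X ξ := by
  unfold sinhProf
  have := Real.cosh_pos ξ
  have : 0 ≤ (max 1 (X * |Real.sinh ξ|))⁻¹ := inv_nonneg.2 (by positivity)
  positivity

/-- `sinhProf X` is continuous. [folklore] -/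
theorem continuous_sinhProf (X : ℝ) : Continuous (sinhProf X) := by
  unfold sinhProf
  have : Continuous fun ξ => max 1 (X * |Real.sinh ξ|) := by fun_prop
  have hi := this.inv₀ fun ξ => by positivity
  exact ((Real.continuous_cosh.mul continuous_const).mul (hi.pow 2)).add
    (((Real.continuous_cosh.pow 3).mul continuous_const).mul (hi.pow 4))

/-- The outer bound `sinhProf X ξ ≤ (272/X) e^{-|ξ|}` for `|ξ| ≥ 1`. [folklore] -/
theorem sinhProf_le_out {X : ℝ} (hX : 0 < X) {ξ : ℝ} (hξ : 1 ≤ |ξ|) :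
    sinhProf X ξ ≤ 272 / X * Real.exp (-1 * |ξ|) := by
  have hN0 : 0 ≤ (max 1 (X * |Real.sinh ξ|))⁻¹ := inv_nonneg.2 (by positivity)
  have hch0 := Real.cosh_pos ξ
  set t := Real.exp (-|ξ|) with ht
  have ht0 : 0 < t := Real.exp_pos _
  have hd : (max 1 (X * |Real.sinh ξ|))⁻¹ ≤ 4 / X * t := inv_max_sinh_le_out hX hξ
  have hE : Real.cosh ξ ≤ t⁻¹ := by rw [ht, ← Real.exp_neg, neg_neg]; exact cosh_le_exp_abs' ξ
  have hd2 : ((max 1 (X * |Real.sinh ξ|))⁻¹) ^ 2 ≤ (4 / X * t) ^ 2 := pow_le_pow_left₀ hN0 hd 2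
  have hd4 : ((max 1 (X * |Real.sinh ξ|))⁻¹) ^ 4 ≤ (4 / X * t) ^ 4 := pow_le_pow_left₀ hN0 hd 4
  have hE3 : (Real.cosh ξ) ^ 3 ≤ (t⁻¹) ^ 3 := pow_le_pow_left₀ hch0.le hE 3
  have h1 : Real.cosh ξ * X * ((max 1 (X * |Real.sinh ξ|))⁻¹) ^ 2 ≤ t⁻¹ * X * (4 / X * t) ^ 2 :=
    mul_le_mul (mul_le_mul_of_nonneg_right hE hX.le) hd2 (by positivity) (by positivity)
  have h2 : (Real.cosh ξ) ^ 3 * X ^ 3 * ((max 1 (X * |Real.sinh ξ|))⁻¹) ^ 4 ≤ (t⁻¹) ^ 3 * X ^ 3 * (4 / X * t) ^ 4 :=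
    mul_le_mul (mul_le_mul_of_nonneg_right hE3 (by positivity)) hd4 (by positivity) (by positivity)
  have e : t⁻¹ * X * (4 / X * t) ^ 2 + (t⁻¹) ^ 3 * X ^ 3 * (4 / X * t) ^ 4 = 272 / X * t := by
    field_simp; ring
  unfold sinhProf
  calc _ ≤ t⁻¹ * X * (4 / X * t) ^ 2 + (t⁻¹) ^ 3 * X ^ 3 * (4 / X * t) ^ 4 := add_le_add h1 h2
    _ = 272 / X * Real.exp (-1 * |ξ|) := by rw [e, ht]; ring_nf

/-- The trivial bound `sinhProf X ξ ≤ cosh ξ · X + cosh³ ξ · X³`. [folklore] -/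
theorem sinhProf_le_triv {X : ℝ} (hX : 0 < X) (ξ : ℝ) :
    sinhProf X ξ ≤ Real.cosh ξ * X + (Real.cosh ξ) ^ 3 * X ^ 3 := by
  have hN0 : 0 ≤ (max 1 (X * |Real.sinh ξ|))⁻¹ := inv_nonneg.2 (by positivity)
  have hN1 : (max 1 (X * |Real.sinh ξ|))⁻¹ ≤ 1 := inv_le_one_of_one_le₀ (le_max_left _ _)
  have h1 : ((max 1 (X * |Real.sinh ξ|))⁻¹) ^ 2 ≤ 1 := pow_le_one₀ hN0 hN1
  have h2 : ((max 1 (X * |Real.sinh ξ|))⁻¹) ^ 4 ≤ 1 := pow_le_one₀ hN0 hN1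
  have := Real.cosh_pos ξ
  unfold sinhProf
  calc _ ≤ Real.cosh ξ * X * 1 + (Real.cosh ξ) ^ 3 * X ^ 3 * 1 :=
        add_le_add (mul_le_mul_of_nonneg_left h1 (by positivity)) (mul_le_mul_of_nonneg_left h2 (by positivity))
    _ = _ := by ring

/-- The core bound `sinhProf X ξ ≤ (1.55 X + 3.73 X³)/max(1, X|ξ|)` for `|ξ| ≤ 1`. [folklore] -/
theorem sinhProf_le_core {X : ℝ} (hX : 0 < X) {ξ : ℝ} (hξ : |ξ| ≤ 1) :
    sinhProf X ξ ≤ (1.55 * X + 3.73 * X ^ 3) * (max 1 (X * |ξ|))⁻¹ := by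
  have hch0 := Real.cosh_pos ξ
  have hc := cosh_le_of_abs_le_one hξ
  have hc3 : (Real.cosh ξ) ^ 3 ≤ 3.73 := by
    calc (Real.cosh ξ) ^ 3 ≤ 1.55 ^ 3 := pow_le_pow_left₀ hch0.le hc 3
      _ ≤ 3.73 := by norm_num
  have hcore1 := inv_max_sinh_le_core hX ξ
  have hN2 : ((max 1 (X * |Real.sinh ξ|))⁻¹) ^ 2 ≤ (max 1 (X * |ξ|))⁻¹ :=
    (inv_max_pow_le 2 (by norm_num)).trans hcore1
  have hN4 : ((max 1 (X * |Real.sinh ξ|))⁻¹) ^ 4 ≤ (max 1 (X * |ξ|))⁻¹ :=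
    (inv_max_pow_le 4 (by norm_num)).trans hcore1
  have h0 : 0 ≤ (max 1 (X * |ξ|))⁻¹ := inv_nonneg.2 (by positivity)
  unfold sinhProf
  calc _ ≤ 1.55 * X * (max 1 (X * |ξ|))⁻¹ + 3.73 * X ^ 3 * (max 1 (X * |ξ|))⁻¹ :=
        add_le_add (mul_le_mul (mul_le_mul_of_nonneg_right hc hX.le) hN2 (by positivity) (by positivity))
          (mul_le_mul (mul_le_mul_of_nonneg_right hc3 (by positivity)) hN4 (by positivity) (by positivity))
    _ = _ := by ring

/-- `sinhProf X` is integrable. [folklore] -/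
theorem integrable_sinhProf {X : ℝ} (hX : 0 < X) : Integrable (sinhProf X) := by
  set C : ℝ := (1.55 * X + 3.73 * X ^ 3) * Real.exp 1 + 272 / X with hC
  refine ((integrable_exp_neg_mul_abs one_pos).const_mul C).mono' (continuous_sinhProf X).aestronglyMeasurable ?_
  refine Filter.Eventually.of_forall fun ξ => ?_
  rw [Real.norm_eq_abs, abs_of_nonneg (sinhProf_nonneg hX ξ)]
  rcases le_or_gt 1 |ξ| with hξ | hξ
  · have := sinhProf_le_out hX hξ
    have h0 : 0 ≤ (1.55 * X + 3.73 * X ^ 3) * Real.exp 1 * Real.exp (-1 * |ξ|) := by positivity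
    calc sinhProf X ξ ≤ 272 / X * Real.exp (-1 * |ξ|) := this
      _ ≤ C * Real.exp (-1 * |ξ|) := by rw [hC]; nlinarith
  · have h1 := sinhProf_le_core hX hξ.le
    have h2 : (max 1 (X * |ξ|))⁻¹ ≤ Real.exp 1 * Real.exp (-1 * |ξ|) := by
      calc (max 1 (X * |ξ|))⁻¹ ≤ 1 := inv_le_one_of_one_le₀ (le_max_left _ _)
        _ ≤ Real.exp 1 * Real.exp (-1 * |ξ|) := by
            rw [← Real.exp_add]; exact Real.one_le_exp (by linarith)
    have h3 : 0 ≤ 1.55 * X + 3.73 * X ^ 3 := by positivity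
    have h4 : 0 ≤ 272 / X * Real.exp (-1 * |ξ|) := by positivity
    calc sinhProf X ξ ≤ (1.55 * X + 3.73 * X ^ 3) * (Real.exp 1 * Real.exp (-1 * |ξ|)) :=
          h1.trans (mul_le_mul_of_nonneg_left h2 h3)
      _ ≤ C * Real.exp (-1 * |ξ|) := by rw [hC]; nlinarith

/-- **The `sinh`-profile majorant of the third derivative**:
`∫ sinhProf X ≤ 250 (1 + |log X|)(1 + X)²`. [folklore] -/
theorem integral_sinhProf_le {X : ℝ} (hX : 0 < X) :
    ∫ ξ, sinhProf X ξ ≤ 250 * (1 + |Real.log X|) * (1 + X) ^ 2 := by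
  set f : ℝ → ℝ := sinhProf X with hf
  have hch0 : ∀ ξ, 0 < Real.cosh ξ := fun ξ => Real.cosh_pos ξ
  have hout : ∀ ξ, 1 ≤ |ξ| → f ξ ≤ 272 / X * Real.exp (-1 * |ξ|) := fun ξ hξ => sinhProf_le_out hX hξ
  have htriv : ∀ ξ, f ξ ≤ Real.cosh ξ * X + (Real.cosh ξ) ^ 3 * X ^ 3 := fun ξ => sinhProf_le_triv hX ξ
  have hcorept : ∀ ξ, |ξ| ≤ 1 → f ξ ≤ (1.55 * X + 3.73 * X ^ 3) * (max 1 (X * |ξ|))⁻¹ := fun ξ hξ =>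
    sinhProf_le_core hX hξ
  have hint : Integrable f := integrable_sinhProf hX
  -- the core integral
  have hcore : ∫ ξ in (-1 : ℝ)..1, f ξ ≤ (1.55 * X + 3.73 * X ^ 3) * (2 * (1 + Real.log (max 1 X)) / max 1 X) := by
    have hgc : Continuous fun ξ : ℝ => (1.55 * X + 3.73 * X ^ 3) * (max 1 (X * |ξ|))⁻¹ := by
      have : Continuous fun ξ => max 1 (X * |ξ|) := by fun_prop
      exact continuous_const.mul (this.inv₀ fun ξ => by positivity)
    have := intervalIntegral.integral_mono_on (by norm_num : (-1 : ℝ) ≤ 1) hint.intervalIntegrable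
      (hgc.intervalIntegrable _ _) (fun ξ hξ => hcorept ξ (abs_le.2 ⟨by linarith [hξ.1], hξ.2⟩))
    refine this.trans ?_
    rw [intervalIntegral.integral_const_mul]
    exact mul_le_mul_of_nonneg_left (core_integral_le hX) (by positivity)
  rcases le_or_gt 1 X with hX1 | hX1
  · -- `X ≥ 1`
    have h3 := integral_le_three_regions hint le_rfl one_pos (A := 272 / X) (B := 272 / X)
      (fun ξ hξ _ => (hout ξ hξ).trans (by
        have : Real.exp (-1 * |ξ|) ≤ 1 := by rw [Real.exp_le_one_iff]; nlinarith [abs_nonneg ξ]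
        have h0 : 0 ≤ 272 / X := by positivity
        nlinarith))
      (fun ξ hξ => hout ξ hξ.le)
    rw [max_eq_right hX1] at hcore
    have hlog0 : 0 ≤ Real.log X := Real.log_nonneg hX1
    rw [abs_of_nonneg hlog0]
    have htail : 2 * (272 / X) * Real.exp (-1 * 1) / 1 ≤ 202 := by
      rw [div_one, show -1 * (1:ℝ) = -1 by ring]
      have h1 : 272 / X ≤ 272 := by rw [div_le_iff₀ hX]; nlinarith
      have h0 : 0 ≤ 272 / X := by positivity
      nlinarith [exp_neg_one_le, Real.exp_pos (-1)]
    have hcore' : (1.55 * X + 3.73 * X ^ 3) * (2 * (1 + Real.log X) / X) = (3.1 + 7.46 * X ^ 2) * (1 + Real.log X) := by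
      field_simp; ring
    calc ∫ ξ, f ξ ≤ (∫ ξ in (-1 : ℝ)..1, f ξ) + 2 * (1 - 1) * (272 / X) + 2 * (272 / X) * Real.exp (-1 * 1) / 1 := h3
      _ ≤ (3.1 + 7.46 * X ^ 2) * (1 + Real.log X) + 0 + 202 := by rw [← hcore']; linarith
      _ ≤ 250 * (1 + Real.log X) * (1 + X) ^ 2 := by nlinarith
  · -- `X < 1`, `L = log(4/X)`
    set L := Real.log (4 / X) with hL
    have hL1 : 1 ≤ L := by
      rw [hL, Real.log_div (by norm_num) hX.ne']
      have : Real.log X < 0 := Real.log_neg hX hX1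
      linarith [one_lt_log_four]
    have heL : Real.exp (-1 * L) = X / 4 := by
      rw [show -1 * L = -L by ring, hL, Real.exp_neg, Real.exp_log (by positivity)]; rw [inv_div]
    have heL' : Real.exp L = 4 / X := by rw [hL, Real.exp_log (by positivity)]
    have hmid : ∀ ξ, 1 ≤ |ξ| → |ξ| ≤ L → f ξ ≤ 68 := by
      intro ξ _ hξL
      have hc : Real.cosh ξ * X ≤ 4 := by
        have h1 : Real.cosh ξ ≤ 4 / X := by
          calc Real.cosh ξ ≤ Real.exp |ξ| := cosh_le_exp_abs' ξ
            _ ≤ Real.exp L := Real.exp_le_exp.2 hξL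
            _ = 4 / X := heL'
        have := mul_le_mul_of_nonneg_right h1 hX.le
        rwa [div_mul_cancel₀ _ hX.ne'] at this
      have hc0 : 0 ≤ Real.cosh ξ * X := by have := hch0 ξ; positivity
      have hc3 : (Real.cosh ξ) ^ 3 * X ^ 3 ≤ 64 := by
        rw [← mul_pow]
        calc (Real.cosh ξ * X) ^ 3 ≤ 4 ^ 3 := pow_le_pow_left₀ hc0 hc 3
          _ = 64 := by norm_num
      linarith [htriv ξ]
    have h3 := integral_le_three_regions hint hL1 one_pos (A := 68) (B := 272 / X) hmid
      (fun ξ hξ => hout ξ (hL1.trans hξ.le))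
    have htail : 2 * (272 / X) * Real.exp (-1 * L) / 1 = 136 := by
      rw [heL]; field_simp; ring
    have hcore' : ∫ ξ in (-1 : ℝ)..1, f ξ ≤ 10.56 := by
      rw [max_eq_left hX1.le, Real.log_one] at hcore
      norm_num at hcore
      have hX3 : X ^ 3 ≤ 1 := pow_le_one₀ hX.le hX1.le
      nlinarith
    have hLle : L ≤ 1.39 + |Real.log X| := by
      rw [hL, Real.log_div (by norm_num) hX.ne']; linarith [log_four_le, neg_le_abs (Real.log X)]
    have hX2 : 1 ≤ (1 + X) ^ 2 := by nlinarith
    calc ∫ ξ, f ξ ≤ (∫ ξ in (-1 : ℝ)..1, f ξ) + 2 * (L - 1) * 68 + 2 * (272 / X) * Real.exp (-1 * L) / 1 := h3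
      _ ≤ 10.56 + 136 * (0.39 + |Real.log X|) + 136 := by rw [htail]; nlinarith
      _ ≤ 250 * (1 + |Real.log X|) * 1 := by nlinarith [abs_nonneg (Real.log X)]
      _ ≤ 250 * (1 + |Real.log X|) * (1 + X) ^ 2 := by gcongr

/-! ### The `sin`-profile integral on `[-π, π]` -/

/-- `∫_0^1 du/max(1, Xu) ≤ 2 (1 + log max(1,X))/max(1,X)`. [folklore] -/
theorem core_integral_half_le {X : ℝ} (hX : 0 < X) :
    ∫ u in (0 : ℝ)..1, (max 1 (X * u))⁻¹ ≤ 2 * (1 + Real.log (max 1 X)) / max 1 X := by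
  have hgc : Continuous fun u : ℝ => (max 1 (X * |u|))⁻¹ := by
    have : Continuous fun u => max 1 (X * |u|) := by fun_prop
    exact this.inv₀ fun u => by positivity
  have h1 : ∫ u in (0 : ℝ)..1, (max 1 (X * u))⁻¹ = ∫ u in (0 : ℝ)..1, (max 1 (X * |u|))⁻¹ := by
    refine intervalIntegral.integral_congr fun u hu => ?_
    rw [Set.uIcc_of_le zero_le_one] at hu
    simp only [abs_of_nonneg hu.1]
  rw [h1]
  calc ∫ u in (0 : ℝ)..1, (max 1 (X * |u|))⁻¹ ≤ ∫ u in (-1 : ℝ)..1, (max 1 (X * |u|))⁻¹ := by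
        apply intervalIntegral.integral_mono_interval (by norm_num) zero_le_one le_rfl
        · exact Filter.Eventually.of_forall fun u => inv_nonneg.2 (by positivity)
        · exact hgc.intervalIntegrable _ _
    _ ≤ _ := core_integral_le hX

/-- **`∫_{-π}^{π} dθ/max(1, X|sin θ|) ≤ 4π (1 + log max(1,X))/max(1,X)`** (Jordan's inequality on four
quarter periods). [folklore] -/
theorem sin_integral_le {X : ℝ} (hX : 0 < X) :
    ∫ θ in (-π : ℝ)..π, (max 1 (X * |Real.sin θ|))⁻¹ ≤ 4 * π * (1 + Real.log (max 1 X)) / max 1 X := by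
  set g : ℝ → ℝ := fun θ => (max 1 (X * |Real.sin θ|))⁻¹ with hg
  set G : ℝ → ℝ := fun u => (max 1 (X * u))⁻¹ with hG
  have hgc : Continuous g := by
    have : Continuous fun θ => max 1 (X * |Real.sin θ|) := by fun_prop
    exact this.inv₀ fun θ => by positivity
  have hGc : Continuous G := by
    have : Continuous fun u => max 1 (X * u) := by fun_prop
    exact this.inv₀ fun u => by positivity
  have hgi : ∀ a b : ℝ, IntervalIntegrable g volume a b := fun a b => hgc.intervalIntegrable _ _
  have hGi : ∀ a b : ℝ, IntervalIntegrable G volume a b := fun a b => hGc.intervalIntegrable _ _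
  have hπ2 : (0 : ℝ) ≤ π / 2 := by positivity
  -- the quarter-period bound `∫_0^{π/2} g ≤ I := ∫_0^{π/2} G((2/π) θ) dθ`
  set I : ℝ := ∫ θ in (0 : ℝ)..(π / 2), G (2 / π * θ) with hI
  have hq : ∫ θ in (0 : ℝ)..(π / 2), g θ ≤ I := by
    apply intervalIntegral.integral_mono_on hπ2 (hgi _ _) ((hGc.comp (continuous_const.mul continuous_id)).intervalIntegrable _ _)
    intro θ hθ
    simp only [hg, hG]
    apply inv_anti₀ (by positivity)
    apply max_le_max le_rfl
    apply mul_le_mul_of_nonneg_left _ hX.le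
    rw [abs_of_nonneg (Real.sin_nonneg_of_nonneg_of_le_pi hθ.1 (by linarith [hθ.2, Real.pi_pos]))]
    exact Real.mul_le_sin hθ.1 hθ.2
  -- `I = (π/2) ∫_0^1 G ≤ π (1 + log max)/max`
  have hIle : I ≤ π * (1 + Real.log (max 1 X)) / max 1 X := by
    have hc : (2 / π : ℝ) ≠ 0 := by positivity
    have e : I = (π / 2) * ∫ u in (0 : ℝ)..1, G u := by
      rw [hI, intervalIntegral.integral_comp_mul_left G hc, smul_eq_mul, inv_div, mul_zero,
        show 2 / π * (π / 2) = (1 : ℝ) by field_simp]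
    rw [e]
    have := core_integral_half_le hX
    calc π / 2 * ∫ u in (0 : ℝ)..1, G u ≤ π / 2 * (2 * (1 + Real.log (max 1 X)) / max 1 X) :=
          mul_le_mul_of_nonneg_left this hπ2
      _ = _ := by ring
  -- the other three quarter periods reduce to the first
  have hsym1 : ∫ θ in (π / 2 : ℝ)..π, g θ = ∫ θ in (0 : ℝ)..(π / 2), g θ := by
    have h1 : ∫ θ in (0 : ℝ)..(π / 2), g (π - θ) = ∫ θ in (π - π / 2 : ℝ)..(π - 0), g θ :=
      intervalIntegral.integral_comp_sub_left g π
    rw [show π - π / 2 = π / 2 by ring, sub_zero] at h1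
    rw [← h1]
    refine intervalIntegral.integral_congr fun θ _ => ?_
    simp only [hg, Real.sin_pi_sub]
  have hsym2 : ∫ θ in (-(π / 2) : ℝ)..0, g θ = ∫ θ in (0 : ℝ)..(π / 2), g θ := by
    have h1 : ∫ θ in (0 : ℝ)..(π / 2), g (-θ) = ∫ θ in (-(π / 2) : ℝ)..(-0), g θ :=
      intervalIntegral.integral_comp_neg g
    rw [neg_zero] at h1
    rw [← h1]
    refine intervalIntegral.integral_congr fun θ _ => ?_
    simp only [hg, Real.sin_neg, abs_neg]
  have hsym3 : ∫ θ in (-π : ℝ)..(-(π / 2)), g θ = ∫ θ in (π / 2 : ℝ)..π, g θ := by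
    have h1 : ∫ θ in (π / 2 : ℝ)..π, g (-θ) = ∫ θ in (-π : ℝ)..(-(π / 2)), g θ :=
      intervalIntegral.integral_comp_neg g
    rw [← h1]
    refine intervalIntegral.integral_congr fun θ _ => ?_
    simp only [hg, Real.sin_neg, abs_neg]
  have hsplit : ∫ θ in (-π : ℝ)..π, g θ =
      (∫ θ in (-π : ℝ)..(-(π / 2)), g θ) + (∫ θ in (-(π / 2) : ℝ)..0, g θ) +
        (∫ θ in (0 : ℝ)..(π / 2), g θ) + ∫ θ in (π / 2 : ℝ)..π, g θ := by
    rw [intervalIntegral.integral_add_adjacent_intervals (hgi _ _) (hgi _ _),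
      intervalIntegral.integral_add_adjacent_intervals (hgi _ _) (hgi _ _),
      intervalIntegral.integral_add_adjacent_intervals (hgi _ _) (hgi _ _)]
  rw [hsplit, hsym3, hsym1, hsym2]
  calc (∫ θ in (0 : ℝ)..(π / 2), g θ) + (∫ θ in (0 : ℝ)..(π / 2), g θ) + (∫ θ in (0 : ℝ)..(π / 2), g θ) +
        ∫ θ in (0 : ℝ)..(π / 2), g θ = 4 * ∫ θ in (0 : ℝ)..(π / 2), g θ := by ring
    _ ≤ 4 * (π * (1 + Real.log (max 1 X)) / max 1 X) := by linarith [hq.trans hIle]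
    _ = _ := by ring

/-- The `sin`-profile integral in terms of `Λ`: `∫_{-π}^{π} dθ/max(1, X|sin θ|) ≤ 8π Λ(X)·(hmm)`; we record
the two consequences used below. For `X ≥ 1`: `≤ 8π Λ(X)`; for `X ≤ 1`: `≤ 4π`. [folklore] -/
theorem sin_integral_le_Lam {X : ℝ} (hX : 0 < X) :
    ∫ θ in (-π : ℝ)..π, (max 1 (X * |Real.sin θ|))⁻¹ ≤ 8 * π * Lam X := by
  have h := sin_integral_le hX
  have hπ := Real.pi_pos
  rcases le_or_gt 1 X with hX1 | hX1
  · rw [max_eq_right hX1] at h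
    have := one_add_log_div_le_two_mul_Lam hX1
    calc ∫ θ in (-π : ℝ)..π, (max 1 (X * |Real.sin θ|))⁻¹ ≤ 4 * π * (1 + Real.log X) / X := h
      _ = 4 * π * ((1 + Real.log X) / X) := by ring
      _ ≤ 4 * π * (2 * Lam X) := by gcongr
      _ = 8 * π * Lam X := by ring
  · rw [max_eq_left hX1.le, Real.log_one, add_zero, mul_one, div_one] at h
    have h2 : 1 ≤ 2 * Lam X := by
      have := one_add_abs_log_le_two_mul_Lam hX.le hX1.le
      linarith [abs_nonneg (Real.log X)]
    nlinarith

/-! ### Third derivatives of compositions `x ↦ G₀(c(x))` -/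

section Comp

variable {G : ℕ → ℝ → ℂ} {c c1 c2 c3 : ℝ → ℝ}

/-- Chain and product rules up to order three for `x ↦ G₀(c(x))` with `G_k' = G_{k+1}`:
the first three derivatives are `c' G₁(c)`, `c'' G₁(c) + c'² G₂(c)`,
`c''' G₁(c) + 3 c' c'' G₂(c) + c'³ G₃(c)`. [folklore] -/
theorem iteratedDeriv_comp_formulas (hG : ∀ k w, HasDerivAt (G k) (G (k + 1) w) w)
    (hc : ∀ x, HasDerivAt c (c1 x) x) (hc1 : ∀ x, HasDerivAt c1 (c2 x) x) (hc2 : ∀ x, HasDerivAt c2 (c3 x) x) :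
    iteratedDeriv 1 (fun x => G 0 (c x)) = (fun x => (c1 x : ℂ) * G 1 (c x)) ∧
    iteratedDeriv 2 (fun x => G 0 (c x)) = (fun x => (c2 x : ℂ) * G 1 (c x) + (c1 x : ℂ) ^ 2 * G 2 (c x)) ∧
    iteratedDeriv 3 (fun x => G 0 (c x)) =
      (fun x => (c3 x : ℂ) * G 1 (c x) + 3 * (c1 x : ℂ) * c2 x * G 2 (c x) + (c1 x : ℂ) ^ 3 * G 3 (c x)) := by
  -- composition rule `(G k ∘ c)' = c' G_{k+1}(c)`
  have hcomp : ∀ k x, HasDerivAt (fun x => G k (c x)) ((c1 x : ℂ) * G (k + 1) (c x)) x := by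
    intro k x
    have h := (hG k (c x)).scomp x (hc x)
    have e : c1 x • G (k + 1) (c x) = (c1 x : ℂ) * G (k + 1) (c x) := Complex.real_smul
    rw [e] at h
    exact h
  have hc1C : ∀ x, HasDerivAt (fun x => (c1 x : ℂ)) (c2 x : ℂ) x := fun x => (hc1 x).ofReal_comp
  have hc2C : ∀ x, HasDerivAt (fun x => (c2 x : ℂ)) (c3 x : ℂ) x := fun x => (hc2 x).ofReal_comp
  -- first derivative
  have d1 : deriv (fun x => G 0 (c x)) = fun x => (c1 x : ℂ) * G 1 (c x) := funext fun x => (hcomp 0 x).deriv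
  -- second derivative
  have h2 : ∀ x, HasDerivAt (fun x => (c1 x : ℂ) * G 1 (c x))
      ((c2 x : ℂ) * G 1 (c x) + (c1 x : ℂ) * ((c1 x : ℂ) * G 2 (c x))) x :=
    fun x => (hc1C x).mul (hcomp 1 x)
  have d2 : deriv (fun x => (c1 x : ℂ) * G 1 (c x)) = fun x => (c2 x : ℂ) * G 1 (c x) + (c1 x : ℂ) ^ 2 * G 2 (c x) := by
    funext x; rw [(h2 x).deriv]; ring
  -- third derivative
  have h3 : ∀ x, HasDerivAt (fun x => (c2 x : ℂ) * G 1 (c x) + (c1 x : ℂ) ^ 2 * G 2 (c x))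
      ((c3 x : ℂ) * G 1 (c x) + (c2 x : ℂ) * ((c1 x : ℂ) * G 2 (c x)) +
        ((2 : ℕ) * (c1 x : ℂ) ^ (2 - 1) * (c2 x : ℂ) * G 2 (c x) + (c1 x : ℂ) ^ 2 * ((c1 x : ℂ) * G 3 (c x)))) x := by
    intro x
    exact ((hc2C x).mul (hcomp 1 x)).add (((hc1C x).pow 2).mul (hcomp 2 x))
  have d3 : deriv (fun x => (c2 x : ℂ) * G 1 (c x) + (c1 x : ℂ) ^ 2 * G 2 (c x)) =
      fun x => (c3 x : ℂ) * G 1 (c x) + 3 * (c1 x : ℂ) * c2 x * G 2 (c x) + (c1 x : ℂ) ^ 3 * G 3 (c x) := by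
    funext x; rw [(h3 x).deriv]; push_cast; ring
  have e1 : iteratedDeriv 1 (fun x => G 0 (c x)) = fun x => (c1 x : ℂ) * G 1 (c x) := by
    rw [iteratedDeriv_one, d1]
  have e2 : iteratedDeriv 2 (fun x => G 0 (c x)) = fun x => (c2 x : ℂ) * G 1 (c x) + (c1 x : ℂ) ^ 2 * G 2 (c x) := by
    rw [iteratedDeriv_succ, e1, d2]
  have e3 : iteratedDeriv 3 (fun x => G 0 (c x)) =
      fun x => (c3 x : ℂ) * G 1 (c x) + 3 * (c1 x : ℂ) * c2 x * G 2 (c x) + (c1 x : ℂ) ^ 3 * G 3 (c x) := by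
    rw [iteratedDeriv_succ, e2, d3]
  exact ⟨e1, e2, e3⟩

end Comp

/-- `u^k / M^{k+1} ≤ 1/M` for `0 ≤ u ≤ M`. [folklore] -/
theorem pow_div_pow_succ_le {u M : ℝ} (hu : 0 ≤ u) (huM : u ≤ M) (hM : 0 < M) (k : ℕ) :
    u ^ k / M ^ (k + 1) ≤ M⁻¹ := by
  rw [pow_succ, div_le_iff₀ (by positivity)]
  have h1 : u ^ k ≤ M ^ k := pow_le_pow_left₀ hu huM k
  have h2 : M⁻¹ * (M ^ k * M) = M ^ k := by field_simp
  rw [h2]; exact h1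

/-! ### The three profiles `H₊ = P₀ ∘ cosh`, `H₋ = P₀ ∘ sinh`, `Q = 𝓐ψ₀ ∘ sin` -/

namespace IsTest

variable {X : ℝ} {φ : ℝ → ℂ} (h : IsTest X φ)
include h

/-- `P_k` is smooth. [folklore] -/
theorem contDiff_Pk (k : ℕ) : ContDiff ℝ ∞ (Pk φ k) := by
  have hc := contDiff_four (h.continuous_psi k) (h.hasCompactSupport_psi k)
  unfold Pk
  exact (hc.add (contDiff_const.mul (hc.comp contDiff_neg))).div_const _

omit h in
/-- `H₊(ξ) = P₀(cosh ξ)`. [folklore] -/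
def Hp (φ : ℝ → ℂ) (ξ : ℝ) : ℂ := Pk φ 0 (Real.cosh ξ)

omit h in
/-- `H₋(ξ) = P₀(sinh ξ)`. [folklore] -/
def Hm (φ : ℝ → ℂ) (ξ : ℝ) : ℂ := Pk φ 0 (Real.sinh ξ)

omit h in
/-- `Q(θ) = 𝓐ψ₀(sin θ) = ∫ e^{-i x sin θ} φ(x) dx/x`. [folklore] -/
def Qs (φ : ℝ → ℂ) (θ : ℝ) : ℂ := four (psi φ 0) (Real.sin θ)

/-- `H₊` is smooth. [folklore] -/
theorem contDiff_Hp : ContDiff ℝ ∞ (Hp φ) := (h.contDiff_Pk 0).comp Real.contDiff_cosh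
/-- `H₋` is smooth. [folklore] -/
theorem contDiff_Hm : ContDiff ℝ ∞ (Hm φ) := (h.contDiff_Pk 0).comp Real.contDiff_sinh
/-- `Q` is smooth. [folklore] -/
theorem contDiff_Qs : ContDiff ℝ ∞ (Qs φ) :=
  (contDiff_four (h.continuous_psi 0) (h.hasCompactSupport_psi 0)).comp Real.contDiff_sin

/-- The derivatives of `H₊`. [folklore] -/
theorem iteratedDeriv_Hp :
    iteratedDeriv 1 (Hp φ) = (fun ξ => (Real.sinh ξ : ℂ) * Pk φ 1 (Real.cosh ξ)) ∧
    iteratedDeriv 2 (Hp φ) = (fun ξ => (Real.cosh ξ : ℂ) * Pk φ 1 (Real.cosh ξ) + (Real.sinh ξ : ℂ) ^ 2 * Pk φ 2 (Real.cosh ξ)) ∧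
    iteratedDeriv 3 (Hp φ) = (fun ξ => (Real.sinh ξ : ℂ) * Pk φ 1 (Real.cosh ξ) +
      3 * (Real.sinh ξ : ℂ) * Real.cosh ξ * Pk φ 2 (Real.cosh ξ) + (Real.sinh ξ : ℂ) ^ 3 * Pk φ 3 (Real.cosh ξ)) :=
  iteratedDeriv_comp_formulas (G := fun k => Pk φ k) (fun k w => h.hasDerivAt_Pk k w)
    Real.hasDerivAt_cosh Real.hasDerivAt_sinh Real.hasDerivAt_cosh

/-- The derivatives of `H₋`. [folklore] -/
theorem iteratedDeriv_Hm :
    iteratedDeriv 1 (Hm φ) = (fun ξ => (Real.cosh ξ : ℂ) * Pk φ 1 (Real.sinh ξ)) ∧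
    iteratedDeriv 2 (Hm φ) = (fun ξ => (Real.sinh ξ : ℂ) * Pk φ 1 (Real.sinh ξ) + (Real.cosh ξ : ℂ) ^ 2 * Pk φ 2 (Real.sinh ξ)) ∧
    iteratedDeriv 3 (Hm φ) = (fun ξ => (Real.cosh ξ : ℂ) * Pk φ 1 (Real.sinh ξ) +
      3 * (Real.cosh ξ : ℂ) * Real.sinh ξ * Pk φ 2 (Real.sinh ξ) + (Real.cosh ξ : ℂ) ^ 3 * Pk φ 3 (Real.sinh ξ)) :=
  iteratedDeriv_comp_formulas (G := fun k => Pk φ k) (fun k w => h.hasDerivAt_Pk k w)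
    Real.hasDerivAt_sinh Real.hasDerivAt_cosh Real.hasDerivAt_sinh

/-- The derivatives of `Q`. [folklore] -/
theorem iteratedDeriv_Qs :
    iteratedDeriv 1 (Qs φ) = (fun θ => (Real.cos θ : ℂ) * four (psi φ 1) (Real.sin θ)) ∧
    iteratedDeriv 2 (Qs φ) = (fun θ => ((-Real.sin θ : ℝ) : ℂ) * four (psi φ 1) (Real.sin θ) +
      (Real.cos θ : ℂ) ^ 2 * four (psi φ 2) (Real.sin θ)) ∧
    iteratedDeriv 3 (Qs φ) = (fun θ => ((-Real.cos θ : ℝ) : ℂ) * four (psi φ 1) (Real.sin θ) +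
      3 * (Real.cos θ : ℂ) * ((-Real.sin θ : ℝ) : ℂ) * four (psi φ 2) (Real.sin θ) +
      (Real.cos θ : ℂ) ^ 3 * four (psi φ 3) (Real.sin θ)) := by
  have hG : ∀ k w, HasDerivAt (four (psi φ k)) (four (psi φ (k + 1)) w) w := by
    intro k w
    have := hasDerivAt_four (h.continuous_psi k) (h.hasCompactSupport_psi k) w
    rwa [negIx_mul_psi] at this
  exact iteratedDeriv_comp_formulas (G := fun k => four (psi φ k)) hG Real.hasDerivAt_sin
    (fun x => (Real.hasDerivAt_cos x)) (fun x => (Real.hasDerivAt_sin x).neg)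

/-! ### Pointwise bounds for the profiles -/

/-- `‖H₊(ξ)‖ ≤ 1536/max(1, X cosh ξ)`. [folklore] -/
theorem norm_Hp_le (ξ : ℝ) : ‖Hp φ ξ‖ ≤ 1536 * (max 1 (X * Real.cosh ξ))⁻¹ := by
  have := h.norm_Pk_le (k := 0) (m := 1) (by norm_num) (by norm_num) (Real.cosh ξ)
  rw [abs_of_pos (Real.cosh_pos ξ), pow_zero, pow_one] at this
  simpa [Hp, div_eq_mul_inv] using this

/-- `‖H₊⁽ⁿ⁾(ξ)‖ ≤ 7680/max(1, X cosh ξ)` for `n = 1, 2, 3`. [folklore] -/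
theorem norm_iteratedDeriv_Hp_le {n : ℕ} (hn1 : 1 ≤ n) (hn : n ≤ 3) (ξ : ℝ) :
    ‖iteratedDeriv n (Hp φ) ξ‖ ≤ 7680 * (max 1 (X * Real.cosh ξ))⁻¹ := by
  have hX := h.pos
  set M := max 1 (X * Real.cosh ξ) with hM
  have hch := Real.cosh_pos ξ
  have hM0 : 0 < M := by positivity
  have hu : X * Real.cosh ξ ≤ M := le_max_right _ _
  have hu0 : 0 ≤ X * Real.cosh ξ := by positivity
  have hs : |Real.sinh ξ| ≤ Real.cosh ξ := by
    rw [abs_sinh, ← Real.cosh_abs]; exact (Real.sinh_lt_cosh _).le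
  have hsC : ‖(Real.sinh ξ : ℂ)‖ ≤ Real.cosh ξ := by rw [Complex.norm_real, Real.norm_eq_abs]; exact hs
  have hcC : ‖(Real.cosh ξ : ℂ)‖ = Real.cosh ξ := by rw [Complex.norm_real, Real.norm_eq_abs, abs_of_pos hch]
  -- the three `P_k` bounds with `m = k + 1`
  have hP : ∀ k, 1 ≤ k → k ≤ 3 → (Real.cosh ξ) ^ k * ‖Pk φ k (Real.cosh ξ)‖ ≤ 1536 * M⁻¹ := by
    intro k hk1 hk3
    have hb := h.norm_Pk_le (k := k) (m := k + 1) hk3 (by omega) (Real.cosh ξ)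
    rw [abs_of_pos hch] at hb
    calc (Real.cosh ξ) ^ k * ‖Pk φ k (Real.cosh ξ)‖ ≤ (Real.cosh ξ) ^ k * (1536 * X ^ k / M ^ (k + 1)) :=
          mul_le_mul_of_nonneg_left hb (by positivity)
      _ = 1536 * ((X * Real.cosh ξ) ^ k / M ^ (k + 1)) := by rw [mul_pow]; ring
      _ ≤ 1536 * M⁻¹ := mul_le_mul_of_nonneg_left (pow_div_pow_succ_le hu0 hu hM0 k) (by norm_num)
  obtain ⟨e1, e2, e3⟩ := h.iteratedDeriv_Hp
  have hP1 := hP 1 le_rfl (by norm_num)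
  have hP2 := hP 2 (by norm_num) (by norm_num)
  have hP3 := hP 3 (by norm_num) le_rfl
  rw [pow_one] at hP1
  interval_cases n
  · rw [e1]
    calc ‖(Real.sinh ξ : ℂ) * Pk φ 1 (Real.cosh ξ)‖ = ‖(Real.sinh ξ : ℂ)‖ * ‖Pk φ 1 (Real.cosh ξ)‖ := norm_mul _ _
      _ ≤ Real.cosh ξ * ‖Pk φ 1 (Real.cosh ξ)‖ := mul_le_mul_of_nonneg_right hsC (norm_nonneg _)
      _ ≤ 1536 * M⁻¹ := hP1
      _ ≤ 7680 * M⁻¹ := by have := inv_nonneg.2 hM0.le; nlinarith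
  · rw [e2]
    calc ‖(Real.cosh ξ : ℂ) * Pk φ 1 (Real.cosh ξ) + (Real.sinh ξ : ℂ) ^ 2 * Pk φ 2 (Real.cosh ξ)‖
        ≤ ‖(Real.cosh ξ : ℂ)‖ * ‖Pk φ 1 (Real.cosh ξ)‖ + ‖(Real.sinh ξ : ℂ)‖ ^ 2 * ‖Pk φ 2 (Real.cosh ξ)‖ := by
          refine (norm_add_le _ _).trans ?_; rw [norm_mul, norm_mul, norm_pow]
      _ ≤ Real.cosh ξ * ‖Pk φ 1 (Real.cosh ξ)‖ + (Real.cosh ξ) ^ 2 * ‖Pk φ 2 (Real.cosh ξ)‖ := by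
          rw [hcC]; gcongr
      _ ≤ 1536 * M⁻¹ + 1536 * M⁻¹ := add_le_add hP1 hP2
      _ ≤ 7680 * M⁻¹ := by have := inv_nonneg.2 hM0.le; nlinarith
  · rw [e3]
    calc ‖(Real.sinh ξ : ℂ) * Pk φ 1 (Real.cosh ξ) + 3 * (Real.sinh ξ : ℂ) * Real.cosh ξ * Pk φ 2 (Real.cosh ξ) +
          (Real.sinh ξ : ℂ) ^ 3 * Pk φ 3 (Real.cosh ξ)‖
        ≤ ‖(Real.sinh ξ : ℂ)‖ * ‖Pk φ 1 (Real.cosh ξ)‖ + 3 * ‖(Real.sinh ξ : ℂ)‖ * ‖(Real.cosh ξ : ℂ)‖ * ‖Pk φ 2 (Real.cosh ξ)‖ +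
            ‖(Real.sinh ξ : ℂ)‖ ^ 3 * ‖Pk φ 3 (Real.cosh ξ)‖ := by
          refine (norm_add_le _ _).trans (add_le_add ((norm_add_le _ _).trans (add_le_add ?_ ?_)) ?_)
          · rw [norm_mul]
          · rw [norm_mul, norm_mul, norm_mul, Complex.norm_ofNat]
          · rw [norm_mul, norm_pow]
      _ ≤ Real.cosh ξ * ‖Pk φ 1 (Real.cosh ξ)‖ + 3 * ((Real.cosh ξ) ^ 2 * ‖Pk φ 2 (Real.cosh ξ)‖) +
            (Real.cosh ξ) ^ 3 * ‖Pk φ 3 (Real.cosh ξ)‖ := by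
          rw [hcC]
          have h2 : 3 * ‖(Real.sinh ξ : ℂ)‖ * Real.cosh ξ * ‖Pk φ 2 (Real.cosh ξ)‖ ≤ 3 * ((Real.cosh ξ) ^ 2 * ‖Pk φ 2 (Real.cosh ξ)‖) := by
            have := mul_le_mul_of_nonneg_right hsC (by positivity : 0 ≤ Real.cosh ξ * ‖Pk φ 2 (Real.cosh ξ)‖)
            nlinarith
          gcongr
      _ ≤ 1536 * M⁻¹ + 3 * (1536 * M⁻¹) + 1536 * M⁻¹ := add_le_add (add_le_add hP1 (by linarith)) hP3
      _ = 7680 * M⁻¹ := by ring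

omit h in
/-- `cosh ξ ≤ |sinh ξ| + 1`. [folklore] -/
theorem cosh_le_abs_sinh_add_one (ξ : ℝ) : Real.cosh ξ ≤ |Real.sinh ξ| + 1 := by
  rw [abs_sinh, ← Real.cosh_abs]
  have h1 := Real.cosh_sub_sinh |ξ|
  have h2 : Real.exp (-|ξ|) ≤ 1 := by rw [Real.exp_le_one_iff]; linarith [abs_nonneg ξ]
  linarith

/-- `‖H₋(ξ)‖ ≤ 1536/max(1, X|sinh ξ|)`. [folklore] -/
theorem norm_Hm_le (ξ : ℝ) : ‖Hm φ ξ‖ ≤ 1536 * (max 1 (X * |Real.sinh ξ|))⁻¹ := by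
  have := h.norm_Pk_le (k := 0) (m := 1) (by norm_num) (by norm_num) (Real.sinh ξ)
  rw [pow_zero, pow_one] at this
  simpa [Hm, div_eq_mul_inv] using this

/-- `‖H₋⁽ⁿ⁾(ξ)‖ ≤ 6144 (1 + X) sinhProf X ξ` for `n = 1, 2, 3`. [folklore] -/
theorem norm_iteratedDeriv_Hm_le {n : ℕ} (hn1 : 1 ≤ n) (hn : n ≤ 3) (ξ : ℝ) :
    ‖iteratedDeriv n (Hm φ) ξ‖ ≤ 6144 * (1 + X) * sinhProf X ξ := by
  have hX := h.pos
  set N := max 1 (X * |Real.sinh ξ|) with hN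
  have hch := Real.cosh_pos ξ
  have hN0 : 0 < N := by positivity
  have hN1 : 1 ≤ N := le_max_left _ _
  have hu : X * |Real.sinh ξ| ≤ N := le_max_right _ _
  have hNi : 0 ≤ N⁻¹ := inv_nonneg.2 hN0.le
  have hcC : ‖(Real.cosh ξ : ℂ)‖ = Real.cosh ξ := by rw [Complex.norm_real, Real.norm_eq_abs, abs_of_pos hch]
  have hsC : ‖(Real.sinh ξ : ℂ)‖ = |Real.sinh ξ| := by rw [Complex.norm_real, Real.norm_eq_abs]
  -- the `P_k` bounds
  have hb1 := h.norm_Pk_le (k := 1) (m := 2) (by norm_num) (by norm_num) (Real.sinh ξ)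
  have hb2 := h.norm_Pk_le (k := 2) (m := 3) (by norm_num) (by norm_num) (Real.sinh ξ)
  have hb3 := h.norm_Pk_le (k := 3) (m := 4) (by norm_num) (by norm_num) (Real.sinh ξ)
  rw [← hN] at hb1 hb2 hb3
  -- the two summands of `sinhProf`
  set S1 := Real.cosh ξ * X * (N⁻¹) ^ 2 with hS1
  set S2 := (Real.cosh ξ) ^ 3 * X ^ 3 * (N⁻¹) ^ 4 with hS2
  have hS10 : 0 ≤ S1 := by positivity
  have hS20 : 0 ≤ S2 := by positivity
  have hprof : sinhProf X ξ = S1 + S2 := rfl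
  -- term bounds
  have t1 : Real.cosh ξ * ‖Pk φ 1 (Real.sinh ξ)‖ ≤ 1536 * S1 := by
    calc Real.cosh ξ * ‖Pk φ 1 (Real.sinh ξ)‖ ≤ Real.cosh ξ * (1536 * X ^ 1 / N ^ 2) :=
          mul_le_mul_of_nonneg_left hb1 hch.le
      _ = 1536 * S1 := by rw [hS1]; field_simp
  have t2 : Real.cosh ξ * |Real.sinh ξ| * ‖Pk φ 2 (Real.sinh ξ)‖ ≤ 1536 * S1 := by
    calc Real.cosh ξ * |Real.sinh ξ| * ‖Pk φ 2 (Real.sinh ξ)‖ ≤ Real.cosh ξ * |Real.sinh ξ| * (1536 * X ^ 2 / N ^ 3) :=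
          mul_le_mul_of_nonneg_left hb2 (by positivity)
      _ = 1536 * S1 * (X * |Real.sinh ξ| / N) := by rw [hS1]; field_simp
      _ ≤ 1536 * S1 * 1 := by
          apply mul_le_mul_of_nonneg_left _ (by positivity)
          rw [div_le_one hN0]; exact hu
      _ = 1536 * S1 := mul_one _
  have t3 : (Real.cosh ξ) ^ 3 * ‖Pk φ 3 (Real.sinh ξ)‖ ≤ 1536 * S2 := by
    calc (Real.cosh ξ) ^ 3 * ‖Pk φ 3 (Real.sinh ξ)‖ ≤ (Real.cosh ξ) ^ 3 * (1536 * X ^ 3 / N ^ 4) :=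
          mul_le_mul_of_nonneg_left hb3 (by positivity)
      _ = 1536 * S2 := by rw [hS2]; field_simp
  have t4 : |Real.sinh ξ| * ‖Pk φ 1 (Real.sinh ξ)‖ ≤ 1536 * (1 + X) * S1 := by
    have h1 : |Real.sinh ξ| ≤ Real.cosh ξ := by rw [abs_sinh, ← Real.cosh_abs]; exact (Real.sinh_lt_cosh _).le
    calc |Real.sinh ξ| * ‖Pk φ 1 (Real.sinh ξ)‖ ≤ Real.cosh ξ * ‖Pk φ 1 (Real.sinh ξ)‖ :=
          mul_le_mul_of_nonneg_right h1 (norm_nonneg _)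
      _ ≤ 1536 * S1 := t1
      _ ≤ 1536 * (1 + X) * S1 := by nlinarith
  have t5 : (Real.cosh ξ) ^ 2 * ‖Pk φ 2 (Real.sinh ξ)‖ ≤ 1536 * (1 + X) * S1 := by
    -- `cosh X ≤ N (1 + X)` since `cosh ≤ |sinh| + 1` and `X ≤ X N`
    have hcx : Real.cosh ξ * X ≤ N * (1 + X) := by
      have h1 := cosh_le_abs_sinh_add_one ξ
      calc Real.cosh ξ * X ≤ (|Real.sinh ξ| + 1) * X := mul_le_mul_of_nonneg_right h1 hX.le
        _ = X * |Real.sinh ξ| + X := by ring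
        _ ≤ N + X * N := add_le_add hu (by nlinarith)
        _ = N * (1 + X) := by ring
    calc (Real.cosh ξ) ^ 2 * ‖Pk φ 2 (Real.sinh ξ)‖ ≤ (Real.cosh ξ) ^ 2 * (1536 * X ^ 2 / N ^ 3) :=
          mul_le_mul_of_nonneg_left hb2 (by positivity)
      _ = 1536 * S1 * (Real.cosh ξ * X / N) := by rw [hS1]; field_simp
      _ ≤ 1536 * S1 * (1 + X) := by
          apply mul_le_mul_of_nonneg_left _ (by positivity)
          rw [div_le_iff₀ hN0]; linarith
      _ = 1536 * (1 + X) * S1 := by ring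
  obtain ⟨e1, e2, e3⟩ := h.iteratedDeriv_Hm
  have hX1 : (1 : ℝ) ≤ 1 + X := by linarith
  interval_cases n
  · rw [e1]
    calc ‖(Real.cosh ξ : ℂ) * Pk φ 1 (Real.sinh ξ)‖ = Real.cosh ξ * ‖Pk φ 1 (Real.sinh ξ)‖ := by rw [norm_mul, hcC]
      _ ≤ 1536 * S1 := t1
      _ ≤ 6144 * (1 + X) * sinhProf X ξ := by rw [hprof]; nlinarith
  · rw [e2]
    calc ‖(Real.sinh ξ : ℂ) * Pk φ 1 (Real.sinh ξ) + (Real.cosh ξ : ℂ) ^ 2 * Pk φ 2 (Real.sinh ξ)‖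
        ≤ |Real.sinh ξ| * ‖Pk φ 1 (Real.sinh ξ)‖ + (Real.cosh ξ) ^ 2 * ‖Pk φ 2 (Real.sinh ξ)‖ := by
          refine (norm_add_le _ _).trans ?_; rw [norm_mul, norm_mul, norm_pow, hsC, hcC]
      _ ≤ 1536 * (1 + X) * S1 + 1536 * (1 + X) * S1 := add_le_add t4 t5
      _ ≤ 6144 * (1 + X) * sinhProf X ξ := by rw [hprof]; nlinarith
  · rw [e3]
    calc ‖(Real.cosh ξ : ℂ) * Pk φ 1 (Real.sinh ξ) + 3 * (Real.cosh ξ : ℂ) * Real.sinh ξ * Pk φ 2 (Real.sinh ξ) +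
          (Real.cosh ξ : ℂ) ^ 3 * Pk φ 3 (Real.sinh ξ)‖
        ≤ Real.cosh ξ * ‖Pk φ 1 (Real.sinh ξ)‖ + 3 * (Real.cosh ξ * |Real.sinh ξ| * ‖Pk φ 2 (Real.sinh ξ)‖) +
            (Real.cosh ξ) ^ 3 * ‖Pk φ 3 (Real.sinh ξ)‖ := by
          refine (norm_add_le _ _).trans (add_le_add ((norm_add_le _ _).trans (add_le_add ?_ ?_)) ?_)
          · rw [norm_mul, hcC]
          · rw [norm_mul, norm_mul, norm_mul, Complex.norm_ofNat, hcC, hsC]; ring_nf; rfl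
          · rw [norm_mul, norm_pow, hcC]
      _ ≤ 1536 * S1 + 3 * (1536 * S1) + 1536 * S2 := add_le_add (add_le_add t1 (by linarith)) t3
      _ ≤ 6144 * (1 + X) * sinhProf X ξ := by rw [hprof]; nlinarith

/-- `‖Q(θ)‖ ≤ 1536/max(1, X|sin θ|)`. [folklore] -/
theorem norm_Qs_le (θ : ℝ) : ‖Qs φ θ‖ ≤ 1536 * (max 1 (X * |Real.sin θ|))⁻¹ := by
  have := h.norm_four_psi_le (n := 0) (m := 1) (by norm_num) (by norm_num) (Real.sin θ)
  rw [pow_zero, pow_one] at this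
  simpa [Qs, div_eq_mul_inv] using this

/-- `‖Q'''(θ)‖ ≤ 1536 (4X + X³)/max(1, X|sin θ|)`. [folklore] -/
theorem norm_iteratedDeriv_three_Qs_le (θ : ℝ) :
    ‖iteratedDeriv 3 (Qs φ) θ‖ ≤ 1536 * (4 * X + X ^ 3) * (max 1 (X * |Real.sin θ|))⁻¹ := by
  have hX := h.pos
  set N := max 1 (X * |Real.sin θ|) with hN
  have hN0 : 0 < N := by positivity
  have hN1 : 1 ≤ N := le_max_left _ _
  have hu : X * |Real.sin θ| ≤ N := le_max_right _ _
  have hNi : 0 ≤ N⁻¹ := inv_nonneg.2 hN0.le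
  have hNi1 : N⁻¹ ≤ 1 := inv_le_one_of_one_le₀ hN1
  have hb1 := h.norm_four_psi_le (n := 1) (m := 2) (by norm_num) (by norm_num) (Real.sin θ)
  have hb2 := h.norm_four_psi_le (n := 2) (m := 3) (by norm_num) (by norm_num) (Real.sin θ)
  have hb3 := h.norm_four_psi_le (n := 3) (m := 4) (by norm_num) (by norm_num) (Real.sin θ)
  rw [← hN] at hb1 hb2 hb3
  have hcos : |Real.cos θ| ≤ 1 := Real.abs_cos_le_one θ
  have hsin : |Real.sin θ| ≤ 1 := Real.abs_sin_le_one θ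
  have hcC : ‖(Real.cos θ : ℂ)‖ = |Real.cos θ| := by rw [Complex.norm_real, Real.norm_eq_abs]
  have hncC : ‖((-Real.cos θ : ℝ) : ℂ)‖ = |Real.cos θ| := by rw [Complex.norm_real, Real.norm_eq_abs, abs_neg]
  have hnsC : ‖((-Real.sin θ : ℝ) : ℂ)‖ = |Real.sin θ| := by rw [Complex.norm_real, Real.norm_eq_abs, abs_neg]
  -- `1/N^m ≤ 1/N`
  have hp2 : (N ^ 2)⁻¹ ≤ N⁻¹ := by rw [← inv_pow]; exact inv_max_pow_le 2 (by norm_num)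
  have hp4 : (N ^ 4)⁻¹ ≤ N⁻¹ := by rw [← inv_pow]; exact inv_max_pow_le 4 (by norm_num)
  have t1 : |Real.cos θ| * ‖four (psi φ 1) (Real.sin θ)‖ ≤ 1536 * X * N⁻¹ := by
    calc |Real.cos θ| * ‖four (psi φ 1) (Real.sin θ)‖ ≤ 1 * (1536 * X ^ 1 / N ^ 2) :=
          mul_le_mul hcos hb1 (norm_nonneg _) zero_le_one
      _ = 1536 * X * (N ^ 2)⁻¹ := by ring
      _ ≤ 1536 * X * N⁻¹ := mul_le_mul_of_nonneg_left hp2 (by positivity)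
  have t2 : |Real.cos θ| * |Real.sin θ| * ‖four (psi φ 2) (Real.sin θ)‖ ≤ 1536 * X * N⁻¹ := by
    calc |Real.cos θ| * |Real.sin θ| * ‖four (psi φ 2) (Real.sin θ)‖ ≤ 1 * |Real.sin θ| * (1536 * X ^ 2 / N ^ 3) :=
          mul_le_mul (mul_le_mul_of_nonneg_right hcos (abs_nonneg _)) hb2 (norm_nonneg _) (by positivity)
      _ = 1536 * X * (N ^ 2)⁻¹ * (X * |Real.sin θ| / N) := by field_simp
      _ ≤ 1536 * X * (N ^ 2)⁻¹ * 1 := by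
          apply mul_le_mul_of_nonneg_left _ (by positivity)
          rw [div_le_one hN0]; exact hu
      _ ≤ 1536 * X * N⁻¹ := by rw [mul_one]; exact mul_le_mul_of_nonneg_left hp2 (by positivity)
  have t3 : |Real.cos θ| ^ 3 * ‖four (psi φ 3) (Real.sin θ)‖ ≤ 1536 * X ^ 3 * N⁻¹ := by
    have hc3 : |Real.cos θ| ^ 3 ≤ 1 := pow_le_one₀ (abs_nonneg _) hcos
    calc |Real.cos θ| ^ 3 * ‖four (psi φ 3) (Real.sin θ)‖ ≤ 1 * (1536 * X ^ 3 / N ^ 4) :=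
          mul_le_mul hc3 hb3 (norm_nonneg _) zero_le_one
      _ = 1536 * X ^ 3 * (N ^ 4)⁻¹ := by ring
      _ ≤ 1536 * X ^ 3 * N⁻¹ := mul_le_mul_of_nonneg_left hp4 (by positivity)
  obtain ⟨-, -, e3⟩ := h.iteratedDeriv_Qs
  rw [e3]
  calc ‖((-Real.cos θ : ℝ) : ℂ) * four (psi φ 1) (Real.sin θ) +
        3 * (Real.cos θ : ℂ) * ((-Real.sin θ : ℝ) : ℂ) * four (psi φ 2) (Real.sin θ) +
        (Real.cos θ : ℂ) ^ 3 * four (psi φ 3) (Real.sin θ)‖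
      ≤ |Real.cos θ| * ‖four (psi φ 1) (Real.sin θ)‖ + 3 * (|Real.cos θ| * |Real.sin θ| * ‖four (psi φ 2) (Real.sin θ)‖) +
          |Real.cos θ| ^ 3 * ‖four (psi φ 3) (Real.sin θ)‖ := by
        refine (norm_add_le _ _).trans (add_le_add ((norm_add_le _ _).trans (add_le_add ?_ ?_)) ?_)
        · rw [norm_mul, hncC]
        · rw [norm_mul, norm_mul, norm_mul, Complex.norm_ofNat, hcC, hnsC]; ring_nf; rfl
        · rw [norm_mul, norm_pow, hcC]
    _ ≤ 1536 * X * N⁻¹ + 3 * (1536 * X * N⁻¹) + 1536 * X ^ 3 * N⁻¹ := add_le_add (add_le_add t1 (by linarith)) t3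
    _ = 1536 * (4 * X + X ^ 3) * N⁻¹ := by ring

end IsTest

/-! ### Fourier decay for `C^N` functions with integrable derivatives -/

/-- `|w|^m ‖𝓐 g w‖ ≤ ∫ ‖g^{(m)}‖` for `g ∈ C^N` with `g, …, g^{(N)}` integrable and `m ≤ N`. [folklore] -/
theorem pow_mul_norm_four_le' {g : ℝ → ℂ} {N : ℕ} (hg : ContDiff ℝ N g)
    (hint : ∀ n : ℕ, n ≤ N → Integrable (iteratedDeriv n g)) {m : ℕ} (hm : m ≤ N) (w : ℝ) :
    |w| ^ m * ‖four g w‖ ≤ ∫ x, ‖iteratedDeriv m g x‖ := by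
  have hint' : ∀ n : ℕ, (n : ℕ∞) ≤ (N : ℕ∞) → Integrable (iteratedDeriv n g) := fun n hn =>
    hint n (by exact_mod_cast hn)
  have key := Real.fourier_iteratedDeriv (N := (N : ℕ∞)) (n := m) (by exact_mod_cast hg) hint' (by exact_mod_cast hm)
  have hval := congrFun key (w / (2 * π))
  have hnorm : ‖𝓕 (iteratedDeriv m g) (w / (2 * π))‖ = |w| ^ m * ‖four g w‖ := by
    rw [hval, norm_smul, four]
    congr 1
    rw [norm_pow]
    congr 1
    have hπ : (π : ℂ) ≠ 0 := by exact_mod_cast Real.pi_ne_zero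
    have : (2 * π * I * ↑(w / (2 * π)) : ℂ) = I * w := by push_cast; field_simp
    rw [this, norm_mul, Complex.norm_I, one_mul, Complex.norm_real, Real.norm_eq_abs]
  rw [← hnorm]
  exact VectorFourier.norm_fourierIntegral_le_integral_norm _ _ _ _ _

/-- The cosine-transform identity `4 ∫ cos(2tξ) H(ξ) dξ = 2 (𝓐 H (2t) + 𝓐 H (-2t))`. [folklore] -/
theorem four_mul_integral_cos_mul {H : ℝ → ℂ} (hH : Integrable H) (t : ℝ) :
    4 * ∫ ξ, (Real.cos (2 * t * ξ) : ℂ) * H ξ = 2 * (four H (2 * t) + four H (-(2 * t))) := by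
  have hi : ∀ w : ℝ, Integrable fun ξ : ℝ => Complex.exp (-(I * w * ξ)) * H ξ := by
    intro w
    refine hH.bdd_mul (c := 1) ((Complex.continuous_exp.comp (by fun_prop)).aestronglyMeasurable) ?_
    exact Filter.Eventually.of_forall fun ξ => by rw [Complex.norm_exp]; simp
  rw [four_eq_integral, four_eq_integral, ← integral_add (hi _) (hi _), ← integral_const_mul, ← integral_const_mul]
  refine integral_congr_ae (Filter.Eventually.of_forall fun ξ => ?_)
  have : (Real.cos (2 * t * ξ) : ℂ) = (Complex.exp (-(I * ↑(2 * t) * ξ)) + Complex.exp (-(I * ↑(-(2 * t)) * ξ))) / 2 := by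
    rw [Complex.ofReal_cos, Complex.cos]; push_cast; ring_nf
  dsimp only
  rw [this]; ring

/-- **Cosine transforms of `C³` functions decay like `|t|^{-3}`**:
`‖4 ∫ cos(2tξ) H(ξ) dξ‖ ≤ (∫ ‖H'''‖) / (2|t|³)` for `t ≠ 0`. [folklore] -/
theorem norm_cos_transform_le_of_C3 {H : ℝ → ℂ} (hH : ContDiff ℝ 3 H)
    (hint : ∀ n : ℕ, n ≤ 3 → Integrable (iteratedDeriv n H)) {t : ℝ} (ht : t ≠ 0) :
    ‖4 * ∫ ξ, (Real.cos (2 * t * ξ) : ℂ) * H ξ‖ ≤ (∫ x, ‖iteratedDeriv 3 H x‖) / (2 * |t| ^ 3) := by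
  have hH0 : Integrable H := by simpa using hint 0 (by norm_num)
  rw [four_mul_integral_cos_mul hH0]
  have h1 := pow_mul_norm_four_le' hH hint le_rfl (2 * t)
  have h2 := pow_mul_norm_four_le' hH hint le_rfl (-(2 * t))
  rw [abs_neg] at h2
  have ht8 : 0 < |2 * t| ^ 3 := by positivity
  set D := ∫ x, ‖iteratedDeriv 3 H x‖
  have hb : ∀ s : ℝ, |2 * t| ^ 3 * ‖four H s‖ ≤ D → ‖four H s‖ ≤ D / |2 * t| ^ 3 := fun s hs => by
    rw [le_div_iff₀ ht8]; linarith
  calc ‖2 * (four H (2 * t) + four H (-(2 * t)))‖ ≤ 2 * (‖four H (2 * t)‖ + ‖four H (-(2 * t))‖) := by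
        rw [norm_mul, Complex.norm_ofNat]; gcongr; exact norm_add_le _ _
    _ ≤ 2 * (D / |2 * t| ^ 3 + D / |2 * t| ^ 3) := by gcongr <;> [exact hb _ h1; exact hb _ h2]
    _ = D / (2 * |t| ^ 3) := by rw [abs_mul, abs_two]; field_simp; ring

/-- The trivial bound `‖4 ∫ w(ξ) H(ξ) dξ‖ ≤ 4 ∫ ‖w‖ ‖H‖`-type: for a real weight `w` and a bound
`‖H ξ‖ ≤ B ξ` with `w · B` integrable, `‖4 ∫ w H‖ ≤ 4 ∫ |w| B`. [folklore] -/
theorem norm_weighted_integral_le {H : ℝ → ℂ} {w B : ℝ → ℝ} (hB : ∀ ξ, ‖H ξ‖ ≤ B ξ)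
    (hwB : Integrable fun ξ => |w ξ| * B ξ) :
    ‖4 * ∫ ξ, (w ξ : ℂ) * H ξ‖ ≤ 4 * ∫ ξ, |w ξ| * B ξ := by
  rw [norm_mul, Complex.norm_ofNat]
  gcongr
  calc ‖∫ ξ, (w ξ : ℂ) * H ξ‖ ≤ ∫ ξ, ‖(w ξ : ℂ) * H ξ‖ := norm_integral_le_integral_norm _
    _ ≤ ∫ ξ, |w ξ| * B ξ := by
        apply integral_mono_of_nonneg (Filter.Eventually.of_forall fun ξ => norm_nonneg _) hwB
        exact Filter.Eventually.of_forall fun ξ => by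
          dsimp only
          rw [norm_mul, Complex.norm_real, Real.norm_eq_abs]
          exact mul_le_mul_of_nonneg_left (hB ξ) (abs_nonneg _)

/-! ### Integrability and `L¹` bounds of the profiles -/

/-- `∫ dξ/max(1, X cosh ξ) ≤ 64 Λ(X)` and integrability. [folklore] -/
theorem integrable_inv_max_cosh {X : ℝ} (hX : 0 < X) : Integrable fun ξ : ℝ => (max 1 (X * Real.cosh ξ))⁻¹ := by
  have := integrable_cosh_div_max hX le_rfl (by norm_num : (0:ℝ) ≤ 1 / 4)
  simpa using this

/-- `∫ dξ/max(1, X cosh ξ) ≤ 64 Λ(X)`. [folklore] -/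
theorem integral_inv_max_cosh_le {X : ℝ} (hX : 0 < X) : ∫ ξ, (max 1 (X * Real.cosh ξ))⁻¹ ≤ 64 * Lam X := by
  have := integral_cosh_div_max_le hX le_rfl (by norm_num : (0:ℝ) ≤ 1 / 4)
  simp only [mul_zero, zero_mul, Real.cosh_zero, one_mul, Real.rpow_zero] at this
  linarith

/-- Integrability of `1/max(1, X|sinh ξ|)`. [folklore] -/
theorem integrable_inv_max_sinh {X : ℝ} (hX : 0 < X) : Integrable fun ξ : ℝ => (max 1 (X * |Real.sinh ξ|))⁻¹ := by
  have := integrable_cosh_div_max_sinh hX le_rfl (by norm_num : (0:ℝ) ≤ 1 / 4)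
  simpa using this

/-- `∫ dξ/max(1, X|sinh ξ|) ≤ 80 Λ(X)`. [folklore] -/
theorem integral_inv_max_sinh_le {X : ℝ} (hX : 0 < X) : ∫ ξ, (max 1 (X * |Real.sinh ξ|))⁻¹ ≤ 80 * Lam X := by
  have := integral_cosh_div_max_sinh_le hX le_rfl (by norm_num : (0:ℝ) ≤ 1 / 4)
  simp only [mul_zero, zero_mul, Real.cosh_zero, one_mul, Real.rpow_zero] at this
  linarith

namespace IsTest

variable {X : ℝ} {φ : ℝ → ℂ} (h : IsTest X φ)
include h

/-- `H₊` and its first three derivatives are integrable. [folklore] -/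
theorem integrable_iteratedDeriv_Hp {n : ℕ} (hn : n ≤ 3) : Integrable (iteratedDeriv n (Hp φ)) := by
  have hX := h.pos
  have hc : Continuous (iteratedDeriv n (Hp φ)) := h.contDiff_Hp.continuous_iteratedDeriv n (by exact_mod_cast le_top)
  refine (((integrable_inv_max_cosh hX).const_mul 7680)).mono' hc.aestronglyMeasurable ?_
  refine Filter.Eventually.of_forall fun ξ => ?_
  rcases Nat.eq_zero_or_pos n with rfl | hn1
  · rw [iteratedDeriv_zero]
    have := h.norm_Hp_le ξ
    have h0 : 0 ≤ (max 1 (X * Real.cosh ξ))⁻¹ := inv_nonneg.2 (by positivity)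
    linarith
  · exact h.norm_iteratedDeriv_Hp_le hn1 hn ξ

/-- `∫ ‖H₊‖ ≤ 98304 Λ(X)`. [folklore] -/
theorem integral_norm_Hp_le : ∫ ξ, ‖Hp φ ξ‖ ≤ 98304 * Lam X := by
  have hX := h.pos
  calc ∫ ξ, ‖Hp φ ξ‖ ≤ ∫ ξ, 1536 * (max 1 (X * Real.cosh ξ))⁻¹ :=
        integral_mono_of_nonneg (Filter.Eventually.of_forall fun ξ => norm_nonneg _)
          ((integrable_inv_max_cosh hX).const_mul 1536) (Filter.Eventually.of_forall fun ξ => h.norm_Hp_le ξ)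
    _ = 1536 * ∫ ξ, (max 1 (X * Real.cosh ξ))⁻¹ := integral_const_mul _ _
    _ ≤ 1536 * (64 * Lam X) := by gcongr; exact integral_inv_max_cosh_le hX
    _ = 98304 * Lam X := by ring

/-- `∫ ‖H₊'''‖ ≤ 491520 Λ(X)`. [folklore] -/
theorem integral_norm_iteratedDeriv_three_Hp_le : ∫ ξ, ‖iteratedDeriv 3 (Hp φ) ξ‖ ≤ 491520 * Lam X := by
  have hX := h.pos
  calc ∫ ξ, ‖iteratedDeriv 3 (Hp φ) ξ‖ ≤ ∫ ξ, 7680 * (max 1 (X * Real.cosh ξ))⁻¹ :=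
        integral_mono_of_nonneg (Filter.Eventually.of_forall fun ξ => norm_nonneg _)
          ((integrable_inv_max_cosh hX).const_mul 7680)
          (Filter.Eventually.of_forall fun ξ => h.norm_iteratedDeriv_Hp_le (by norm_num) le_rfl ξ)
    _ = 7680 * ∫ ξ, (max 1 (X * Real.cosh ξ))⁻¹ := integral_const_mul _ _
    _ ≤ 7680 * (64 * Lam X) := by gcongr; exact integral_inv_max_cosh_le hX
    _ = 491520 * Lam X := by ring

/-- `H₋` and its first three derivatives are integrable. [folklore] -/
theorem integrable_iteratedDeriv_Hm {n : ℕ} (hn : n ≤ 3) : Integrable (iteratedDeriv n (Hm φ)) := by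
  have hX := h.pos
  have hc : Continuous (iteratedDeriv n (Hm φ)) := h.contDiff_Hm.continuous_iteratedDeriv n (by exact_mod_cast le_top)
  rcases Nat.eq_zero_or_pos n with rfl | hn1
  · refine (((integrable_inv_max_sinh hX).const_mul 1536)).mono' hc.aestronglyMeasurable ?_
    refine Filter.Eventually.of_forall fun ξ => ?_
    rw [iteratedDeriv_zero]; exact h.norm_Hm_le ξ
  · refine (((integrable_sinhProf hX).const_mul (6144 * (1 + X)))).mono' hc.aestronglyMeasurable ?_
    exact Filter.Eventually.of_forall fun ξ => h.norm_iteratedDeriv_Hm_le hn1 hn ξ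

/-- `∫ ‖H₋‖ ≤ 122880 Λ(X)`. [folklore] -/
theorem integral_norm_Hm_le : ∫ ξ, ‖Hm φ ξ‖ ≤ 122880 * Lam X := by
  have hX := h.pos
  calc ∫ ξ, ‖Hm φ ξ‖ ≤ ∫ ξ, 1536 * (max 1 (X * |Real.sinh ξ|))⁻¹ :=
        integral_mono_of_nonneg (Filter.Eventually.of_forall fun ξ => norm_nonneg _)
          ((integrable_inv_max_sinh hX).const_mul 1536) (Filter.Eventually.of_forall fun ξ => h.norm_Hm_le ξ)
    _ = 1536 * ∫ ξ, (max 1 (X * |Real.sinh ξ|))⁻¹ := integral_const_mul _ _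
    _ ≤ 1536 * (80 * Lam X) := by gcongr; exact integral_inv_max_sinh_le hX
    _ = 122880 * Lam X := by ring

/-- The sharp bound on `H₋'''`: `‖H₋'''(ξ)‖ ≤ 6144 sinhProf X ξ`. [folklore] -/
theorem norm_iteratedDeriv_three_Hm_le (ξ : ℝ) : ‖iteratedDeriv 3 (Hm φ) ξ‖ ≤ 6144 * sinhProf X ξ := by
  have hX := h.pos
  set N := max 1 (X * |Real.sinh ξ|) with hN
  have hch := Real.cosh_pos ξ
  have hN0 : 0 < N := by positivity
  have hu : X * |Real.sinh ξ| ≤ N := le_max_right _ _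
  have hcC : ‖(Real.cosh ξ : ℂ)‖ = Real.cosh ξ := by rw [Complex.norm_real, Real.norm_eq_abs, abs_of_pos hch]
  have hsC : ‖(Real.sinh ξ : ℂ)‖ = |Real.sinh ξ| := by rw [Complex.norm_real, Real.norm_eq_abs]
  have hb1 := h.norm_Pk_le (k := 1) (m := 2) (by norm_num) (by norm_num) (Real.sinh ξ)
  have hb2 := h.norm_Pk_le (k := 2) (m := 3) (by norm_num) (by norm_num) (Real.sinh ξ)
  have hb3 := h.norm_Pk_le (k := 3) (m := 4) (by norm_num) (by norm_num) (Real.sinh ξ)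
  rw [← hN] at hb1 hb2 hb3
  set S1 := Real.cosh ξ * X * (N⁻¹) ^ 2 with hS1
  set S2 := (Real.cosh ξ) ^ 3 * X ^ 3 * (N⁻¹) ^ 4 with hS2
  have hS10 : 0 ≤ S1 := by positivity
  have hS20 : 0 ≤ S2 := by positivity
  have hprof : sinhProf X ξ = S1 + S2 := rfl
  have t1 : Real.cosh ξ * ‖Pk φ 1 (Real.sinh ξ)‖ ≤ 1536 * S1 := by
    calc Real.cosh ξ * ‖Pk φ 1 (Real.sinh ξ)‖ ≤ Real.cosh ξ * (1536 * X ^ 1 / N ^ 2) :=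
          mul_le_mul_of_nonneg_left hb1 hch.le
      _ = 1536 * S1 := by rw [hS1]; field_simp
  have t2 : Real.cosh ξ * |Real.sinh ξ| * ‖Pk φ 2 (Real.sinh ξ)‖ ≤ 1536 * S1 := by
    calc Real.cosh ξ * |Real.sinh ξ| * ‖Pk φ 2 (Real.sinh ξ)‖ ≤ Real.cosh ξ * |Real.sinh ξ| * (1536 * X ^ 2 / N ^ 3) :=
          mul_le_mul_of_nonneg_left hb2 (by positivity)
      _ = 1536 * S1 * (X * |Real.sinh ξ| / N) := by rw [hS1]; field_simp
      _ ≤ 1536 * S1 * 1 := by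
          apply mul_le_mul_of_nonneg_left _ (by positivity)
          rw [div_le_one hN0]; exact hu
      _ = 1536 * S1 := mul_one _
  have t3 : (Real.cosh ξ) ^ 3 * ‖Pk φ 3 (Real.sinh ξ)‖ ≤ 1536 * S2 := by
    calc (Real.cosh ξ) ^ 3 * ‖Pk φ 3 (Real.sinh ξ)‖ ≤ (Real.cosh ξ) ^ 3 * (1536 * X ^ 3 / N ^ 4) :=
          mul_le_mul_of_nonneg_left hb3 (by positivity)
      _ = 1536 * S2 := by rw [hS2]; field_simp
  obtain ⟨-, -, e3⟩ := h.iteratedDeriv_Hm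
  rw [e3]
  calc ‖(Real.cosh ξ : ℂ) * Pk φ 1 (Real.sinh ξ) + 3 * (Real.cosh ξ : ℂ) * Real.sinh ξ * Pk φ 2 (Real.sinh ξ) +
        (Real.cosh ξ : ℂ) ^ 3 * Pk φ 3 (Real.sinh ξ)‖
      ≤ Real.cosh ξ * ‖Pk φ 1 (Real.sinh ξ)‖ + 3 * (Real.cosh ξ * |Real.sinh ξ| * ‖Pk φ 2 (Real.sinh ξ)‖) +
          (Real.cosh ξ) ^ 3 * ‖Pk φ 3 (Real.sinh ξ)‖ := by
        refine (norm_add_le _ _).trans (add_le_add ((norm_add_le _ _).trans (add_le_add ?_ ?_)) ?_)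
        · rw [norm_mul, hcC]
        · rw [norm_mul, norm_mul, norm_mul, Complex.norm_ofNat, hcC, hsC]; ring_nf; rfl
        · rw [norm_mul, norm_pow, hcC]
    _ ≤ 1536 * S1 + 3 * (1536 * S1) + 1536 * S2 := add_le_add (add_le_add t1 (by linarith)) t3
    _ ≤ 6144 * sinhProf X ξ := by rw [hprof]; nlinarith

/-- `∫ ‖H₋'''‖ ≤ 1536000 Λ(X) (1+X)³`. [folklore] -/
theorem integral_norm_iteratedDeriv_three_Hm_le :
    ∫ ξ, ‖iteratedDeriv 3 (Hm φ) ξ‖ ≤ 1536000 * Lam X * (1 + X) ^ 3 := by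
  have hX := h.pos
  have hΛ : (1 + |Real.log X|) * (1 + X) ^ 2 = Lam X * (1 + X) ^ 3 := by
    unfold Lam; field_simp
  calc ∫ ξ, ‖iteratedDeriv 3 (Hm φ) ξ‖ ≤ ∫ ξ, 6144 * sinhProf X ξ :=
        integral_mono_of_nonneg (Filter.Eventually.of_forall fun ξ => norm_nonneg _)
          ((integrable_sinhProf hX).const_mul 6144)
          (Filter.Eventually.of_forall fun ξ => h.norm_iteratedDeriv_three_Hm_le ξ)
    _ = 6144 * ∫ ξ, sinhProf X ξ := integral_const_mul _ _
    _ ≤ 6144 * (250 * (1 + |Real.log X|) * (1 + X) ^ 2) := by gcongr; exact integral_sinhProf_le hX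
    _ = 1536000 * Lam X * (1 + X) ^ 3 := by rw [mul_assoc 250, hΛ]; ring

/-- `∫_{-π}^{π} ‖Q‖ ≤ 12288 π Λ(X)`. [folklore] -/
theorem integral_norm_Qs_le : ∫ θ in (-π : ℝ)..π, ‖Qs φ θ‖ ≤ 12288 * π * Lam X := by
  have hX := h.pos
  have hc : Continuous fun θ : ℝ => (max 1 (X * |Real.sin θ|))⁻¹ := by
    have : Continuous fun θ => max 1 (X * |Real.sin θ|) := by fun_prop
    exact this.inv₀ fun θ => by positivity
  calc ∫ θ in (-π : ℝ)..π, ‖Qs φ θ‖ ≤ ∫ θ in (-π : ℝ)..π, 1536 * (max 1 (X * |Real.sin θ|))⁻¹ := by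
        apply intervalIntegral.integral_mono_on (by linarith [Real.pi_pos])
          ((h.contDiff_Qs.continuous.norm).intervalIntegrable _ _) ((continuous_const.mul hc).intervalIntegrable _ _)
        exact fun θ _ => h.norm_Qs_le θ
    _ = 1536 * ∫ θ in (-π : ℝ)..π, (max 1 (X * |Real.sin θ|))⁻¹ := intervalIntegral.integral_const_mul _ _
    _ ≤ 1536 * (8 * π * Lam X) := by gcongr; exact sin_integral_le_Lam hX
    _ = 12288 * π * Lam X := by ring

/-- `∫_{-π}^{π} ‖Q'''‖ ≤ 61440 π Λ(X) (1 + X)³`. [folklore] -/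
theorem integral_norm_iteratedDeriv_three_Qs_le :
    ∫ θ in (-π : ℝ)..π, ‖iteratedDeriv 3 (Qs φ) θ‖ ≤ 61440 * π * Lam X * (1 + X) ^ 3 := by
  have hX := h.pos
  have hπ := Real.pi_pos
  have hc : Continuous fun θ : ℝ => (max 1 (X * |Real.sin θ|))⁻¹ := by
    have : Continuous fun θ => max 1 (X * |Real.sin θ|) := by fun_prop
    exact this.inv₀ fun θ => by positivity
  have hQc : Continuous (iteratedDeriv 3 (Qs φ)) :=
    h.contDiff_Qs.continuous_iteratedDeriv 3 (WithTop.coe_le_coe.mpr le_top)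
  have h1 : ∫ θ in (-π : ℝ)..π, ‖iteratedDeriv 3 (Qs φ) θ‖ ≤
      1536 * (4 * X + X ^ 3) * (4 * π * (1 + Real.log (max 1 X)) / max 1 X) := by
    calc ∫ θ in (-π : ℝ)..π, ‖iteratedDeriv 3 (Qs φ) θ‖
        ≤ ∫ θ in (-π : ℝ)..π, 1536 * (4 * X + X ^ 3) * (max 1 (X * |Real.sin θ|))⁻¹ := by
          apply intervalIntegral.integral_mono_on (by linarith) (hQc.norm.intervalIntegrable _ _)
            ((continuous_const.mul hc).intervalIntegrable _ _)
          exact fun θ _ => h.norm_iteratedDeriv_three_Qs_le θ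
      _ = 1536 * (4 * X + X ^ 3) * ∫ θ in (-π : ℝ)..π, (max 1 (X * |Real.sin θ|))⁻¹ :=
          intervalIntegral.integral_const_mul _ _
      _ ≤ 1536 * (4 * X + X ^ 3) * (4 * π * (1 + Real.log (max 1 X)) / max 1 X) := by
          gcongr; exact sin_integral_le hX
  refine h1.trans ?_
  have hΛ0 := Lam_nonneg hX.le
  rcases le_or_gt 1 X with hX1 | hX1
  · rw [max_eq_right hX1]
    have hlog : 0 ≤ Real.log X := Real.log_nonneg hX1
    have hΛ : 1 + Real.log X = Lam X * (1 + X) := by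
      unfold Lam; rw [abs_of_nonneg hlog]; field_simp
    calc 1536 * (4 * X + X ^ 3) * (4 * π * (1 + Real.log X) / X)
        = 1536 * 4 * π * (4 + X ^ 2) * (1 + Real.log X) := by field_simp
      _ = 1536 * 4 * π * (4 + X ^ 2) * (Lam X * (1 + X)) := by rw [hΛ]
      _ ≤ 1536 * 4 * π * (4 * (1 + X) ^ 2) * (Lam X * (1 + X)) := by gcongr; nlinarith
      _ = 24576 * π * Lam X * (1 + X) ^ 3 := by ring
      _ ≤ 61440 * π * Lam X * (1 + X) ^ 3 := by gcongr; norm_num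
  · rw [max_eq_left hX1.le, Real.log_one, add_zero, mul_one, div_one]
    have h2 : 1 ≤ 2 * Lam X := by
      have := one_add_abs_log_le_two_mul_Lam hX.le hX1.le
      linarith [abs_nonneg (Real.log X)]
    have h3 : 4 * X + X ^ 3 ≤ 5 := by
      have : X ^ 3 ≤ 1 := pow_le_one₀ hX.le hX1.le
      linarith
    have h4 : (1 : ℝ) ≤ (1 + X) ^ 3 := one_le_pow₀ (by linarith)
    calc 1536 * (4 * X + X ^ 3) * (4 * π) ≤ 1536 * 5 * (4 * π) := by gcongr
      _ = 30720 * π * 1 * 1 := by ring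
      _ ≤ 30720 * π * (2 * Lam X) * (1 + X) ^ 3 := by gcongr
      _ = 61440 * π * Lam X * (1 + X) ^ 3 := by ring

end IsTest

/-! ### Bessel's integral in exponential form and the holomorphic transform -/

section Bessel

open Literature.Analysis.FunctionSpaces

/-- **Bessel's integral, exponential form**: `J_n(x) = (2π)⁻¹ ∫_{-π}^{π} e^{i(nθ - x sin θ)} dθ`
(from the tree's `J_n(x) = π⁻¹ ∫₀^π cos(nθ - x sin θ) dθ`: the sine part is odd, the cosine part even).
[cite: Watson1944, §2.2 (1); DLMF 10.9.2] -/
theorem besselJ_eq_integral_exp (n : ℕ) (x : ℝ) :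
    (besselJ n x : ℂ) = (1 / (2 * π) : ℂ) * ∫ θ in (-π : ℝ)..π, Complex.exp (I * ((n : ℝ) * θ - x * Real.sin θ : ℝ)) := by
  set u : ℝ → ℝ := fun θ => (n : ℝ) * θ - x * Real.sin θ with hu
  have huc : Continuous u := by simp only [hu]; fun_prop
  have hodd : ∀ θ, u (-θ) = -u θ := fun θ => by simp only [hu, Real.sin_neg]; ring
  -- split the exponential into cosine and sine
  have hsplit : ∀ θ, Complex.exp (I * (u θ : ℝ)) = (Real.cos (u θ) : ℂ) + (Real.sin (u θ) : ℂ) * I := by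
    intro θ; rw [mul_comm, Complex.exp_mul_I, ← Complex.ofReal_cos, ← Complex.ofReal_sin]
  have hci : ∀ a b : ℝ, IntervalIntegrable (fun θ => (Real.cos (u θ) : ℂ)) volume a b := fun a b =>
    (Complex.continuous_ofReal.comp (Real.continuous_cos.comp huc)).intervalIntegrable _ _
  have hsi : ∀ a b : ℝ, IntervalIntegrable (fun θ => (Real.sin (u θ) : ℂ) * I) volume a b := fun a b =>
    ((Complex.continuous_ofReal.comp (Real.continuous_sin.comp huc)).mul continuous_const).intervalIntegrable _ _
  have e1 : ∫ θ in (-π : ℝ)..π, Complex.exp (I * (u θ : ℝ)) =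
      (∫ θ in (-π : ℝ)..π, (Real.cos (u θ) : ℂ)) + ∫ θ in (-π : ℝ)..π, (Real.sin (u θ) : ℂ) * I := by
    rw [← intervalIntegral.integral_add (hci _ _) (hsi _ _)]
    exact intervalIntegral.integral_congr fun θ _ => hsplit θ
  -- the sine part vanishes (odd integrand)
  have hsin0 : ∫ θ in (-π : ℝ)..π, (Real.sin (u θ) : ℂ) * I = 0 := by
    rw [intervalIntegral.integral_mul_const, intervalIntegral.integral_ofReal]
    suffices hz : ∫ θ in (-π : ℝ)..π, Real.sin (u θ) = 0 by rw [hz]; simp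
    have hsc : ∀ a b : ℝ, IntervalIntegrable (fun θ => Real.sin (u θ)) volume a b := fun a b =>
      (Real.continuous_sin.comp huc).intervalIntegrable _ _
    have h1 : ∫ θ in (-π : ℝ)..0, Real.sin (u θ) = -∫ θ in (0 : ℝ)..π, Real.sin (u θ) := by
      have h2 : ∫ θ in (0 : ℝ)..π, Real.sin (u (-θ)) = ∫ θ in (-π : ℝ)..(-0), Real.sin (u θ) :=
        intervalIntegral.integral_comp_neg fun θ => Real.sin (u θ)
      rw [neg_zero] at h2
      rw [← h2, ← intervalIntegral.integral_neg]
      refine intervalIntegral.integral_congr fun θ _ => ?_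
      simp only [hodd, Real.sin_neg]
    rw [← intervalIntegral.integral_add_adjacent_intervals (hsc (-π) 0) (hsc 0 π), h1]; ring
  -- the cosine part is twice the integral over `[0, π]`
  have hcos : ∫ θ in (-π : ℝ)..π, (Real.cos (u θ) : ℂ) = 2 * ((∫ θ in (0 : ℝ)..π, Real.cos (u θ) : ℝ) : ℂ) := by
    rw [intervalIntegral.integral_ofReal]
    have hcc : ∀ a b : ℝ, IntervalIntegrable (fun θ => Real.cos (u θ)) volume a b := fun a b =>
      (Real.continuous_cos.comp huc).intervalIntegrable _ _
    have h1 : ∫ θ in (-π : ℝ)..0, Real.cos (u θ) = ∫ θ in (0 : ℝ)..π, Real.cos (u θ) := by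
      have h2 : ∫ θ in (0 : ℝ)..π, Real.cos (u (-θ)) = ∫ θ in (-π : ℝ)..(-0), Real.cos (u θ) :=
        intervalIntegral.integral_comp_neg fun θ => Real.cos (u θ)
      rw [neg_zero] at h2
      rw [← h2]
      refine intervalIntegral.integral_congr fun θ _ => ?_
      simp only [hodd, Real.cos_neg]
    rw [← intervalIntegral.integral_add_adjacent_intervals (hcc (-π) 0) (hcc 0 π), h1]
    push_cast; ring
  rw [e1, hsin0, add_zero, hcos, besselJ_eq_integral_cos_holds n x]
  have hπ : (π : ℂ) ≠ 0 := by exact_mod_cast Real.pi_ne_zero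
  push_cast
  field_simp
  rfl

variable {X : ℝ} {φ : ℝ → ℂ}

/-- **The pairing of `J_n` with `ψ₀` is a Fourier coefficient of `Q`**:
`∫ J_n(x) ψ₀(x) dx = (2π)⁻¹ ∫_{-π}^{π} e^{inθ} Q(θ) dθ` (Fubini). [folklore] -/
theorem IsTest.integral_besselJ_mul_psi (h : IsTest X φ) (n : ℕ) :
    ∫ x, (besselJ n x : ℂ) * psi φ 0 x =
      (1 / (2 * π) : ℂ) * ∫ θ in (-π : ℝ)..π, Complex.exp (I * n * θ) * Qs φ θ := by
  set ψ := psi φ 0 with hψ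
  have hψi : Integrable ψ := h.integrable_psi 0
  have hψc : Continuous ψ := h.continuous_psi 0
  -- the two-variable integrand
  set F : ℝ → ℝ → ℂ := fun θ x => Complex.exp (I * n * θ) * (Complex.exp (-(I * Real.sin θ * x)) * ψ x) with hF
  have hFeq : ∀ θ x, Complex.exp (I * ((n : ℝ) * θ - x * Real.sin θ : ℝ)) * ψ x = F θ x := by
    intro θ x
    simp only [hF]
    rw [← mul_assoc, ← Complex.exp_add]
    congr 1; push_cast; ring_nf
  -- Fubini
  haveI : IsFiniteMeasure (volume.restrict (Set.uIoc (-π) π)) :=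
    isFiniteMeasure_restrict.2 (by
      rw [Set.uIoc_of_le (by linarith [Real.pi_pos]), Real.volume_Ioc]; exact ENNReal.ofReal_ne_top)
  have hint : Integrable (Function.uncurry F) ((volume.restrict (Set.uIoc (-π) π)).prod volume) := by
    have hm : Continuous (Function.uncurry F) := by
      simp only [hF]
      fun_prop
    refine Integrable.mono' (((integrable_const (1 : ℝ)).mul_prod hψi.norm)) hm.aestronglyMeasurable ?_
    refine Filter.Eventually.of_forall fun p => ?_
    simp only [hF, Function.uncurry, norm_mul, Complex.norm_exp]
    have e1 : (I * (n : ℂ) * (p.1 : ℂ)).re = 0 := by simp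
    have e2 : (-(I * (Real.sin p.1 : ℂ) * (p.2 : ℂ))).re = 0 := by
      simp [Complex.mul_re]
    rw [e1, e2, Real.exp_zero, one_mul, one_mul]
  have hswap := MeasureTheory.intervalIntegral_integral_swap hint
  -- the left side
  have hL : ∫ x, (besselJ n x : ℂ) * ψ x = (1 / (2 * π) : ℂ) * ∫ x, ∫ θ in (-π : ℝ)..π, F θ x := by
    rw [← integral_const_mul]
    refine integral_congr_ae (Filter.Eventually.of_forall fun x => ?_)
    dsimp only
    rw [besselJ_eq_integral_exp, mul_assoc, ← intervalIntegral.integral_mul_const]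
    congr 1
    exact intervalIntegral.integral_congr fun θ _ => hFeq θ x
  -- the inner integral on the right side
  have hR : ∀ θ, ∫ x, F θ x = Complex.exp (I * n * θ) * Qs φ θ := by
    intro θ
    simp only [hF]
    rw [integral_const_mul, Qs, four_eq_integral]
  rw [hL, ← hswap]
  congr 1
  exact intervalIntegral.integral_congr fun θ _ => hR θ

/-- **Integration by parts against `e^{inθ}` over a period**: for `u ∈ C¹` with `u(π) = u(-π)` and
`n ≠ 0`, `∫_{-π}^{π} e^{inθ} u = -(in)⁻¹ ∫_{-π}^{π} e^{inθ} u'`. [folklore] -/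
theorem integral_exp_mul_eq_of_periodic {u u' : ℝ → ℂ} {n : ℤ} (hn : n ≠ 0)
    (hu : ∀ θ, HasDerivAt u (u' θ) θ) (hu' : Continuous u') (hper : u π = u (-π)) :
    ∫ θ in (-π : ℝ)..π, Complex.exp (I * n * θ) * u θ =
      -(1 / (I * n)) * ∫ θ in (-π : ℝ)..π, Complex.exp (I * n * θ) * u' θ := by
  have hIn : (I * n : ℂ) ≠ 0 := mul_ne_zero Complex.I_ne_zero (by exact_mod_cast hn)
  -- `v = e^{inθ}/(in)`, `v' = e^{inθ}`
  set v : ℝ → ℂ := fun θ => Complex.exp (I * n * θ) / (I * n) with hv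
  have hv' : ∀ θ : ℝ, HasDerivAt v (Complex.exp (I * n * θ)) θ := by
    intro θ
    have h1 : HasDerivAt (fun θ : ℝ => I * n * (θ : ℂ)) (I * n) θ := by
      simpa using (Complex.ofRealCLM.hasDerivAt (x := θ)).const_mul (I * n)
    have h2 := (Complex.hasDerivAt_exp (I * n * θ)).comp θ h1
    have h3 := h2.div_const (I * n)
    have e : Complex.exp (I * n * θ) * (I * n) / (I * n) = Complex.exp (I * n * θ) := by field_simp
    rw [e] at h3
    exact h3
  have hvc : Continuous fun θ : ℝ => Complex.exp (I * n * θ) := by fun_prop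
  have hibp := intervalIntegral.integral_mul_deriv_eq_deriv_mul (a := -π) (b := π) (u := u) (v := v)
    (fun θ _ => hu θ) (fun θ _ => hv' θ) (hu'.intervalIntegrable _ _) (hvc.intervalIntegrable _ _)
  -- periodicity of `v`
  have hvper : v π = v (-π) := by
    simp only [hv]
    congr 1
    have : I * n * ((π : ℝ) : ℂ) = I * n * ((-π : ℝ) : ℂ) + (n : ℂ) * (2 * π * I) := by push_cast; ring
    rw [this, Complex.exp_add, Complex.exp_int_mul_two_pi_mul_I, mul_one]
  calc ∫ θ in (-π : ℝ)..π, Complex.exp (I * n * θ) * u θ = ∫ θ in (-π : ℝ)..π, u θ * Complex.exp (I * n * θ) := by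
        congr 1; funext θ; ring
    _ = u π * v π - u (-π) * v (-π) - ∫ θ in (-π : ℝ)..π, u' θ * v θ := hibp
    _ = -∫ θ in (-π : ℝ)..π, u' θ * v θ := by rw [hper, hvper]; ring
    _ = -(1 / (I * n)) * ∫ θ in (-π : ℝ)..π, Complex.exp (I * n * θ) * u' θ := by
        rw [← intervalIntegral.integral_const_mul, ← intervalIntegral.integral_neg]
        congr 1; funext θ; simp only [hv]; field_simp

/-- **Three integrations by parts**: `‖∫_{-π}^{π} e^{inθ} Q(θ) dθ‖ ≤ |n|⁻³ ∫_{-π}^{π} ‖Q'''‖` for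
`n ≠ 0` (the boundary terms vanish since `Q, Q', Q''` take equal values at `±π`). [folklore] -/
theorem IsTest.norm_integral_exp_mul_Qs_le (h : IsTest X φ) {n : ℤ} (hn : n ≠ 0) :
    ‖∫ θ in (-π : ℝ)..π, Complex.exp (I * n * θ) * Qs φ θ‖ ≤
      (∫ θ in (-π : ℝ)..π, ‖iteratedDeriv 3 (Qs φ) θ‖) / |(n : ℝ)| ^ 3 := by
  obtain ⟨e1, e2, e3⟩ := h.iteratedDeriv_Qs
  have hQ := h.contDiff_Qs
  -- `HasDerivAt` for `Q`, `Q'`, `Q''`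
  have hd : ∀ k : ℕ, ∀ θ, HasDerivAt (iteratedDeriv k (Qs φ)) (iteratedDeriv (k + 1) (Qs φ) θ) θ := by
    intro k θ
    have hdiff : Differentiable ℝ (iteratedDeriv k (Qs φ)) :=
      hQ.differentiable_iteratedDeriv k (WithTop.coe_lt_coe.mpr (ENat.coe_lt_top k))
    rw [iteratedDeriv_succ]
    exact (hdiff θ).hasDerivAt
  have hc : ∀ k : ℕ, Continuous (iteratedDeriv k (Qs φ)) := fun k =>
    hQ.continuous_iteratedDeriv k (WithTop.coe_le_coe.mpr le_top)
  -- periodicity of the boundary values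
  have hsinπ : Real.sin π = Real.sin (-π) := by rw [Real.sin_neg, Real.sin_pi, neg_zero]
  have hcosπ : Real.cos π = Real.cos (-π) := by rw [Real.cos_neg]
  have hp0 : iteratedDeriv 0 (Qs φ) π = iteratedDeriv 0 (Qs φ) (-π) := by
    simp only [iteratedDeriv_zero, Qs, hsinπ]
  have hp1 : iteratedDeriv 1 (Qs φ) π = iteratedDeriv 1 (Qs φ) (-π) := by
    rw [e1]; simp only [hsinπ, hcosπ]
  have hp2 : iteratedDeriv 2 (Qs φ) π = iteratedDeriv 2 (Qs φ) (-π) := by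
    rw [e2]; simp only [hsinπ, hcosπ]
  -- three integrations by parts
  have s0 := integral_exp_mul_eq_of_periodic hn (hd 0) (hc 1) hp0
  have s1 := integral_exp_mul_eq_of_periodic hn (hd 1) (hc 2) hp1
  have s2 := integral_exp_mul_eq_of_periodic hn (hd 2) (hc 3) hp2
  rw [iteratedDeriv_zero] at s0
  simp only [show (0 : ℕ) + 1 = 1 from rfl] at s0
  simp only [show (1 : ℕ) + 1 = 2 from rfl] at s1
  simp only [show (2 : ℕ) + 1 = 3 from rfl] at s2
  rw [s0, s1, s2]
  have hIn : ‖(I * n : ℂ)‖ = |(n : ℝ)| := by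
    rw [norm_mul, Complex.norm_I, one_mul, Complex.norm_intCast]
  have hc3 : ‖-(1 / (I * (n : ℂ)))‖ = |(n : ℝ)|⁻¹ := by rw [norm_neg, norm_div, norm_one, hIn, one_div]
  rw [norm_mul, norm_mul, norm_mul, hc3]
  have hn0 : 0 < |(n : ℝ)| := abs_pos.2 (by exact_mod_cast hn)
  have hπ := Real.pi_pos
  have hI : ‖∫ θ in (-π : ℝ)..π, Complex.exp (I * n * θ) * iteratedDeriv 3 (Qs φ) θ‖ ≤
      ∫ θ in (-π : ℝ)..π, ‖iteratedDeriv 3 (Qs φ) θ‖ := by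
    calc ‖∫ θ in (-π : ℝ)..π, Complex.exp (I * n * θ) * iteratedDeriv 3 (Qs φ) θ‖
        ≤ ∫ θ in (-π : ℝ)..π, ‖Complex.exp (I * n * θ) * iteratedDeriv 3 (Qs φ) θ‖ :=
          intervalIntegral.norm_integral_le_integral_norm (by linarith)
      _ = ∫ θ in (-π : ℝ)..π, ‖iteratedDeriv 3 (Qs φ) θ‖ := by
          congr 1; funext θ
          rw [norm_mul, Complex.norm_exp]
          have : (I * (n : ℂ) * (θ : ℂ)).re = 0 := by simp
          rw [this, Real.exp_zero, one_mul]
  calc |(n : ℝ)|⁻¹ * (|(n : ℝ)|⁻¹ * (|(n : ℝ)|⁻¹ * ‖∫ θ in (-π : ℝ)..π, Complex.exp (I * n * θ) * iteratedDeriv 3 (Qs φ) θ‖))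
      ≤ |(n : ℝ)|⁻¹ * (|(n : ℝ)|⁻¹ * (|(n : ℝ)|⁻¹ * ∫ θ in (-π : ℝ)..π, ‖iteratedDeriv 3 (Qs φ) θ‖)) := by
        gcongr
    _ = (∫ θ in (-π : ℝ)..π, ‖iteratedDeriv 3 (Qs φ) θ‖) / |(n : ℝ)| ^ 3 := by
        field_simp

/-- **The holomorphic pairing, uniform bound**: `‖∫ J_n ψ₀‖ ≤ 6144 Λ(X)` for all `n`. [folklore] -/
theorem IsTest.norm_integral_besselJ_mul_psi_le (h : IsTest X φ) (n : ℕ) :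
    ‖∫ x, (besselJ n x : ℂ) * psi φ 0 x‖ ≤ 6144 * Lam X := by
  rw [h.integral_besselJ_mul_psi n, norm_mul]
  have hπ := Real.pi_pos
  have hc : ‖(1 / (2 * π) : ℂ)‖ = 1 / (2 * π) := by
    rw [show (1 / (2 * π) : ℂ) = ((1 / (2 * π) : ℝ) : ℂ) by push_cast; ring, Complex.norm_real,
      Real.norm_eq_abs, abs_of_pos (by positivity)]
  rw [hc]
  have hI : ‖∫ θ in (-π : ℝ)..π, Complex.exp (I * n * θ) * Qs φ θ‖ ≤ ∫ θ in (-π : ℝ)..π, ‖Qs φ θ‖ := by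
    calc ‖∫ θ in (-π : ℝ)..π, Complex.exp (I * n * θ) * Qs φ θ‖
        ≤ ∫ θ in (-π : ℝ)..π, ‖Complex.exp (I * n * θ) * Qs φ θ‖ :=
          intervalIntegral.norm_integral_le_integral_norm (by linarith)
      _ = ∫ θ in (-π : ℝ)..π, ‖Qs φ θ‖ := by
          congr 1; funext θ
          rw [norm_mul, Complex.norm_exp]
          have : (I * (n : ℂ) * (θ : ℂ)).re = 0 := by simp
          rw [this, Real.exp_zero, one_mul]
  calc 1 / (2 * π) * ‖∫ θ in (-π : ℝ)..π, Complex.exp (I * n * θ) * Qs φ θ‖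
      ≤ 1 / (2 * π) * (12288 * π * Lam X) :=
        mul_le_mul_of_nonneg_left (hI.trans h.integral_norm_Qs_le) (by positivity)
    _ = 6144 * Lam X := by field_simp; ring

/-- **The holomorphic pairing, decay**: `‖∫ J_n ψ₀‖ ≤ 30720 Λ(X)(1+X)³/n³` for `n ≥ 1`. [folklore] -/
theorem IsTest.norm_integral_besselJ_mul_psi_le_decay (h : IsTest X φ) {n : ℕ} (hn : 1 ≤ n) :
    ‖∫ x, (besselJ n x : ℂ) * psi φ 0 x‖ ≤ 30720 * Lam X * (1 + X) ^ 3 / (n : ℝ) ^ 3 := by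
  rw [h.integral_besselJ_mul_psi n, norm_mul]
  have hπ := Real.pi_pos
  have hX := h.pos
  have hc : ‖(1 / (2 * π) : ℂ)‖ = 1 / (2 * π) := by
    rw [show (1 / (2 * π) : ℂ) = ((1 / (2 * π) : ℝ) : ℂ) by push_cast; ring, Complex.norm_real,
      Real.norm_eq_abs, abs_of_pos (by positivity)]
  rw [hc]
  have hn0 : (n : ℤ) ≠ 0 := by exact_mod_cast (by omega : n ≠ 0)
  have hI := h.norm_integral_exp_mul_Qs_le hn0
  push_cast at hI
  rw [abs_of_nonneg (Nat.cast_nonneg n)] at hI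
  have hn3 : 0 < (n : ℝ) ^ 3 := by positivity
  calc 1 / (2 * π) * ‖∫ θ in (-π : ℝ)..π, Complex.exp (I * n * θ) * Qs φ θ‖
      ≤ 1 / (2 * π) * ((61440 * π * Lam X * (1 + X) ^ 3) / (n : ℝ) ^ 3) := by
        apply mul_le_mul_of_nonneg_left _ (by positivity)
        exact hI.trans (div_le_div_of_nonneg_right h.integral_norm_iteratedDeriv_three_Qs_le hn3.le)
    _ = 30720 * Lam X * (1 + X) ^ 3 / (n : ℝ) ^ 3 := by field_simp; ring

end Bessel

/-! ### Combining a uniform bound and a cubic decay into `Λ ω` -/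

/-- If `V ≤ C₁ Λ` and, for `t ≠ 0`, `V ≤ C₂ Λ (1+X)³/|t|³`, then
`V ≤ 8 max(C₁, C₂) Λ min(1, ((1+X)/(1+|t|))³)`. [folklore] -/
theorem le_Lam_omega_of_bounds {V L C₁ C₂ X t : ℝ} (hL : 0 ≤ L) (hX : 0 ≤ X) (hC₁ : 0 ≤ C₁)
    (h1 : V ≤ C₁ * L) (h2 : t ≠ 0 → V ≤ C₂ * L * (1 + X) ^ 3 / |t| ^ 3) :
    V ≤ 8 * max C₁ C₂ * L * min 1 ((1 + X) ^ 3 / (1 + |t|) ^ 3) := by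
  have hmax1 : C₁ ≤ max C₁ C₂ := le_max_left _ _
  have hmax2 : C₂ ≤ max C₁ C₂ := le_max_right _ _
  have hM0 : 0 ≤ max C₁ C₂ := hC₁.trans hmax1
  have hX3 : 1 ≤ (1 + X) ^ 3 := one_le_pow₀ (by linarith)
  have ht0 : 0 ≤ |t| := abs_nonneg t
  rcases le_or_gt |t| 1 with ht | ht
  · -- `|t| ≤ 1`: `ω ≥ 1/8`
    have hω : (1 : ℝ) / 8 ≤ min 1 ((1 + X) ^ 3 / (1 + |t|) ^ 3) := by
      apply le_min (by norm_num)
      rw [le_div_iff₀ (by positivity)]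
      have : (1 + |t|) ^ 3 ≤ 8 := by
        calc (1 + |t|) ^ 3 ≤ 2 ^ 3 := pow_le_pow_left₀ (by positivity) (by linarith) 3
          _ = 8 := by norm_num
      nlinarith
    calc V ≤ C₁ * L := h1
      _ ≤ max C₁ C₂ * L := mul_le_mul_of_nonneg_right hmax1 hL
      _ = 8 * max C₁ C₂ * L * (1 / 8) := by ring
      _ ≤ 8 * max C₁ C₂ * L * min 1 ((1 + X) ^ 3 / (1 + |t|) ^ 3) :=
          mul_le_mul_of_nonneg_left hω (by positivity)
  · -- `|t| > 1`
    have htne : t ≠ 0 := by intro h0; rw [h0, abs_zero] at ht; linarith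
    have h2' := h2 htne
    set r := (1 + X) ^ 3 / (1 + |t|) ^ 3 with hr
    have hr0 : 0 ≤ r := by positivity
    -- `(1+X)³/|t|³ ≤ 8 r`
    have hrr : (1 + X) ^ 3 / |t| ^ 3 ≤ 8 * r := by
      have hp : (1 + |t|) ^ 3 ≤ 8 * |t| ^ 3 := by
        calc (1 + |t|) ^ 3 ≤ (2 * |t|) ^ 3 := pow_le_pow_left₀ (by positivity) (by linarith) 3
          _ = 8 * |t| ^ 3 := by ring
      have ht3 : 0 < |t| ^ 3 := by positivity
      calc (1 + X) ^ 3 / |t| ^ 3 = ((1 + X) ^ 3 * 8) / (8 * |t| ^ 3) := by field_simp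
        _ ≤ ((1 + X) ^ 3 * 8) / (1 + |t|) ^ 3 := div_le_div_of_nonneg_left (by positivity) (by positivity) hp
        _ = 8 * r := by rw [hr]; ring
    rcases le_or_gt 1 r with hr1 | hr1
    · rw [min_eq_left hr1]
      calc V ≤ C₁ * L := h1
        _ ≤ 8 * max C₁ C₂ * L * 1 := by nlinarith
    · rw [min_eq_right hr1.le]
      calc V ≤ C₂ * L * (1 + X) ^ 3 / |t| ^ 3 := h2'
        _ = C₂ * L * ((1 + X) ^ 3 / |t| ^ 3) := by ring
        _ ≤ max C₁ C₂ * L * (8 * r) := mul_le_mul (mul_le_mul_of_nonneg_right hmax2 hL) hrr (by positivity) (by positivity)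
        _ = 8 * max C₁ C₂ * L * r := by ring

/-- The trivial bound for weighted integrals: `‖4 ∫ w H‖ ≤ 4 ∫ ‖H‖` when `|w| ≤ 1`. [folklore] -/
theorem norm_unit_weight_integral_le {H : ℝ → ℂ} {w : ℝ → ℝ} (hw : ∀ ξ, |w ξ| ≤ 1) (hH : Integrable H) :
    ‖4 * ∫ ξ, (w ξ : ℂ) * H ξ‖ ≤ 4 * ∫ ξ, ‖H ξ‖ := by
  rw [norm_mul, Complex.norm_ofNat]
  gcongr
  calc ‖∫ ξ, (w ξ : ℂ) * H ξ‖ ≤ ∫ ξ, ‖(w ξ : ℂ) * H ξ‖ := norm_integral_le_integral_norm _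
    _ ≤ ∫ ξ, ‖H ξ‖ := by
        apply integral_mono_of_nonneg (Filter.Eventually.of_forall fun ξ => norm_nonneg _) hH.norm
        exact Filter.Eventually.of_forall fun ξ => by
          dsimp only
          rw [norm_mul, Complex.norm_real, Real.norm_eq_abs]
          exact mul_le_of_le_one_left (norm_nonneg _) (hw ξ)

end Literature.NumberTheory.Sieve.BFI.L1.Kuz

/-! ## The concrete transforms and the discharge of hypothesis (W) -/

namespace Literature.NumberTheory.Sieve.BFI.L1

open Kuz Literature.Analysis.FunctionSpaces

/-- **The Kuznetsov–Bessel transforms in Mehler–Sonine form.**  For a test function `φ` (in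
Kuznetsov's formula: smooth with compact support in `(0, ∞)`) put
`P(w) = ∫ cos(wx) φ(x) dx/x` (`Kuz.Pk φ 0 w`).  Then

* `Tpl φ t = 4 ∫_ℝ cos(2tξ) P(cosh ξ) dξ` — this is `φ̃(t) = (2πi/sinh πt) ∫₀^∞ (J_{2it}(x) − J_{−2it}(x)) φ(x) dx/x`
  of [Drappeau2017, (4.12)] (`κ = 0`) by the Mehler–Sonine formula
  `J_ν(x) − J_{−ν}(x)` / Schläfli: `(J_{2it} − J_{−2it})(x) = −(4i/π) sinh(πt) ∫₀^∞ cos(x cosh ξ) cos(2tξ) dξ`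
  [Watson, *Bessel functions*, §6.21 (1); EMOT II p. 82; DeshouillersIwaniec1982, p. 264];
* `Tmi φ t = 4 ∫_ℝ cos(2tξ) P(sinh ξ) dξ` — this is `φ̌(t) = 8 cosh(πt) ∫₀^∞ K_{2it}(x) φ(x) dx/x` of
  [Drappeau2017, (4.13)] by `cosh(πt) K_{2it}(x) = ∫₀^∞ cos(x sinh ξ) cos(2tξ) dξ`
  [Watson §6.22; EMOT II p. 82; DeshouillersIwaniec1982, p. 264];
* `TplX φ y`, `TmiX φ y` — the same with `cosh(2yξ)` in place of `cos(2tξ)`: the values `φ̃(iy)`,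
  `φ̌(iy)` at the exceptional spectral parameters (`0 < y < 1/2`);
* `Thol φ k = 4 i^k ∫ J_{k−1}(x) φ(x) dx/x` ([Drappeau2017, (4.11)]; the tree's `besselJ` of
  natural order; the index `k − 1` is a natural-number subtraction, immaterial since holomorphic cusp
  forms have weight `k ≥ 2`).

The double integrals are absolutely convergent (unlike the Bessel kernels' `ξ`-integrals), which is
what makes the bounds of `transformBound_kuzTransforms` elementary.  The identification with the
Bessel-function form is the classical pair of formulae quoted above (exchange of the order of
integration is justified by the uniform boundedness of the truncated `ξ`-integrals); it is not needed
for the bounds and is left to the instantiation of `KuzPlus`/`KuzMinus`.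
[cite: Drappeau2017, §4.1.3 (4.11)–(4.13); DeshouillersIwaniec1982, (1.21)–(1.23) & p. 264] -/
def kuzTransforms : KuzTransforms where
  Tpl := fun φ t => 4 * ∫ ξ, (Real.cos (2 * t * ξ) : ℂ) * Kuz.IsTest.Hp φ ξ
  Tmi := fun φ t => 4 * ∫ ξ, (Real.cos (2 * t * ξ) : ℂ) * Kuz.IsTest.Hm φ ξ
  TplX := fun φ y => 4 * ∫ ξ, (Real.cosh (2 * y * ξ) : ℂ) * Kuz.IsTest.Hp φ ξ
  TmiX := fun φ y => 4 * ∫ ξ, (Real.cosh (2 * y * ξ) : ℂ) * Kuz.IsTest.Hm φ ξ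
  Thol := fun φ k => 4 * I ^ k * ∫ x, (besselJ (k - 1) x : ℂ) * Kuz.IsTest.psi φ 0 x

/-- `Kuz.Lam = LamT`. [folklore] -/
theorem Lam_eq_LamT (X : ℝ) : Kuz.Lam X = LamT X := rfl

/-- **Hypothesis (W) holds for the genuine transforms**, with the absolute constant `A = 6144000`:
the bounds of [DeshouillersIwaniec1982, Lemma 7.1] in the form `TransformBoundAt` (Fourier decay from
three `ξ`-derivatives for `φ̃, φ̌`; three integrations by parts in Bessel's integral for `φ̇`; the
exceptional bounds by splitting the `ξ`-integral at `cosh ξ ≍ 1/X`).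
[cite: DeshouillersIwaniec1982, Lemma 7.1 (7.1)–(7.4); Drappeau2017, Lemma 4.4] -/
theorem transformBoundAt_kuzTransforms : TransformBoundAt kuzTransforms 6144000 := by
  intro X hX φ hφ1 hφ2 hφ3
  have h : Kuz.IsTest X φ := ⟨hX, hφ1, hφ2, hφ3⟩
  have hΛ0 : 0 ≤ LamT X := LamT_nonneg hX.le
  have hX3 : (1 : ℝ) ≤ (1 + X) ^ 3 := one_le_pow₀ (by linarith)
  -- `Tpl`
  have hTpl : ∀ t : ℝ, ‖kuzTransforms.Tpl φ t‖ ≤ 6144000 * LamT X * omegaT X t := by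
    intro t
    have hH0 : Integrable (Kuz.IsTest.Hp φ) := by simpa using h.integrable_iteratedDeriv_Hp (n := 0) (by norm_num)
    have u1 : ‖kuzTransforms.Tpl φ t‖ ≤ 393216 * LamT X := by
      calc ‖kuzTransforms.Tpl φ t‖ ≤ 4 * ∫ ξ, ‖Kuz.IsTest.Hp φ ξ‖ :=
            norm_unit_weight_integral_le (fun ξ => Real.abs_cos_le_one _) hH0
        _ ≤ 4 * (98304 * LamT X) := by gcongr; exact h.integral_norm_Hp_le
        _ = 393216 * LamT X := by ring
    have u2 : t ≠ 0 → ‖kuzTransforms.Tpl φ t‖ ≤ 245760 * LamT X * (1 + X) ^ 3 / |t| ^ 3 := by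
      intro ht
      have hC3 : ContDiff ℝ 3 (Kuz.IsTest.Hp φ) := h.contDiff_Hp.of_le (WithTop.coe_le_coe.mpr le_top)
      have hd := norm_cos_transform_le_of_C3 hC3 (fun n hn => h.integrable_iteratedDeriv_Hp hn) ht
      have ht3 : 0 < |t| ^ 3 := by positivity
      calc ‖kuzTransforms.Tpl φ t‖ ≤ (∫ x, ‖iteratedDeriv 3 (Kuz.IsTest.Hp φ) x‖) / (2 * |t| ^ 3) := hd
        _ ≤ (491520 * LamT X) / (2 * |t| ^ 3) :=
            div_le_div_of_nonneg_right h.integral_norm_iteratedDeriv_three_Hp_le (by positivity)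
        _ = 245760 * LamT X * 1 / |t| ^ 3 := by field_simp; ring
        _ ≤ 245760 * LamT X * (1 + X) ^ 3 / |t| ^ 3 := by gcongr
    have := le_Lam_omega_of_bounds hΛ0 hX.le (by norm_num) u1 u2
    have hω0 : 0 ≤ min 1 ((1 + X) ^ 3 / (1 + |t|) ^ 3) := le_min zero_le_one (by positivity)
    calc ‖kuzTransforms.Tpl φ t‖ ≤ 8 * max 393216 245760 * LamT X * min 1 ((1 + X) ^ 3 / (1 + |t|) ^ 3) := this
      _ ≤ 6144000 * LamT X * min 1 ((1 + X) ^ 3 / (1 + |t|) ^ 3) := by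
          apply mul_le_mul_of_nonneg_right _ hω0
          rw [show max (393216 : ℝ) 245760 = 393216 by norm_num]
          nlinarith
      _ = 6144000 * LamT X * omegaT X t := by unfold omegaT; rfl
  -- `Tmi`
  have hTmi : ∀ t : ℝ, ‖kuzTransforms.Tmi φ t‖ ≤ 6144000 * LamT X * omegaT X t := by
    intro t
    have hH0 : Integrable (Kuz.IsTest.Hm φ) := by simpa using h.integrable_iteratedDeriv_Hm (n := 0) (by norm_num)
    have u1 : ‖kuzTransforms.Tmi φ t‖ ≤ 491520 * LamT X := by
      calc ‖kuzTransforms.Tmi φ t‖ ≤ 4 * ∫ ξ, ‖Kuz.IsTest.Hm φ ξ‖ :=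
            norm_unit_weight_integral_le (fun ξ => Real.abs_cos_le_one _) hH0
        _ ≤ 4 * (122880 * LamT X) := by gcongr; exact h.integral_norm_Hm_le
        _ = 491520 * LamT X := by ring
    have u2 : t ≠ 0 → ‖kuzTransforms.Tmi φ t‖ ≤ 768000 * LamT X * (1 + X) ^ 3 / |t| ^ 3 := by
      intro ht
      have hC3 : ContDiff ℝ 3 (Kuz.IsTest.Hm φ) := h.contDiff_Hm.of_le (WithTop.coe_le_coe.mpr le_top)
      have hd := norm_cos_transform_le_of_C3 hC3 (fun n hn => h.integrable_iteratedDeriv_Hm hn) ht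
      have ht3 : 0 < |t| ^ 3 := by positivity
      calc ‖kuzTransforms.Tmi φ t‖ ≤ (∫ x, ‖iteratedDeriv 3 (Kuz.IsTest.Hm φ) x‖) / (2 * |t| ^ 3) := hd
        _ ≤ (1536000 * LamT X * (1 + X) ^ 3) / (2 * |t| ^ 3) :=
            div_le_div_of_nonneg_right h.integral_norm_iteratedDeriv_three_Hm_le (by positivity)
        _ = 768000 * LamT X * (1 + X) ^ 3 / |t| ^ 3 := by field_simp; ring
    have := le_Lam_omega_of_bounds hΛ0 hX.le (by norm_num) u1 u2
    have hω0 : 0 ≤ min 1 ((1 + X) ^ 3 / (1 + |t|) ^ 3) := le_min zero_le_one (by positivity)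
    calc ‖kuzTransforms.Tmi φ t‖ ≤ 8 * max 491520 768000 * LamT X * min 1 ((1 + X) ^ 3 / (1 + |t|) ^ 3) := this
      _ ≤ 6144000 * LamT X * min 1 ((1 + X) ^ 3 / (1 + |t|) ^ 3) := by
          apply mul_le_mul_of_nonneg_right _ hω0
          rw [show max (491520 : ℝ) 768000 = 768000 by norm_num]
          nlinarith
      _ = 6144000 * LamT X * omegaT X t := by unfold omegaT; rfl
  -- `Thol`
  have hThol : ∀ k : ℕ, ‖kuzTransforms.Thol φ k‖ ≤ 6144000 * LamT X * omegaT X k := by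
    intro k
    have hnorm : ‖kuzTransforms.Thol φ k‖ = 4 * ‖∫ x, (besselJ (k - 1) x : ℂ) * Kuz.IsTest.psi φ 0 x‖ := by
      show ‖4 * I ^ k * ∫ x, (besselJ (k - 1) x : ℂ) * Kuz.IsTest.psi φ 0 x‖ = _
      rw [norm_mul, norm_mul, norm_pow, Complex.norm_I, one_pow, mul_one, Complex.norm_ofNat]
    have u1 : ‖kuzTransforms.Thol φ k‖ ≤ 24576 * LamT X := by
      rw [hnorm]
      calc 4 * ‖∫ x, (besselJ (k - 1) x : ℂ) * Kuz.IsTest.psi φ 0 x‖ ≤ 4 * (6144 * LamT X) := by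
            gcongr; exact h.norm_integral_besselJ_mul_psi_le (k - 1)
        _ = 24576 * LamT X := by ring
    have hωdef : omegaT X k = min 1 ((1 + X) ^ 3 / (1 + (k : ℝ)) ^ 3) := by
      unfold omegaT; rw [Nat.abs_cast]
    rw [hωdef]
    rcases le_or_gt k 1 with hk | hk
    · -- `k ≤ 1`: `ω ≥ 1/8`
      have hk' : (k : ℝ) ≤ 1 := by exact_mod_cast hk
      have hω : (1 : ℝ) / 8 ≤ min 1 ((1 + X) ^ 3 / (1 + (k : ℝ)) ^ 3) := by
        apply le_min (by norm_num)
        rw [le_div_iff₀ (by positivity)]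
        have hk0 : (0 : ℝ) ≤ k := Nat.cast_nonneg k
        have : (1 + (k : ℝ)) ^ 3 ≤ 8 := by
          calc (1 + (k : ℝ)) ^ 3 ≤ 2 ^ 3 := pow_le_pow_left₀ (by positivity) (by linarith) 3
            _ = 8 := by norm_num
        nlinarith
      calc ‖kuzTransforms.Thol φ k‖ ≤ 24576 * LamT X := u1
        _ = 8 * 24576 * LamT X * (1 / 8) := by ring
        _ ≤ 8 * 24576 * LamT X * min 1 ((1 + X) ^ 3 / (1 + (k : ℝ)) ^ 3) :=
            mul_le_mul_of_nonneg_left hω (by positivity)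
        _ ≤ 6144000 * LamT X * min 1 ((1 + X) ^ 3 / (1 + (k : ℝ)) ^ 3) := by
            apply mul_le_mul_of_nonneg_right _ (le_trans (by norm_num) hω)
            nlinarith
    · -- `k ≥ 2`: decay in `k`
      have hk1 : 1 ≤ k - 1 := by omega
      have u2 := h.norm_integral_besselJ_mul_psi_le_decay hk1
      have hkR : ((k - 1 : ℕ) : ℝ) = (k : ℝ) - 1 := by
        rw [Nat.cast_sub (by omega)]; simp
      rw [hkR] at u2
      have hk2 : (2 : ℝ) ≤ k := by exact_mod_cast hk
      have hkm : 0 < (k : ℝ) - 1 := by linarith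
      -- `(1+k)³ ≤ 27 (k-1)³`
      have hratio : (1 + X) ^ 3 / ((k : ℝ) - 1) ^ 3 ≤ 27 * ((1 + X) ^ 3 / (1 + (k : ℝ)) ^ 3) := by
        have h27 : (1 + (k : ℝ)) ^ 3 ≤ 27 * ((k : ℝ) - 1) ^ 3 := by
          have : 1 + (k : ℝ) ≤ 3 * ((k : ℝ) - 1) := by linarith
          calc (1 + (k : ℝ)) ^ 3 ≤ (3 * ((k : ℝ) - 1)) ^ 3 := pow_le_pow_left₀ (by positivity) this 3
            _ = 27 * ((k : ℝ) - 1) ^ 3 := by ring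
        have hkm3 : 0 < ((k : ℝ) - 1) ^ 3 := by positivity
        calc (1 + X) ^ 3 / ((k : ℝ) - 1) ^ 3 = ((1 + X) ^ 3 * 27) / (27 * ((k : ℝ) - 1) ^ 3) := by field_simp
          _ ≤ ((1 + X) ^ 3 * 27) / (1 + (k : ℝ)) ^ 3 := div_le_div_of_nonneg_left (by positivity) (by positivity) h27
          _ = 27 * ((1 + X) ^ 3 / (1 + (k : ℝ)) ^ 3) := by ring
      have v2 : ‖kuzTransforms.Thol φ k‖ ≤ 3317760 * LamT X * ((1 + X) ^ 3 / (1 + (k : ℝ)) ^ 3) := by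
        rw [hnorm]
        calc 4 * ‖∫ x, (besselJ (k - 1) x : ℂ) * Kuz.IsTest.psi φ 0 x‖
            ≤ 4 * (30720 * Kuz.Lam X * (1 + X) ^ 3 / ((k : ℝ) - 1) ^ 3) := by gcongr
          _ = 122880 * LamT X * ((1 + X) ^ 3 / ((k : ℝ) - 1) ^ 3) := by rw [Lam_eq_LamT]; ring
          _ ≤ 122880 * LamT X * (27 * ((1 + X) ^ 3 / (1 + (k : ℝ)) ^ 3)) :=
              mul_le_mul_of_nonneg_left hratio (by positivity)
          _ = 3317760 * LamT X * ((1 + X) ^ 3 / (1 + (k : ℝ)) ^ 3) := by ring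
      rcases le_or_gt 1 ((1 + X) ^ 3 / (1 + (k : ℝ)) ^ 3) with hr | hr
      · rw [min_eq_left hr]
        calc ‖kuzTransforms.Thol φ k‖ ≤ 24576 * LamT X := u1
          _ ≤ 6144000 * LamT X * 1 := by nlinarith
      · rw [min_eq_right hr.le]
        calc ‖kuzTransforms.Thol φ k‖ ≤ 3317760 * LamT X * ((1 + X) ^ 3 / (1 + (k : ℝ)) ^ 3) := v2
          _ ≤ 6144000 * LamT X * ((1 + X) ^ 3 / (1 + (k : ℝ)) ^ 3) := by
              apply mul_le_mul_of_nonneg_right _ (by positivity); nlinarith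
  -- the exceptional values
  have hExc : ∀ y : ℝ, 0 < y → y ≤ 1 / 4 →
      ‖kuzTransforms.TplX φ y‖ ≤ 6144000 * LamT X * (1 + X ^ (-2 * y)) ∧
        ‖kuzTransforms.TmiX φ y‖ ≤ 6144000 * LamT X * (1 + X ^ (-2 * y)) := by
    intro y hy0 hy
    have hpow : 0 ≤ X ^ (-2 * y) := by positivity
    have hΛ1 : 0 ≤ LamT X * (1 + X ^ (-2 * y)) := by positivity
    constructor
    · have hB : ∀ ξ, ‖Kuz.IsTest.Hp φ ξ‖ ≤ 1536 * (max 1 (X * Real.cosh ξ))⁻¹ := h.norm_Hp_le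
      have hwB : Integrable fun ξ => |Real.cosh (2 * y * ξ)| * (1536 * (max 1 (X * Real.cosh ξ))⁻¹) := by
        have := (integrable_cosh_div_max hX hy0.le hy).const_mul 1536
        refine this.congr (Filter.Eventually.of_forall fun ξ => ?_)
        dsimp only
        rw [abs_of_pos (Real.cosh_pos _)]; ring
      have := norm_weighted_integral_le (w := fun ξ => Real.cosh (2 * y * ξ)) hB hwB
      calc ‖kuzTransforms.TplX φ y‖ ≤ 4 * ∫ ξ, |Real.cosh (2 * y * ξ)| * (1536 * (max 1 (X * Real.cosh ξ))⁻¹) := this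
        _ = 6144 * ∫ ξ, Real.cosh (2 * y * ξ) * (max 1 (X * Real.cosh ξ))⁻¹ := by
            rw [← integral_const_mul, ← integral_const_mul]
            congr 1; funext ξ; rw [abs_of_pos (Real.cosh_pos _)]; ring
        _ ≤ 6144 * (32 * Kuz.Lam X * (1 + X ^ (-2 * y))) := by gcongr; exact integral_cosh_div_max_le hX hy0.le hy
        _ = 196608 * (LamT X * (1 + X ^ (-2 * y))) := by rw [Lam_eq_LamT]; ring
        _ ≤ 6144000 * (LamT X * (1 + X ^ (-2 * y))) := by gcongr; norm_num
        _ = _ := by ring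
    · have hB : ∀ ξ, ‖Kuz.IsTest.Hm φ ξ‖ ≤ 1536 * (max 1 (X * |Real.sinh ξ|))⁻¹ := h.norm_Hm_le
      have hwB : Integrable fun ξ => |Real.cosh (2 * y * ξ)| * (1536 * (max 1 (X * |Real.sinh ξ|))⁻¹) := by
        have := (integrable_cosh_div_max_sinh hX hy0.le hy).const_mul 1536
        refine this.congr (Filter.Eventually.of_forall fun ξ => ?_)
        dsimp only
        rw [abs_of_pos (Real.cosh_pos _)]; ring
      have := norm_weighted_integral_le (w := fun ξ => Real.cosh (2 * y * ξ)) hB hwB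
      calc ‖kuzTransforms.TmiX φ y‖ ≤ 4 * ∫ ξ, |Real.cosh (2 * y * ξ)| * (1536 * (max 1 (X * |Real.sinh ξ|))⁻¹) := this
        _ = 6144 * ∫ ξ, Real.cosh (2 * y * ξ) * (max 1 (X * |Real.sinh ξ|))⁻¹ := by
            rw [← integral_const_mul, ← integral_const_mul]
            congr 1; funext ξ; rw [abs_of_pos (Real.cosh_pos _)]; ring
        _ ≤ 6144 * (40 * Kuz.Lam X * (1 + X ^ (-2 * y))) := by
            gcongr; exact integral_cosh_div_max_sinh_le hX hy0.le hy
        _ = 245760 * (LamT X * (1 + X ^ (-2 * y))) := by rw [Lam_eq_LamT]; ring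
        _ ≤ 6144000 * (LamT X * (1 + X ^ (-2 * y))) := by gcongr; norm_num
        _ = _ := by ring
  exact ⟨hTpl, hTmi, hThol, hExc⟩

/-- **`TransformBound kuzTransforms`**: hypothesis (W) of `H91At_of_kuznetsov` is discharged for the
genuine (Mehler–Sonine form of the) Kuznetsov–Bessel transforms. [cite: DeshouillersIwaniec1982, Lemma 7.1] -/
theorem transformBound_kuzTransforms : TransformBound kuzTransforms :=
  ⟨6144000, by norm_num, transformBoundAt_kuzTransforms⟩

end Literature.NumberTheory.Sieve.BFI.L1
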